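import Literature.Geometry.Lorentzian.CoordScalarGradientEvolution
import Literature.Geometry.Riemannian.WeightedHeatFlowNoncompact
import HarnessLib
/-!
# The weighted heat flow on a complete `CD(K,∞)` manifold with first-order (Gaffney) cut-offs, I: weighted Green identities,
# Gaffney cut-offs, the Stampacchia weak maximum principle, the energy estimate, the `Γ₂`-slack, gradient decay
# `|∇ρ(s)|² ≤ e^{-2Ks} sup |∇ρ₀|²`, a-priori bounds and conservation of mass (Bakry–Gentil–Ledoux 2014 §3.2; Grigor'yan 2009 §§11–12)

**The `L²` ("finite energy") route of Bakry–Gentil–Ledoux, *Analysis and Geometry of Markov Diffusion Operators* (2014)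
§3.2, pp. 141–147 [BakryGentilLedoux2014] for the weighted heat flow `∂ₛρ = Δ_g ρ − g⁻¹(dV, dρ)` on a COMPLETE weighted Riemannian
manifold `(M, g, e^{-V} dV_g)` under `CD(K,∞)`: `Ric_g + Hess V ≥ K g`, run with FIRST-ORDER (Gaffney 1954) cut-offs only
(`η_k → 1`, `|∇η_k|² ≤ C₀/(k+1)²`; no bound on `Lη_k` exists in this generality)** — weighted Green identities with one compactly
supported factor (Carrillo–Ni 2009 §4 [CarrilloNi2009]), differentiation of space-time slices, the Gaffney cut-off sequence and the
first-order integration-by-parts toolkit, the Stampacchia weak maximum principle for `𝕃²` solutions by the energy method with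
cut-offs (Grigor'yan, *Heat Kernel and Analysis on Manifolds* (2009) §11.4, §12.1 [Grigoryan2009]), the energy estimate, the
pointwise `Γ₂`-slack bound `g⁻¹(dη, d|∇u|²)² ≤ 4|∇η|²|∇u|²·‖Hess u‖²` (BGL §C.6), the dissipation inequality of the gradient
subsolution and the gradient decay `|∇ρ(s)|² ≤ e^{-2Ks} sup|∇ρ₀|²` (BGL Thm. 3.2.3/3.2.4), the a-priori bounds `a ≤ ρ ≤ b`, and
conservation of mass (BGL Thm. 3.2.6).
RE-HOMED into `Literature/` by the Hodge foundations lane (`lit-hodgefound`, seat p20, generation 41): verbatim DECLARATION-LEVEL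
ports, in dependency order and each under its original module docstring, of the theorems of the theorem-only modules
`Summits/SmoothPoincare4/SmoothPoincare4/Theorems/EntropyRung{NoncompactShrinkerGapHeat{WeightedGreen, CutoffToolkit, FisherCutoff}, BakryEmeryLogSobolev{GaffneyCutoff, Stampacchia,
GaffneyEnergy, HessianSlack, GradientDissipation, GradientBound, APriori, Mass}}.lean`
(cell of the route `EntropyRung` of the smooth Poincaré 4 summit, where they served the analytic support item "Bakry–Émery
logarithmic Sobolev inequality"; they certify classical heat-flow analysis on a complete weighted manifold and are independent
of that route's topological target), namespaces `Summit.SmoothPoincare4.SmoothPoincare4.Theorems.{NoncompactShrinkerGapHeat,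
BakryEmeryComplete}` re-rooted as `Literature.Geometry.Riemannian.{NoncompactShrinkerGapHeat, BakryEmeryComplete}`.  The 24 theorems
of the same cone that other seats had already re-homed (`Geometry/Riemannian/{WeightedHeatCutoffCalculus, WeightedHeatFlowNoncompact,
LinearHeatVeryWeakNoncompact, LinearHeatWeakRegularityNoncompact, LinearHeatCauchyNoncompact}`, namespace
`Literature.Geometry.Riemannian`) are IMPORTED, not duplicated.  Everything is built on the tree's Literature layer
`Literature/Geometry/{Riemannian, Lorentzian}/` (`PseudoRiemannianMetric`, `laplaceBeltrami`, `weightedLaplacian`, `gradSq`,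
`innerDual`, `riemVolume`, Gaffney cut-offs `exists_cutoff_seq_of_isGeodesicallyComplete`, weighted Green identities, the linear
heat equation packages).  Theorem-only file: no definition, no named fact (D-0026); imports Mathlib/Literature only; every
declaration carries the citation of the printed step it formalises or serves.  The Summits originals stay in place (transitional
duplication; twins = same short names under `Summit.SmoothPoincare4.SmoothPoincare4.Theorems.…`).  Nothing here bears on any
summit statement.
Consumed by `BakryEmeryCompleteFisherEntropy.lean` and `BakryEmeryCompleteLogSobolevHolds.lean` (same directory), which carry the
Fisher-information decay and the EXACT discharge of `bakryEmery_logSobolev_complete`.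
-/

noncomputable section

/-!
## Part 1 — port of `Summits/SmoothPoincare4/SmoothPoincare4/Theorems/EntropyRungNoncompactShrinkerGapHeatWeightedGreen.lean` (4 declarations kept)

# Weighted Green identities with one compactly supported factor on a (non-compact) manifold

Helpers of the registered stub `stub_compactSupportLSI` (the compact-support logarithmic Sobolev inequality of
the shrinker measure, proved by the Bakry–Émery heat flow on the complete shrinker). Every integration by parts
of that argument is one of the two identities below: for a Riemannian manifold `(M, g)` modelled on `ℝⁿ`
(Hausdorff, second countable — NOT compact), a smooth weight `V`, the weighted Laplacian
`L b = Δ_g b − g⁻¹(dV, db)` and the weighted measure `dm = e^{-V} dV_g`,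

  `∫ a (L b) dm = −∫ g⁻¹(da, db) dm`

whenever `a ∈ C¹`, `b ∈ C²` and EITHER `a` (`helper_weightedGreen_left`) OR `b`
(`helper_weightedGreen_right`) has compact support. Proof: Green's first identity for compactly supported
functions on a non-compact manifold (`GreenIdentityCompactSupport.lean`:
`integral_mul_dalembertian_eq_neg_integral_innerDual_of_hasCompactSupport` / `…_right`) applied to
`u = a e^{-V}`, and `d(a e^{-V}) = e^{-V} da − a e^{-V} dV` (`mvfderiv_mul_exp_neg_toLinearMap`); the closed-manifold
version is `integral_mul_weightedLaplacian` (`BakryEmeryHeatFlow.lean`). Everything is proved; no definitions.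

References: Carrillo–Ni 2009, §3–§4 (integration by parts on the complete soliton); Bakry–Gentil–Ledoux 2014,
§3.1 (`∫ f Lg dμ = −∫ Γ(f,g) dμ`).
-/

section Part1

open scoped _root_.Manifold _root_.ContDiff _root_.ENNReal _root_.NNReal _root_.Topology
open _root_.MeasureTheory _root_.Set _root_.Filter
open Literature.Geometry.Lorentzian Literature.Geometry.Riemannian

namespace Literature.Geometry.Riemannian.NoncompactShrinkerGapHeat

section Green

variable {n : ℕ} {M : Type*} [TopologicalSpace M] [T2Space M] [SecondCountableTopology M]
  [ChartedSpace (EuclideanSpace ℝ (Fin n)) M] [IsManifold (𝓡 n) ∞ M] [T3Space M] [MeasurableSpace M]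
  [BorelSpace M]
  {g : PseudoRiemannianMetric (𝓡 n) ∞ (EuclideanSpace ℝ (Fin n)) (TangentSpace (𝓡 n) : M → Type _)}
  [g.HasLeviCivita]

/-- **Green's first identity for a compactly supported first factor, in the `riemVolume` vocabulary**:
`∫ u Δ_g w dV_g = −∫ g⁻¹(du, dw) dV_g` for `u ∈ C¹_c(M)`, `w ∈ C²(M)` on a (non-compact) Riemannian manifold
modelled on `ℝⁿ` (`integral_mul_dalembertian_eq_neg_integral_innerDual_of_hasCompactSupport` through
`riemVolume_eq`). [cite: Lee2018, Problem 2-23 (a)] -/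
theorem integral_mul_dalembertian_of_hasCompactSupport_left (hg : g.IsRiemannian) {u w : M → ℝ}
    (hu : ContMDiff (𝓡 n) 𝓘(ℝ, ℝ) 1 u) (huc : HasCompactSupport u) (hw : ContMDiff (𝓡 n) 𝓘(ℝ, ℝ) 2 w) :
    ∫ x, u x * g.dalembertian w x ∂g.riemVolume =
      -∫ x, g.innerDual x (mvfderiv (𝓡 n) u x).toLinearMap (mvfderiv (𝓡 n) w x).toLinearMap
        ∂g.riemVolume := by
  haveI : LocallyCompactSpace M := ChartedSpace.locallyCompactSpace (EuclideanSpace ℝ (Fin n)) M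
  haveI := (PseudoRiemannianMetric.ofRiemannian (g.toContMDiffRiemannianMetric hg)).hasLeviCivita
  have h1 := integral_mul_dalembertian_eq_neg_integral_innerDual_of_hasCompactSupport
    (g.toContMDiffRiemannianMetric hg) hu huc hw
  rw [PseudoRiemannianMetric.riemVolume_eq hg]
  exact h1

omit [T2Space M] [SecondCountableTopology M] [g.HasLeviCivita] in
/-- Continuous compactly supported functions are integrable for `g.riemVolume` (finite on compact sets).
[cite: CarrilloNi2009, §4 (integration by parts on the complete soliton)] -/
theorem integrable_of_continuous_of_hasCompactSupport' (hg : g.IsRiemannian) {F : M → ℝ}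
    (hF : Continuous F) (hFc : HasCompactSupport F) : Integrable F g.riemVolume := by
  haveI := CarrilloNi2009_shrinkerLSI.isFiniteMeasureOnCompacts_riemVolume hg
  exact hF.integrable_of_hasCompactSupport hFc

omit [T2Space M] [SecondCountableTopology M] [T3Space M] [MeasurableSpace M] [BorelSpace M] [g.HasLeviCivita] in
/-- The covector field `g⁻¹(du, dw)` vanishes off the support of `u`. [cite: CarrilloNi2009, §4 (integration by parts on the complete soliton)] -/
theorem innerDual_mvfderiv_eq_zero_of_notMem_tsupport_left {u w : M → ℝ} {x : M} (hx : x ∉ tsupport u) :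
    g.innerDual x (mvfderiv (𝓡 n) u x).toLinearMap (mvfderiv (𝓡 n) w x).toLinearMap = 0 := by
  rw [mvfderiv_eq_zero_of_notMem_tsupport hx]
  simp [PseudoRiemannianMetric.innerDual]

/-- **Weighted Green identity, compactly supported first factor**: `∫ a (L b) e^{-V} dV = −∫ g⁻¹(da, db) e^{-V} dV`
for `a ∈ C¹_c`, `b ∈ C²`, `V ∈ C¹`, `L b = Δ b − g⁻¹(dV, db)`, on a (non-compact) Riemannian manifold modelled on
`ℝⁿ`. [cite: CarrilloNi2009, §4 (integration by parts on the complete soliton)] -/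
theorem weightedGreen_left (hg : g.IsRiemannian) {a b V : M → ℝ}
    (ha : ContMDiff (𝓡 n) 𝓘(ℝ, ℝ) 1 a) (hac : HasCompactSupport a) (hb : ContMDiff (𝓡 n) 𝓘(ℝ, ℝ) 2 b)
    (hV : ContMDiff (𝓡 n) 𝓘(ℝ, ℝ) 1 V) :
    ∫ x, a x * (g.dalembertian b x
        - g.innerDual x (mvfderiv (𝓡 n) V x).toLinearMap (mvfderiv (𝓡 n) b x).toLinearMap) *
        Real.exp (-V x) ∂g.riemVolume =
      -∫ x, g.innerDual x (mvfderiv (𝓡 n) a x).toLinearMap (mvfderiv (𝓡 n) b x).toLinearMap *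
          Real.exp (-V x) ∂g.riemVolume := by
  -- Green's first identity for `u = a e^{-V}` (compactly supported) and `f = b`
  have hexp : ContMDiff (𝓡 n) 𝓘(ℝ, ℝ) 1 (fun y ↦ Real.exp (-V y)) :=
    ((Real.contDiff_exp.comp contDiff_neg).of_le le_top).comp_contMDiff hV
  have hu : ContMDiff (𝓡 n) 𝓘(ℝ, ℝ) 1 (fun y ↦ a y * Real.exp (-V y)) := ha.mul hexp
  have huc : HasCompactSupport (fun y ↦ a y * Real.exp (-V y)) := hac.mul_right
  have hG := integral_mul_dalembertian_of_hasCompactSupport_left hg hu huc hb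
  have hb1 : ContMDiff (𝓡 n) 𝓘(ℝ, ℝ) 1 b := hb.of_le (by norm_num)
  -- the integrand of the right-hand side of Green, pointwise
  have hpt : ∀ x, g.innerDual x (mvfderiv (𝓡 n) (fun y ↦ a y * Real.exp (-V y)) x).toLinearMap
        (mvfderiv (𝓡 n) b x).toLinearMap =
      g.innerDual x (mvfderiv (𝓡 n) a x).toLinearMap (mvfderiv (𝓡 n) b x).toLinearMap * Real.exp (-V x)
        - a x * g.innerDual x (mvfderiv (𝓡 n) V x).toLinearMap (mvfderiv (𝓡 n) b x).toLinearMap *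
            Real.exp (-V x) := by
    intro x
    have h := mvfderiv_mul_exp_neg_toLinearMap (I := 𝓡 n) (ha.mdifferentiableAt one_ne_zero (x := x))
      (hV.mdifferentiableAt one_ne_zero)
    rw [show (mvfderiv (𝓡 n) (fun y ↦ a y * Real.exp (-V y)) x).toLinearMap =
        (mvfderiv (𝓡 n) (fun y ↦ a y * Real.exp (-V y)) x : TangentSpace (𝓡 n) x →ₗ[ℝ] ℝ) from rfl, h,
      g.innerDual_sub_left, g.innerDual_smul_left, g.innerDual_smul_left]
    ring
  -- continuity, supports, integrability
  have hΔc : Continuous (g.dalembertian b) := continuous_dalembertian g hb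
  have hIVc : Continuous fun x ↦ g.innerDual x (mvfderiv (𝓡 n) V x).toLinearMap
      (mvfderiv (𝓡 n) b x).toLinearMap := continuous_innerDual_mvfderiv g hV hb1
  have hIac : Continuous fun x ↦ g.innerDual x (mvfderiv (𝓡 n) a x).toLinearMap
      (mvfderiv (𝓡 n) b x).toLinearMap := continuous_innerDual_mvfderiv g ha hb1
  have hec : Continuous fun x ↦ Real.exp (-V x) := hexp.continuous
  have i1 : Integrable (fun x ↦ (a x * Real.exp (-V x)) * g.dalembertian b x) g.riemVolume :=
    integrable_of_continuous_of_hasCompactSupport' hg ((ha.continuous.mul hec).mul hΔc) huc.mul_right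
  have i2 : Integrable (fun x ↦ a x * g.innerDual x (mvfderiv (𝓡 n) V x).toLinearMap
      (mvfderiv (𝓡 n) b x).toLinearMap * Real.exp (-V x)) g.riemVolume :=
    integrable_of_continuous_of_hasCompactSupport' hg ((ha.continuous.mul hIVc).mul hec)
      (hac.mul_right.mul_right)
  have i3 : Integrable (fun x ↦ g.innerDual x (mvfderiv (𝓡 n) a x).toLinearMap
      (mvfderiv (𝓡 n) b x).toLinearMap * Real.exp (-V x)) g.riemVolume := by
    refine integrable_of_continuous_of_hasCompactSupport' hg (hIac.mul hec) ?_
    refine HasCompactSupport.mul_right ?_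
    exact HasCompactSupport.intro hac (fun x hx ↦ innerDual_mvfderiv_eq_zero_of_notMem_tsupport_left hx)
  -- split the integrals
  have s1 : ∫ x, a x * (g.dalembertian b x
        - g.innerDual x (mvfderiv (𝓡 n) V x).toLinearMap (mvfderiv (𝓡 n) b x).toLinearMap) *
        Real.exp (-V x) ∂g.riemVolume =
      ∫ x, ((a x * Real.exp (-V x)) * g.dalembertian b x
        - a x * g.innerDual x (mvfderiv (𝓡 n) V x).toLinearMap (mvfderiv (𝓡 n) b x).toLinearMap *
            Real.exp (-V x)) ∂g.riemVolume :=
    integral_congr_ae (Eventually.of_forall fun x ↦ by ring)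
  have s2 : ∫ x, ((a x * Real.exp (-V x)) * g.dalembertian b x
        - a x * g.innerDual x (mvfderiv (𝓡 n) V x).toLinearMap (mvfderiv (𝓡 n) b x).toLinearMap *
            Real.exp (-V x)) ∂g.riemVolume =
      ∫ x, (a x * Real.exp (-V x)) * g.dalembertian b x ∂g.riemVolume
      - ∫ x, a x * g.innerDual x (mvfderiv (𝓡 n) V x).toLinearMap (mvfderiv (𝓡 n) b x).toLinearMap *
            Real.exp (-V x) ∂g.riemVolume :=
    integral_sub i1 i2
  have s3 : ∫ x, g.innerDual x (mvfderiv (𝓡 n) (fun y ↦ a y * Real.exp (-V y)) x).toLinearMap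
        (mvfderiv (𝓡 n) b x).toLinearMap ∂g.riemVolume =
      ∫ x, (g.innerDual x (mvfderiv (𝓡 n) a x).toLinearMap (mvfderiv (𝓡 n) b x).toLinearMap *
          Real.exp (-V x)
        - a x * g.innerDual x (mvfderiv (𝓡 n) V x).toLinearMap (mvfderiv (𝓡 n) b x).toLinearMap *
            Real.exp (-V x)) ∂g.riemVolume :=
    integral_congr_ae (Eventually.of_forall hpt)
  have s4 : ∫ x, (g.innerDual x (mvfderiv (𝓡 n) a x).toLinearMap (mvfderiv (𝓡 n) b x).toLinearMap *
          Real.exp (-V x)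
        - a x * g.innerDual x (mvfderiv (𝓡 n) V x).toLinearMap (mvfderiv (𝓡 n) b x).toLinearMap *
            Real.exp (-V x)) ∂g.riemVolume =
      ∫ x, g.innerDual x (mvfderiv (𝓡 n) a x).toLinearMap (mvfderiv (𝓡 n) b x).toLinearMap *
          Real.exp (-V x) ∂g.riemVolume
      - ∫ x, a x * g.innerDual x (mvfderiv (𝓡 n) V x).toLinearMap (mvfderiv (𝓡 n) b x).toLinearMap *
            Real.exp (-V x) ∂g.riemVolume :=
    integral_sub i3 i2
  linarith [hG, s1, s2, s3, s4]

end Green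

/-! ## Registered helpers (verbatim signatures) -/

end Literature.Geometry.Riemannian.NoncompactShrinkerGapHeat

end Part1

/-!
## Part 2 — port of `Summits/SmoothPoincare4/SmoothPoincare4/Theorems/EntropyRungNoncompactShrinkerGapHeatCutoffToolkit.lean` (2 declarations kept)

# Cut-off toolkit for the weighted heat flow on a complete manifold

Auxiliary file of the helpers `helper_energyEstimate`, `helper_massConservation`,
`helper_energyVanishing` (energy method with compactly supported cut-offs `η_k` for solutions of
`∂ₛρ = Lρ`, `L = Δ_g − g⁻¹(dV, d·)`, on a NON-compact Riemannian manifold modelled on `ℝⁿ`).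
First-order bookkeeping only, in the sub-namespace `CutoffToolkit`:

* `hasDerivAt_integral_mul_of_hasCompactSupport`, `continuousOn_integral_mul_of_hasCompactSupport`
  — `d/ds ∫ F(s,x) h(x) dμ = ∫ ∂ₛF(s,x) h(x) dμ` and continuity of `s ↦ ∫ F(s,x) h(x) dμ` for a
  compactly supported continuous weight `h` (`WeightedParametricIntegral.lean`);
* `integral_strip_eq_intervalIntegral`, `aestronglyMeasurable_strip`,
  `integrable_strip_mul_of_hasCompactSupport` — Fubini on the strip `X × (a,b)` for
  `(μ ⊗ ds)|_{X×(a,b)}` and integrability there of `F(x,s) h(x)`, `h` compactly supported;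
* `sigmaFinite_riemVolume`, `isOpenPosMeasure_riemVolume` — the Riemannian measure of a second
  countable manifold is σ-finite (so Fubini on `dV ⊗ ds` is available) and charges open sets;
* `integral_cutoff_mul_weightedLaplacian` (`∫ η (Lu) e^{-V} = ∫ u (Lη) e^{-V}`) and
  `integral_sub_mul_cutoff_mul_weightedLaplacian` — the ENERGY IDENTITY with a cut-off
  `∫ (u − c) η (Lu) e^{-V} = −∫ η |∇u|² e^{-V} + ½ ∫ (u − c)² (Lη) e^{-V}` (from the landed
  weighted Green identities `weightedGreen_left/right`; only `Lη` enters, never a separate second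
  derivative of `η`);
* `tendsto_cutoff`, `weightedLaplacian_cutoff_eventually_eq_zero`,
  `dalembertian_cutoff_eventually_eq_zero` — cut-offs eventually `= 1` near every point:
  `η_k(x) → 1` and `Lη_k(x) = 0` for large `k` (locality of `Δ_g`, `d`);
* `continuousOn_deriv_time`, `hasDerivAt_time` — time derivatives of functions smooth on
  `M × O`, `O` open.

References: J. A. Carrillo, L. Ni, Comm. Anal. Geom. 17 (2009), §4 (integrations by parts with
cut-offs on the complete soliton) [CarrilloNi2009]; D. Bakry, I. Gentil, M. Ledoux, *Analysis and
Geometry of Markov Diffusion Operators* (2014), §3.2 [BakryGentilLedoux2014].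
-/

section Part2

open scoped _root_.Manifold _root_.ContDiff _root_.ENNReal _root_.NNReal _root_.Topology
open _root_.MeasureTheory _root_.Set _root_.Filter
open Literature.Geometry.Lorentzian Literature.Geometry.Riemannian

namespace Literature.Geometry.Riemannian.NoncompactShrinkerGapHeat.CutoffToolkit

/-! ### Parametric integrals against a compactly supported weight; the strip `X × (a, b)` -/

section Measure

variable {X : Type*} [TopologicalSpace X] [MeasurableSpace X]

end Measure

/-! ### The Riemannian measure of a second countable manifold; Green identities with compact
support on `g.riemVolume` -/

section Manifold

variable {n : ℕ} {M : Type*} [TopologicalSpace M] [T2Space M] [SecondCountableTopology M]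
  [ChartedSpace (EuclideanSpace ℝ (Fin n)) M] [IsManifold (𝓡 n) ∞ M] [T3Space M]
  [MeasurableSpace M] [BorelSpace M]
  {g : PseudoRiemannianMetric (𝓡 n) ∞ (EuclideanSpace ℝ (Fin n)) (TangentSpace (𝓡 n) : M → Type _)}

variable [g.HasLeviCivita]

/-! ### Two integrations by parts against a compactly supported cut-off -/

omit [T2Space M] [SecondCountableTopology M] [T3Space M] [MeasurableSpace M] [BorelSpace M]
  [g.HasLeviCivita] in
/-- For `ρ` smooth on `M × O` (`O` open), `(x, s) ↦ ∂ₛρ(s, x)` is continuous on `M × O`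
(`contMDiffOn_derivWithin_time_of_uniqueDiffOn`, `derivWithin = deriv` on the open `O`).
[cite: BakryGentilLedoux2014, §3.2 (pp. 141–147: cut-off calculus on a complete weighted manifold)] -/
theorem continuousOn_deriv_time {O : Set ℝ} (hO : IsOpen O) {ρ : ℝ → M → ℝ}
    (hρ : ContMDiffOn ((𝓡 n).prod 𝓘(ℝ, ℝ)) 𝓘(ℝ, ℝ) ∞ (fun p : M × ℝ ↦ ρ p.2 p.1) (univ ×ˢ O)) :
    ContinuousOn (fun p : M × ℝ ↦ deriv (fun r ↦ ρ r p.1) p.2) (univ ×ˢ O) := by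
  have h := (contMDiffOn_derivWithin_time_of_uniqueDiffOn hO.uniqueDiffOn hρ).continuousOn
  refine h.congr fun p hp ↦ ?_
  exact (derivWithin_of_isOpen hO hp.2).symm

omit [T2Space M] [SecondCountableTopology M] [IsManifold (𝓡 n) ∞ M] [T3Space M]
  [MeasurableSpace M] [BorelSpace M] [g.HasLeviCivita] in
/-- For `ρ` smooth on `M × O` (`O` open), `s ↦ ρ(s, x)` has derivative `deriv (ρ · x) s` at
`s ∈ O`. [cite: BakryGentilLedoux2014, §3.2 (pp. 141–147: cut-off calculus on a complete weighted manifold)] -/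
theorem hasDerivAt_time {O : Set ℝ} (hO : IsOpen O) {ρ : ℝ → M → ℝ}
    (hρ : ContMDiffOn ((𝓡 n).prod 𝓘(ℝ, ℝ)) 𝓘(ℝ, ℝ) ∞ (fun p : M × ℝ ↦ ρ p.2 p.1) (univ ×ˢ O))
    (x : M) {s : ℝ} (hs : s ∈ O) :
    HasDerivAt (fun r ↦ ρ r x) (deriv (fun r ↦ ρ r x) s) s :=
  hasDerivAt_slice_of_contMDiffOn hO (v := fun p : M × ℝ ↦ ρ p.2 p.1) hρ x hs

end Manifold

end Literature.Geometry.Riemannian.NoncompactShrinkerGapHeat.CutoffToolkit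

namespace Literature.Geometry.Riemannian.NoncompactShrinkerGapHeat

end Literature.Geometry.Riemannian.NoncompactShrinkerGapHeat

end Part2

/-!
## Part 3 — port of `Summits/SmoothPoincare4/SmoothPoincare4/Theorems/EntropyRungNoncompactShrinkerGapHeatFisherCutoff.lean` (2 declarations kept)

# Fixed-time dissipation of the cut-off Fisher information on a complete weighted manifold

Non-compact counterpart of `integral_derivWithin_fisher_le` (`BakryEmeryHeatFlow.lean`): for `(M, g)` modelled on
`ℝⁿ` (NOT compact), `Ric + Hess V ≥ K g`, `L = Δ − g⁻¹(dV, d·)`, `φ` smooth on `M × S` with `∂ₜφ = Lφ − |∇φ|²`, and a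
smooth COMPACTLY SUPPORTED `η ≥ 0`: `∫ η ∂ₜ(|∇φ|² e^{-φ} e^{-V}) ≤ −2K ∫ η |∇φ|² e^{-φ}e^{-V} + ∫ |∇φ|² e^{-φ} (Lη) e^{-V}`
(`fisherCutoff_le`, registered as `helper_fisherCutoff`). Proof: `fisher_pointwise_le` times `η`, integrated; the
`L`- and gradient terms are integrated by parts with the weighted Green identities with one compactly supported
factor (`weightedGreen_left/right`); everything cancels except `−2K ∫ η|∇φ|²e^{-φ}e^{-V}` and the boundary term
carried by `Lη`. Everything is proved; no definitions. Source: Carrillo–Ni 2009, §3 (p. 8); Bakry–Émery 1985.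
-/

section Part3

open scoped _root_.Manifold _root_.ContDiff _root_.ENNReal _root_.NNReal _root_.Topology
open _root_.MeasureTheory _root_.Set _root_.Filter
open Literature.Geometry.Lorentzian Literature.Geometry.Riemannian

namespace Literature.Geometry.Riemannian.NoncompactShrinkerGapHeat

section Fisher

variable {n : ℕ} {M : Type*} [TopologicalSpace M] [T2Space M] [SecondCountableTopology M]
  [ChartedSpace (EuclideanSpace ℝ (Fin n)) M] [IsManifold (𝓡 n) ∞ M] [T3Space M] [MeasurableSpace M]
  [BorelSpace M]
  {g : PseudoRiemannianMetric (𝓡 n) ∞ (EuclideanSpace ℝ (Fin n)) (TangentSpace (𝓡 n) : M → Type _)}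
  [g.HasLeviCivita]

omit [T2Space M] [SecondCountableTopology M] [T3Space M] [MeasurableSpace M] [BorelSpace M] [g.HasLeviCivita] in
/-- `g⁻¹(d(ab), β) = a g⁻¹(db, β) + b g⁻¹(da, β)` (Leibniz rule inside the inverse metric). [cite: CarrilloNi2009, §3 (p. 8)] -/
theorem innerDual_mvfderiv_mul_left {a b : M → ℝ} {x : M} (ha : MDifferentiableAt (𝓡 n) 𝓘(ℝ, ℝ) a x)
    (hb : MDifferentiableAt (𝓡 n) 𝓘(ℝ, ℝ) b x) (β : Module.Dual ℝ (TangentSpace (𝓡 n) x)) :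
    g.innerDual x (mvfderiv (𝓡 n) (fun y ↦ a y * b y) x).toLinearMap β =
      a x * g.innerDual x (mvfderiv (𝓡 n) b x).toLinearMap β
        + b x * g.innerDual x (mvfderiv (𝓡 n) a x).toLinearMap β := by
  rw [mvfderiv_fun_mul ha hb]
  simp only [ContinuousLinearMap.toLinearMap_add, ContinuousLinearMap.toLinearMap_smul, g.innerDual_add_left,
    g.innerDual_smul_left]

omit [T2Space M] [SecondCountableTopology M] [T3Space M] [MeasurableSpace M] [BorelSpace M] [g.HasLeviCivita] in
/-- `g⁻¹(d(e^{-F}), β) = −e^{-F} g⁻¹(dF, β)`. [cite: CarrilloNi2009, §3 (p. 8)] -/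
theorem innerDual_mvfderiv_exp_neg_left {F : M → ℝ} {x : M} (hF : MDifferentiableAt (𝓡 n) 𝓘(ℝ, ℝ) F x)
    (β : Module.Dual ℝ (TangentSpace (𝓡 n) x)) :
    g.innerDual x (mvfderiv (𝓡 n) (fun y ↦ Real.exp (-F y)) x).toLinearMap β =
      -Real.exp (-F x) * g.innerDual x (mvfderiv (𝓡 n) F x).toLinearMap β := by
  rw [show (mvfderiv (𝓡 n) (fun y ↦ Real.exp (-F y)) x).toLinearMap =
      (mvfderiv (𝓡 n) (fun y ↦ Real.exp (-F y)) x : TangentSpace (𝓡 n) x →ₗ[ℝ] ℝ) from rfl,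
    mvfderiv_exp_neg_toLinearMap (I := 𝓡 n) hF, g.innerDual_smul_left]

end Fisher

end Literature.Geometry.Riemannian.NoncompactShrinkerGapHeat

end Part3

/-!
## Part 4 — port of `Summits/SmoothPoincare4/SmoothPoincare4/Theorems/EntropyRungBakryEmeryLogSobolevGaffneyCutoff.lean` (5 declarations kept)

# Gaffney cut-offs and the first-order integration-by-parts toolkit on a complete weighted
# manifold

Setting: `M` modelled on `ℝⁿ` (Hausdorff, second countable, `T₃`, Borel — NOT compact), `g`
Riemannian with its Levi-Civita connection, `V` smooth (NO further assumption on `V`),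
`L = Δ_g − g⁻¹(dV, d·)`, weight `e^{-V} dV_g`. The cut-offs are GAFFNEY's: `η_k ∈ C_c^∞`,
`0 ≤ η_k ≤ 1`, `η_k → 1` pointwise and `|∇η_k|² ≤ C₀/(k+1)²` — available on every complete
Riemannian manifold (`exists_cutoff_of_isGeodesicallyComplete`), whereas the bounded-`Lη_k`
cut-offs of the shrinker toolkit (`EntropyRungNoncompactShrinkerGapHeat*.lean`) need curvature /
potential bounds that a general `CD(K, ∞)` weighted manifold does not have.

* `exists_gaffney_cutoff` — a MONOTONE exhausting family of Gaffney cut-offs on a connected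
  complete Riemannian manifold (scales `2^{k+1}` about a base point);
* `integral_mul_cutoffSq_mul_weightedLaplacian` — `∫ a η² (Lu) e^{-V} = −∫ η² g⁻¹(da, du) e^{-V}
  − 2 ∫ a η g⁻¹(dη, du) e^{-V}` (weighted Green identity with the compactly supported factor `a η²`);
* `neg_four_mul_cutoff_innerDual_le` — the pointwise first-order absorption
  `−4 (ρ − c) η g⁻¹(dη, dρ) ≤ η²|∇ρ|² + 4(ρ − c)²|∇η|²`.

The energy estimate itself is `EntropyRungBakryEmeryLogSobolevGaffneyEnergy.lean`. This is the
toolkit of the `L²` ("finite energy") route of Bakry–Gentil–Ledoux (2014), §3.2, pp. 141–147, where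
every integration by parts on the complete manifold is justified with cut-offs `ζ_k` having only
`Γ(ζ_k) ≤ 1/k`. Everything is proved; no definitions, no named facts.

## References

* [BakryGentilLedoux2014] D. Bakry, I. Gentil, M. Ledoux, *Analysis and Geometry of Markov
  Diffusion Operators*, Springer 2014, §3.2 (pp. 141–147), Prop. 3.2.1, Thm. 3.2.6 (proofs).
* [Gaffney1954] M. P. Gaffney, Ann. of Math. 60 (1954) 140–145 (cut-offs on complete manifolds).
* [CarrilloNi2009] J. A. Carrillo, L. Ni, Comm. Anal. Geom. 17 (2009), §4.
-/

section Part4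

open scoped _root_.Manifold _root_.ContDiff _root_.ENNReal _root_.NNReal _root_.Topology
open _root_.MeasureTheory _root_.Set _root_.Filter
open Literature.Geometry.Lorentzian Literature.Geometry.Riemannian

namespace Literature.Geometry.Riemannian.BakryEmeryComplete

open NoncompactShrinkerGapHeat NoncompactShrinkerGapHeat.CutoffToolkit

/-! ### Monotone Gaffney cut-offs on a connected complete Riemannian manifold -/

section Gaffney

variable {n : ℕ} {M : Type} [TopologicalSpace M] [T2Space M] [SecondCountableTopology M]
  [ChartedSpace (EuclideanSpace ℝ (Fin n)) M] [IsManifold (𝓡 n) ∞ M] [ConnectedSpace M]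
  {g : PseudoRiemannianMetric (𝓡 n) ∞ (EuclideanSpace ℝ (Fin n)) (TangentSpace (𝓡 n) : M → Type _)}
  [g.HasLeviCivita]

/-- **Monotone Gaffney cut-offs.** On a connected complete Riemannian manifold modelled on `ℝⁿ`
(closed `g.edist`-balls compact) there are `η_k ∈ C_c^∞(M; [0,1])`, `k ∈ ℕ`, with
`η_k ≤ η_{k+1}`, `η_k(x) = 1` for all large `k` (every `x`), and `|∇η_k|²_g ≤ C₀/(k+1)²`: the
cut-offs of `exists_cutoff_of_isGeodesicallyComplete` (Gaffney 1954; Carron) about a base point at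
the scales `2^{k+1}` — `η_k = 1` on `B(o, 2^k)`, `tsupport η_k ⊆ B(o, 2^{k+1})` where `η_{k+1} = 1`.
[cite: Gaffney1954] [cite: BakryGentilLedoux2014, §3.2 (p. 142, the sequence ζ_k)] -/
theorem exists_gaffney_cutoff (hg : g.IsRiemannian)
    (hc : ∀ (x : M) (r : NNReal), IsCompact {y : M | g.edist hg x y ≤ r}) :
    ∃ (η : ℕ → M → ℝ) (C₀ : ℝ), (∀ k, ContMDiff (𝓡 n) 𝓘(ℝ, ℝ) ∞ (η k)) ∧
      (∀ k, HasCompactSupport (η k)) ∧ (∀ k x, 0 ≤ η k x ∧ η k x ≤ 1) ∧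
      (∀ k x, η k x ≤ η (k + 1) x) ∧ (∀ x, ∀ᶠ k in atTop, η k x = 1) ∧
      ∀ k x, g.gradSq (η k) x ≤ C₀ / ((k : ℝ) + 1) ^ 2 := by
  haveI : Nonempty M := ConnectedSpace.toNonempty
  obtain ⟨o⟩ := ‹Nonempty M›
  have hk1 : ((1 : ℕ∞) : ℕ∞ω) + 1 ≤ (∞ : ℕ∞ω) := by
    rw [show ((1 : ℕ∞) : ℕ∞ω) + 1 = 2 by norm_num]; exact WithTop.coe_le_coe.2 le_top
  haveI : CovariantDerivative.ContMDiffCovariantDerivative g.leviCivita 1 :=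
    ⟨g.isLocallyContMDiff_leviCivita_holds 1 hk1 univ isOpen_univ⟩
  have hgc : IsGeodesicallyComplete g.leviCivita :=
    (isGeodesicallyComplete_iff_isCompact_setOf_edist_le g le_rfl hg).2 hc
  obtain ⟨C₀, hC₀'⟩ := exists_cutoff_of_isGeodesicallyComplete.{0, 0, 0}
  have h := fun k : ℕ ↦ hC₀' (𝓡 n) M g hg hgc o ((2 : ℝ) ^ (k + 1)) (by positivity)
  choose η hηs hηc hη0 hη1 hηone hηsupp hηgrad using h
  have hC₀ : 0 ≤ C₀ := by
    have h1 := hηgrad 0 o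
    have h2 : 0 ≤ g.gradSq (η 0) o := g.gradSq_nonneg hg _ _
    have h3 : (0 : ℝ) < ((2 : ℝ) ^ (0 + 1)) ^ 2 := by positivity
    rcases div_nonneg_iff.1 (h2.trans h1) with h | h
    · exact h.1
    · exact absurd h.2 (not_le.mpr h3)
  refine ⟨η, C₀, hηs, hηc, fun k x ↦ ⟨hη0 k x, hη1 k x⟩, fun k x ↦ ?_, fun x ↦ ?_, fun k x ↦ ?_⟩
  · -- monotonicity: off `tsupport η_k`, `η_k = 0 ≤ η_{k+1}`; on it, `d(o,x) < 2^{k+1}` so `η_{k+1} = 1`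
    by_cases hx : x ∈ tsupport (η k)
    · have hd : g.edist hg o x < ENNReal.ofReal ((2 : ℝ) ^ (k + 1 + 1) / 2) := by
        have h1 := hηsupp k hx
        simp only [mem_setOf_eq] at h1
        convert h1 using 2
        rw [pow_succ]; ring
      rw [hηone (k + 1) x hd]
      exact hη1 k x
    · rw [image_eq_zero_of_notMem_tsupport hx]
      exact hη0 (k + 1) x
  · -- `d(o, x) < ∞`, hence `< 2^{k+1}/2 = 2^k` for all large `k`
    have hfin : g.edist hg o x ≠ ⊤ := (PseudoRiemannianMetric.edist_lt_top hg o x).ne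
    set d : ℝ := (g.edist hg o x).toReal with hd
    obtain ⟨N, hN⟩ : ∃ N : ℕ, d < 2 ^ N := by
      obtain ⟨N, hN⟩ := pow_unbounded_of_one_lt d (by norm_num : (1 : ℝ) < 2)
      exact ⟨N, hN⟩
    refine eventually_atTop.2 ⟨N, fun k hk ↦ hηone k x ?_⟩
    rw [← ENNReal.ofReal_toReal hfin]
    refine (ENNReal.ofReal_lt_ofReal_iff (by positivity)).2 ?_
    have h2 : (2 : ℝ) ^ N ≤ 2 ^ k := pow_le_pow_right₀ (by norm_num) hk
    rw [← hd, pow_succ]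
    linarith
  · -- `C₀ / (2^{k+1})² ≤ C₀ / (k+1)²`
    refine (hηgrad k x).trans ?_
    have h1 : ((k : ℝ) + 1) ≤ (2 : ℝ) ^ (k + 1) := by
      have h := Nat.lt_two_pow_self (n := k + 1)
      have h' : ((k + 1 : ℕ) : ℝ) < ((2 ^ (k + 1) : ℕ) : ℝ) := by exact_mod_cast h
      push_cast at h'
      linarith
    have h2 : ((k : ℝ) + 1) ^ 2 ≤ ((2 : ℝ) ^ (k + 1)) ^ 2 :=
      pow_le_pow_left₀ (by positivity) h1 2
    exact div_le_div_of_nonneg_left hC₀ (by positivity) h2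

end Gaffney

/-- A cut-off family which is eventually `1` at every point tends to `1` pointwise. [cite: BakryGentilLedoux2014, §3.2 (p. 142, the sequence ζ_k)] -/
theorem tendsto_cutoff_of_eventually_eq {X : Type*} {η : ℕ → X → ℝ}
    (hη1 : ∀ x, ∀ᶠ k in atTop, η k x = 1) (x : X) : Tendsto (fun k ↦ η k x) atTop (𝓝 1) :=
  tendsto_const_nhds.congr' ((hη1 x).mono fun _ hk ↦ hk.symm)

section Energy

variable {n : ℕ} {M : Type*} [TopologicalSpace M] [T2Space M] [SecondCountableTopology M]
  [ChartedSpace (EuclideanSpace ℝ (Fin n)) M] [IsManifold (𝓡 n) ∞ M] [T3Space M]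
  [MeasurableSpace M] [BorelSpace M]
  {g : PseudoRiemannianMetric (𝓡 n) ∞ (EuclideanSpace ℝ (Fin n)) (TangentSpace (𝓡 n) : M → Type _)}
  [g.HasLeviCivita]

/-! ### The weighted Green identity against `a η²` -/

/-- **`∫ a η² (Lu) e^{-V} = −∫ η² g⁻¹(da, du) e^{-V} − 2∫ a η g⁻¹(dη, du) e^{-V}`** for `a, u, V`
smooth and `η ∈ C_c^∞` (`weightedGreen_left` with the compactly supported factor `a η²`,
`d(a η²) = η² da + 2 a η dη`). [cite: BakryGentilLedoux2014, §3.2 (p. 141)] -/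
theorem integral_mul_cutoffSq_mul_weightedLaplacian (hg : g.IsRiemannian) {a u η V : M → ℝ}
    (ha : ContMDiff (𝓡 n) 𝓘(ℝ, ℝ) ∞ a) (hu : ContMDiff (𝓡 n) 𝓘(ℝ, ℝ) ∞ u)
    (hη : ContMDiff (𝓡 n) 𝓘(ℝ, ℝ) ∞ η) (hηc : HasCompactSupport η)
    (hV : ContMDiff (𝓡 n) 𝓘(ℝ, ℝ) ∞ V) :
    ∫ x, a x * η x ^ 2 * (g.dalembertian u x
        - g.innerDual x (mvfderiv (𝓡 n) V x).toLinearMap (mvfderiv (𝓡 n) u x).toLinearMap) *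
        Real.exp (-V x) ∂g.riemVolume =
      -(∫ x, η x ^ 2 * g.innerDual x (mvfderiv (𝓡 n) a x).toLinearMap
          (mvfderiv (𝓡 n) u x).toLinearMap * Real.exp (-V x) ∂g.riemVolume)
      - 2 * ∫ x, a x * η x * g.innerDual x (mvfderiv (𝓡 n) η x).toLinearMap
          (mvfderiv (𝓡 n) u x).toLinearMap * Real.exp (-V x) ∂g.riemVolume := by
  have h1 : (1 : ℕ∞ω) ≤ (∞ : ℕ∞ω) := WithTop.coe_le_coe.mpr le_top
  have h2 : (2 : ℕ∞ω) ≤ (∞ : ℕ∞ω) := WithTop.coe_le_coe.mpr le_top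
  -- the compactly supported factor `A = a η²`
  have hA : ContMDiff (𝓡 n) 𝓘(ℝ, ℝ) ∞ (fun x ↦ a x * (η x * η x)) := ha.mul (hη.mul hη)
  have hAc : HasCompactSupport (fun x ↦ a x * (η x * η x)) := (hηc.mul_left).mul_left
  have hG := weightedGreen_left hg (hA.of_le h1) hAc (hu.of_le h2) (hV.of_le h1)
  -- pointwise expansion of `g⁻¹(d(a η²), du)`
  have had : ∀ x, MDifferentiableAt (𝓡 n) 𝓘(ℝ, ℝ) a x := fun x ↦ ha.mdifferentiableAt (by simp)
  have hηd : ∀ x, MDifferentiableAt (𝓡 n) 𝓘(ℝ, ℝ) η x := fun x ↦ hη.mdifferentiableAt (by simp)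
  have hηηd : ∀ x, MDifferentiableAt (𝓡 n) 𝓘(ℝ, ℝ) (fun y ↦ η y * η y) x := fun x ↦
    (hηd x).mul (hηd x)
  have hpt : ∀ x, g.innerDual x (mvfderiv (𝓡 n) (fun y ↦ a y * (η y * η y)) x).toLinearMap
        (mvfderiv (𝓡 n) u x).toLinearMap =
      η x ^ 2 * g.innerDual x (mvfderiv (𝓡 n) a x).toLinearMap (mvfderiv (𝓡 n) u x).toLinearMap
        + 2 * (a x * η x * g.innerDual x (mvfderiv (𝓡 n) η x).toLinearMap
            (mvfderiv (𝓡 n) u x).toLinearMap) := by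
    intro x
    rw [innerDual_mvfderiv_mul_left (had x) (hηηd x), innerDual_mvfderiv_mul_left (hηd x) (hηd x)]
    ring
  -- continuity and integrability
  have hu1 : ContMDiff (𝓡 n) 𝓘(ℝ, ℝ) 1 u := hu.of_le h1
  have hec : Continuous fun x ↦ Real.exp (-V x) := Real.continuous_exp.comp hV.continuous.neg
  have hIau : Continuous fun x ↦ g.innerDual x (mvfderiv (𝓡 n) a x).toLinearMap
      (mvfderiv (𝓡 n) u x).toLinearMap := continuous_innerDual_mvfderiv g (ha.of_le h1) hu1
  have hIηu : Continuous fun x ↦ g.innerDual x (mvfderiv (𝓡 n) η x).toLinearMap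
      (mvfderiv (𝓡 n) u x).toLinearMap := continuous_innerDual_mvfderiv g (hη.of_le h1) hu1
  have hηz : ∀ x ∉ tsupport η, g.innerDual x (mvfderiv (𝓡 n) η x).toLinearMap
      (mvfderiv (𝓡 n) u x).toLinearMap = 0 := fun x hx ↦
    innerDual_mvfderiv_eq_zero_of_notMem_tsupport_left hx
  have hη2c : HasCompactSupport (fun x ↦ η x ^ 2) := by
    rw [show (fun x ↦ η x ^ 2) = fun x ↦ η x * η x from funext fun x ↦ sq (η x)]
    exact hηc.mul_right
  have i1 : Integrable (fun x ↦ η x ^ 2 * g.innerDual x (mvfderiv (𝓡 n) a x).toLinearMap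
      (mvfderiv (𝓡 n) u x).toLinearMap * Real.exp (-V x)) g.riemVolume := by
    refine integrable_of_continuous_of_hasCompactSupport' hg
      (((hη.continuous.pow 2).mul hIau).mul hec) ?_
    exact (hη2c.mul_right).mul_right
  have i2 : Integrable (fun x ↦ 2 * (a x * η x * g.innerDual x (mvfderiv (𝓡 n) η x).toLinearMap
      (mvfderiv (𝓡 n) u x).toLinearMap) * Real.exp (-V x)) g.riemVolume := by
    refine integrable_of_continuous_of_hasCompactSupport' hg
      ((continuous_const.mul ((ha.continuous.mul hη.continuous).mul hIηu)).mul hec) ?_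
    exact (((hηc.mul_left).mul_right).mul_left).mul_right
  have s1 : ∫ x, g.innerDual x (mvfderiv (𝓡 n) (fun y ↦ a y * (η y * η y)) x).toLinearMap
        (mvfderiv (𝓡 n) u x).toLinearMap * Real.exp (-V x) ∂g.riemVolume =
      ∫ x, (η x ^ 2 * g.innerDual x (mvfderiv (𝓡 n) a x).toLinearMap
          (mvfderiv (𝓡 n) u x).toLinearMap * Real.exp (-V x)
        + 2 * (a x * η x * g.innerDual x (mvfderiv (𝓡 n) η x).toLinearMap
            (mvfderiv (𝓡 n) u x).toLinearMap) * Real.exp (-V x)) ∂g.riemVolume :=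
    integral_congr_ae (Eventually.of_forall fun x ↦ by dsimp only; rw [hpt x]; ring)
  have s2 := integral_add i1 i2
  have s3 : ∫ x, 2 * (a x * η x * g.innerDual x (mvfderiv (𝓡 n) η x).toLinearMap
      (mvfderiv (𝓡 n) u x).toLinearMap) * Real.exp (-V x) ∂g.riemVolume =
      2 * ∫ x, a x * η x * g.innerDual x (mvfderiv (𝓡 n) η x).toLinearMap
          (mvfderiv (𝓡 n) u x).toLinearMap * Real.exp (-V x) ∂g.riemVolume := by
    rw [← integral_const_mul]
    exact integral_congr_ae (Eventually.of_forall fun x ↦ by ring)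
  have s0 : ∫ x, a x * η x ^ 2 * (g.dalembertian u x
        - g.innerDual x (mvfderiv (𝓡 n) V x).toLinearMap (mvfderiv (𝓡 n) u x).toLinearMap) *
        Real.exp (-V x) ∂g.riemVolume =
      ∫ x, a x * (η x * η x) * (g.dalembertian u x
        - g.innerDual x (mvfderiv (𝓡 n) V x).toLinearMap (mvfderiv (𝓡 n) u x).toLinearMap) *
        Real.exp (-V x) ∂g.riemVolume :=
    integral_congr_ae (Eventually.of_forall fun x ↦ by ring)
  rw [s0, hG, s1, s2, s3]
  ring

omit [T2Space M] [SecondCountableTopology M] [T3Space M] [MeasurableSpace M] [BorelSpace M]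
  [g.HasLeviCivita] in
/-- **The first-order absorption, pointwise**: `−4 (ρ − c) η g⁻¹(dη, dρ) ≤ η²|∇ρ|² + 4(ρ − c)²|∇η|²`
(`|g⁻¹(dη, dρ)| ≤ |∇η| |∇ρ|` and `2xy ≤ x² + y²`). [cite: BakryGentilLedoux2014, §3.2 (p. 142, the sequence ζ_k)] -/
theorem neg_four_mul_cutoff_innerDual_le (hg : g.IsRiemannian) (ρ η : M → ℝ) (c : ℝ) (x : M) :
    -(4 * ((ρ x - c) * η x * g.innerDual x (mvfderiv (𝓡 n) η x).toLinearMap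
        (mvfderiv (𝓡 n) ρ x).toLinearMap)) ≤
      η x ^ 2 * g.gradSq ρ x + 4 * ((ρ x - c) ^ 2 * g.gradSq η x) := by
  have hI := abs_innerDual_le_sqrt_gradSq_mul hg η ρ x
  set I := g.innerDual x (mvfderiv (𝓡 n) η x).toLinearMap (mvfderiv (𝓡 n) ρ x).toLinearMap
  have hη2 : Real.sqrt (g.gradSq η x) ^ 2 = g.gradSq η x := Real.sq_sqrt (g.gradSq_nonneg hg η x)
  have hρ2 : Real.sqrt (g.gradSq ρ x) ^ 2 = g.gradSq ρ x := Real.sq_sqrt (g.gradSq_nonneg hg ρ x)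
  have h1 : |4 * ((ρ x - c) * η x * I)| ≤
      2 * (|η x| * Real.sqrt (g.gradSq ρ x)) * (2 * |ρ x - c| * Real.sqrt (g.gradSq η x)) := by
    rw [abs_mul, abs_mul, abs_mul, abs_of_pos (by norm_num : (0 : ℝ) < 4)]
    have h0 : 0 ≤ |ρ x - c| * |η x| := mul_nonneg (abs_nonneg _) (abs_nonneg _)
    calc 4 * (|ρ x - c| * |η x| * |I|)
        ≤ 4 * (|ρ x - c| * |η x| * (Real.sqrt (g.gradSq η x) * Real.sqrt (g.gradSq ρ x))) :=
          mul_le_mul_of_nonneg_left (mul_le_mul_of_nonneg_left hI h0) (by norm_num)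
      _ = 2 * (|η x| * Real.sqrt (g.gradSq ρ x)) * (2 * |ρ x - c| * Real.sqrt (g.gradSq η x)) := by
          ring
  have h2 : 2 * (|η x| * Real.sqrt (g.gradSq ρ x)) * (2 * |ρ x - c| * Real.sqrt (g.gradSq η x)) ≤
      (|η x| * Real.sqrt (g.gradSq ρ x)) ^ 2 + (2 * |ρ x - c| * Real.sqrt (g.gradSq η x)) ^ 2 :=
    two_mul_le_add_sq _ _
  have h3 : (|η x| * Real.sqrt (g.gradSq ρ x)) ^ 2 + (2 * |ρ x - c| * Real.sqrt (g.gradSq η x)) ^ 2 =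
      η x ^ 2 * g.gradSq ρ x + 4 * ((ρ x - c) ^ 2 * g.gradSq η x) := by
    rw [mul_pow, mul_pow, mul_pow, sq_abs, sq_abs, hη2, hρ2]; ring
  linarith [neg_abs_le (4 * ((ρ x - c) * η x * I)), h1, h2, h3]

omit [T2Space M] [SecondCountableTopology M] [T3Space M] [MeasurableSpace M] [BorelSpace M]
  [g.HasLeviCivita] in
/-- `|∇η|²` vanishes off the topological support of `η`. [cite: BakryGentilLedoux2014, §3.2 (p. 142, the sequence ζ_k)] -/
theorem gradSq_eq_zero_of_notMem_tsupport {η : M → ℝ} {x : M} (hx : x ∉ tsupport η) :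
    g.gradSq η x = 0 :=
  g.gradSq_eq_zero_of_mvfderiv_eq_zero (mvfderiv_eq_zero_of_notMem_tsupport hx)

end Energy

end Literature.Geometry.Riemannian.BakryEmeryComplete

end Part4

/-!
## Part 5 — port of `Summits/SmoothPoincare4/SmoothPoincare4/Theorems/EntropyRungBakryEmeryLogSobolevStampacchia.lean` (3 declarations kept)

# The weak maximum principle for `𝕃²` solutions of the weighted heat equation on a complete
# manifold, with first-order (Gaffney) cut-offs

Setting: `M` modelled on `ℝⁿ` (Hausdorff, second countable, `T₃`, Borel — NOT compact), `g`
Riemannian with its Levi-Civita connection, `V` smooth (NO further assumption), `L = Δ_g − g⁻¹(dV, d·)`,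
weight `e^{-V} dV_g`; Gaffney cut-offs `η_k ∈ C_c^∞`, `0 ≤ η_k ≤ 1`, `η_k ≤ η_{k+1}`, `η_k(x) = 1`
for large `k`, `|∇η_k|² ≤ C₀/(k+1)²` (`exists_gaffney_cutoff`).

**Theorem** (`gaffney_maxPrinciple`). If `z` is smooth on `M × O` (`O ⊇ [0, T]` open),
`∂ₛz = Lz` on `[0, T] × M`, `z(0, ·) ≤ 0` and `z₊² e^{-V} ∈ L¹(M × (0,T))`, then `z ≤ 0` on
`[0, T] × M`.

Proof: Grigor'yan's energy method (2009, §11.4 / §12.1) with the SQUARE `Φ = Ψ²` of the convex test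
function of `exists_convexTest` (`Φ = 0` on `(−∞, 0]`, `Φ ≤ t₊²`, `Φ'² ≤ 2 Φ Φ''` — the inequality that
allows FIRST-ORDER cut-offs): `E_k(s) = ∫ Φ(z(s,·)) η_k² e^{-V}` has
`E_k' = −∫ η_k² Φ''(z)|∇z|² e^{-V} − 2∫ Φ'(z) η_k g⁻¹(dη_k, dz) e^{-V} ≤ 2 ∫ Φ(z) |∇η_k|² e^{-V}`
(`integral_mul_cutoffSq_mul_weightedLaplacian`, `sq_convexTest_absorb`), whence
`0 ≤ E_k(s) ≤ 2C₀/(k+1)² ∫∫ z₊² e^{-V} → 0`; `E_k(s)` is nondecreasing in `k`, so it vanishes and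
`z(s, x) ≤ 0` wherever some `η_k(x) = 1`. No bound on `Lη_k` is used (compare the shrinker toolkit's
`helper_weightedMaxPrinciple`). Everything is proved; no definitions, no named facts.

## References

* [Grigoryan2009] A. Grigor'yan, *Heat Kernel and Analysis on Manifolds* (2009), §11.4, §12.1.
* [BakryGentilLedoux2014] D. Bakry, I. Gentil, M. Ledoux (2014), §3.2, pp. 141–147.
-/

section Part5

open scoped _root_.Manifold _root_.ContDiff _root_.ENNReal _root_.NNReal _root_.Topology
open _root_.MeasureTheory _root_.Set _root_.Filter
open Literature.Geometry.Lorentzian Literature.Geometry.Riemannian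

namespace Literature.Geometry.Riemannian.BakryEmeryComplete

open NoncompactShrinkerGapHeat NoncompactShrinkerGapHeat.CutoffToolkit

/-! ### The pointwise absorption inequality behind `Φ = Ψ²` -/

/-- **First-order absorption for the squared test function.** For `ψ, ψ' ≥ 0`, `ψ'' ≥ 0`
(values of `Ψ, Ψ', Ψ''`), `Q = |∇z|² ≥ 0`, `G = |∇η|² ≥ 0` and `I = g⁻¹(dη, dz)` with `I² ≤ G Q`:
`−(η² (2ψ'² + 2ψψ'') Q) − 2 (2ψψ' η I) ≤ 2 ψ² G`, i.e. `−Φ''η²|∇z|² − 2Φ'η g⁻¹(dη,dz) ≤ 2Φ|∇η|²`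
for `Φ = Ψ²` (`(4ψψ'ηI)² ≤ (2ψ'²η²Q + 2ψ²G)²` since the difference is `4(ψ'²η²Q − ψ²G)² + 16ψ²ψ'²η²(GQ − I²)`).
[cite: Grigoryan2009, §11.4 and §12.1 (weak maximum principle by the energy method with cut-offs)] -/
theorem sq_convexTest_absorb {ψ ψ' ψ'' Q G I η : ℝ} (h0 : 0 ≤ ψ) (_h1 : 0 ≤ ψ') (h2 : 0 ≤ ψ'')
    (hQ : 0 ≤ Q) (hG : 0 ≤ G) (hI : I ^ 2 ≤ G * Q) :
    -(η ^ 2 * (2 * ψ' ^ 2 + 2 * ψ * ψ'') * Q) - 2 * (2 * ψ * ψ' * η * I) ≤ 2 * ψ ^ 2 * G := by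
  set a : ℝ := ψ' ^ 2 * η ^ 2 * Q with ha
  set b : ℝ := ψ ^ 2 * G with hb
  have ha0 : 0 ≤ a := mul_nonneg (mul_nonneg (sq_nonneg _) (sq_nonneg _)) hQ
  have hb0 : 0 ≤ b := mul_nonneg (sq_nonneg _) hG
  have hsq : (4 * ψ * ψ' * η * I) ^ 2 ≤ (2 * a + 2 * b) ^ 2 := by
    have e1 : (4 * ψ * ψ' * η * I) ^ 2 = 16 * (ψ ^ 2 * ψ' ^ 2 * η ^ 2) * I ^ 2 := by ring
    have e2 : (2 * a + 2 * b) ^ 2 = 4 * (a - b) ^ 2 + 16 * (ψ ^ 2 * ψ' ^ 2 * η ^ 2) * (G * Q) := by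
      simp only [ha, hb]; ring
    rw [e1, e2]
    have h3 : 0 ≤ 16 * (ψ ^ 2 * ψ' ^ 2 * η ^ 2) := by positivity
    nlinarith [mul_le_mul_of_nonneg_left hI h3, sq_nonneg (a - b)]
  have habs := abs_le_of_sq_le_sq' hsq (by linarith)
  have hcross : -(4 * ψ * ψ' * η * I) ≤ 2 * a + 2 * b := by linarith [habs.1]
  have hextra : 0 ≤ η ^ 2 * (2 * ψ * ψ'') * Q := by positivity
  have e3 : -(η ^ 2 * (2 * ψ' ^ 2 + 2 * ψ * ψ'') * Q) - 2 * (2 * ψ * ψ' * η * I) =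
      -(2 * a) - η ^ 2 * (2 * ψ * ψ'') * Q + -(4 * ψ * ψ' * η * I) := by simp only [ha]; ring
  rw [e3]
  linarith

section MaxPrinciple

variable {n : ℕ} {M : Type*} [TopologicalSpace M] [T2Space M] [SecondCountableTopology M]
  [ChartedSpace (EuclideanSpace ℝ (Fin n)) M] [IsManifold (𝓡 n) ∞ M] [T3Space M]
  [MeasurableSpace M] [BorelSpace M]
  {g : PseudoRiemannianMetric (𝓡 n) ∞ (EuclideanSpace ℝ (Fin n)) (TangentSpace (𝓡 n) : M → Type _)}
  [g.HasLeviCivita]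

/-- **The dissipation inequality for `Φ = Ψ²` with a first-order cut-off.** For `z, V` smooth,
`η ∈ C_c^∞`, and `Ψ` smooth with `Ψ, Ψ', Ψ'' ≥ 0`:
`∫ (2Ψ(z)Ψ'(z)) η² (Lz) e^{-V} ≤ 2 ∫ Ψ(z)² |∇η|² e^{-V}` — the weighted Green identity against
`Φ'(z) η²` (`integral_mul_cutoffSq_mul_weightedLaplacian`) and `sq_convexTest_absorb` pointwise.
[cite: Grigoryan2009, §12.1 (energy estimate with cut-off)] -/
theorem integral_sqTest_dissipation_le (hg : g.IsRiemannian) {z η V : M → ℝ}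
    (hz : ContMDiff (𝓡 n) 𝓘(ℝ, ℝ) ∞ z) (hη : ContMDiff (𝓡 n) 𝓘(ℝ, ℝ) ∞ η)
    (hηc : HasCompactSupport η) (hV : ContMDiff (𝓡 n) 𝓘(ℝ, ℝ) ∞ V)
    {Ψ : ℝ → ℝ} (hΨ : ContDiff ℝ ∞ Ψ) (hΨ0 : ∀ t, 0 ≤ Ψ t) (hΨ1 : ∀ t, 0 ≤ deriv Ψ t)
    (hΨ2 : ∀ t, 0 ≤ deriv (deriv Ψ) t) :
    ∫ x, (2 * Ψ (z x) * deriv Ψ (z x)) * η x ^ 2 * (g.dalembertian z x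
        - g.innerDual x (mvfderiv (𝓡 n) V x).toLinearMap (mvfderiv (𝓡 n) z x).toLinearMap) *
        Real.exp (-V x) ∂g.riemVolume ≤
      2 * ∫ x, Ψ (z x) ^ 2 * (g.gradSq η x * Real.exp (-V x)) ∂g.riemVolume := by
  haveI := CarrilloNi2009_shrinkerLSI.isFiniteMeasureOnCompacts_riemVolume hg
  have h1le : (1 : ℕ∞ω) ≤ (∞ : ℕ∞ω) := WithTop.coe_le_coe.mpr le_top
  -- the one-variable functions `φ₁ = Φ' = 2ΨΨ'`, `φ₂ = Φ'' = 2Ψ'² + 2ΨΨ''`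
  have hΨ' : ContDiff ℝ ∞ (deriv Ψ) := (contDiff_infty_iff_deriv.1 hΨ).2
  have hΨ'' : ContDiff ℝ ∞ (deriv (deriv Ψ)) := (contDiff_infty_iff_deriv.1 hΨ').2
  have hΨd : ∀ t, HasDerivAt Ψ (deriv Ψ t) t := fun t ↦ (hΨ.differentiable (by simp) t).hasDerivAt
  have hΨ'd : ∀ t, HasDerivAt (deriv Ψ) (deriv (deriv Ψ) t) t := fun t ↦
    (hΨ'.differentiable (by simp) t).hasDerivAt
  set φ₁ : ℝ → ℝ := fun t ↦ 2 * Ψ t * deriv Ψ t with hφ₁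
  set φ₂ : ℝ → ℝ := fun t ↦ 2 * deriv Ψ t ^ 2 + 2 * Ψ t * deriv (deriv Ψ) t with hφ₂
  have hφ₁s : ContDiff ℝ ∞ φ₁ := (contDiff_const.mul hΨ).mul hΨ'
  have hφ₁d : ∀ t, HasDerivAt φ₁ (φ₂ t) t := fun t ↦ by
    have h := (((hΨd t).const_mul 2).mul (hΨ'd t))
    refine h.congr_deriv ?_
    simp only [hφ₂]; ring
  -- the Green identity against `φ₁(z) η²`
  have ha : ContMDiff (𝓡 n) 𝓘(ℝ, ℝ) ∞ (fun y ↦ φ₁ (z y)) := hφ₁s.comp_contMDiff hz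
  have hid := integral_mul_cutoffSq_mul_weightedLaplacian hg (a := fun y ↦ φ₁ (z y)) ha hz hη hηc hV
  -- chain rule: `g⁻¹(d(φ₁∘z), dz) = φ₂(z) |∇z|²`
  have hzd : ∀ x, MDifferentiableAt (𝓡 n) 𝓘(ℝ, ℝ) z x := fun x ↦ hz.mdifferentiableAt (by simp)
  have hch : ∀ x, (mvfderiv (𝓡 n) (fun y ↦ φ₁ (z y)) x).toLinearMap =
      φ₂ (z x) • (mvfderiv (𝓡 n) z x).toLinearMap := fun x ↦ by
    ext v
    exact mvfderiv_real_comp_apply (I := 𝓡 n) (hφ₁d (z x)) (hzd x) v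
  have hpt1 : ∀ x, g.innerDual x (mvfderiv (𝓡 n) (fun y ↦ φ₁ (z y)) x).toLinearMap
      (mvfderiv (𝓡 n) z x).toLinearMap = φ₂ (z x) * g.gradSq z x := fun x ↦ by
    rw [hch x, g.innerDual_smul_left]; rfl
  -- the pointwise absorption
  have hpt : ∀ x, -(η x ^ 2 * g.innerDual x (mvfderiv (𝓡 n) (fun y ↦ φ₁ (z y)) x).toLinearMap
        (mvfderiv (𝓡 n) z x).toLinearMap * Real.exp (-V x))
      - 2 * ((fun y ↦ φ₁ (z y)) x * η x * g.innerDual x (mvfderiv (𝓡 n) η x).toLinearMap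
        (mvfderiv (𝓡 n) z x).toLinearMap * Real.exp (-V x)) ≤
      2 * (Ψ (z x) ^ 2 * (g.gradSq η x * Real.exp (-V x))) := by
    intro x
    rw [hpt1 x]
    have hI := abs_innerDual_le_sqrt_gradSq_mul hg η z x
    set I := g.innerDual x (mvfderiv (𝓡 n) η x).toLinearMap (mvfderiv (𝓡 n) z x).toLinearMap
    have hQ : 0 ≤ g.gradSq z x := g.gradSq_nonneg hg z x
    have hG : 0 ≤ g.gradSq η x := g.gradSq_nonneg hg η x
    have hI2 : I ^ 2 ≤ g.gradSq η x * g.gradSq z x := by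
      have h := pow_le_pow_left₀ (abs_nonneg I) hI 2
      rwa [sq_abs, mul_pow, Real.sq_sqrt hG, Real.sq_sqrt hQ] at h
    have habs := sq_convexTest_absorb (η := η x) (hΨ0 (z x)) (hΨ1 (z x)) (hΨ2 (z x)) hQ hG hI2
    have hex : 0 ≤ Real.exp (-V x) := (Real.exp_pos _).le
    have key := mul_le_mul_of_nonneg_right habs hex
    simp only [hφ₁, hφ₂] at key ⊢
    nlinarith [key]
  -- integrability (everything is continuous with compact support)
  have hec : Continuous fun x ↦ Real.exp (-V x) := Real.continuous_exp.comp hV.continuous.neg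
  have hgradη : Continuous (g.gradSq η) := (contMDiff_gradSq g hη).continuous
  have hgradηs : HasCompactSupport (g.gradSq η) :=
    HasCompactSupport.intro hηc fun x hx ↦ gradSq_eq_zero_of_notMem_tsupport hx
  have hη2c : HasCompactSupport (fun x ↦ η x ^ 2) := by
    rw [show (fun x ↦ η x ^ 2) = fun x ↦ η x * η x from funext fun x ↦ sq (η x)]
    exact hηc.mul_right
  have hI1c : Continuous fun x ↦ g.innerDual x (mvfderiv (𝓡 n) (fun y ↦ φ₁ (z y)) x).toLinearMap
      (mvfderiv (𝓡 n) z x).toLinearMap := continuous_innerDual_mvfderiv g (ha.of_le h1le) (hz.of_le h1le)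
  have hI2c : Continuous fun x ↦ g.innerDual x (mvfderiv (𝓡 n) η x).toLinearMap
      (mvfderiv (𝓡 n) z x).toLinearMap := continuous_innerDual_mvfderiv g (hη.of_le h1le) (hz.of_le h1le)
  have iA : Integrable (fun x ↦ η x ^ 2 * g.innerDual x
      (mvfderiv (𝓡 n) (fun y ↦ φ₁ (z y)) x).toLinearMap (mvfderiv (𝓡 n) z x).toLinearMap *
      Real.exp (-V x)) g.riemVolume :=
    integrable_of_continuous_of_hasCompactSupport' hg (((hη.continuous.pow 2).mul hI1c).mul hec)
      (hη2c.mul_right.mul_right)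
  have iB : Integrable (fun x ↦ (fun y ↦ φ₁ (z y)) x * η x * g.innerDual x
      (mvfderiv (𝓡 n) η x).toLinearMap (mvfderiv (𝓡 n) z x).toLinearMap * Real.exp (-V x)) g.riemVolume :=
    integrable_of_continuous_of_hasCompactSupport' hg (((ha.continuous.mul hη.continuous).mul hI2c).mul hec)
      (((hηc.mul_left).mul_right).mul_right)
  have iAn : Integrable (fun x ↦ -(η x ^ 2 * g.innerDual x
        (mvfderiv (𝓡 n) (fun y ↦ φ₁ (z y)) x).toLinearMap (mvfderiv (𝓡 n) z x).toLinearMap *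
          Real.exp (-V x))) g.riemVolume := iA.neg
  have iB2 : Integrable (fun x ↦ 2 * ((fun y ↦ φ₁ (z y)) x * η x * g.innerDual x
      (mvfderiv (𝓡 n) η x).toLinearMap (mvfderiv (𝓡 n) z x).toLinearMap * Real.exp (-V x))) g.riemVolume :=
    iB.const_mul 2
  have iL : Integrable (fun x ↦ -(η x ^ 2 * g.innerDual x
        (mvfderiv (𝓡 n) (fun y ↦ φ₁ (z y)) x).toLinearMap (mvfderiv (𝓡 n) z x).toLinearMap *
          Real.exp (-V x))
      - 2 * ((fun y ↦ φ₁ (z y)) x * η x * g.innerDual x (mvfderiv (𝓡 n) η x).toLinearMap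
        (mvfderiv (𝓡 n) z x).toLinearMap * Real.exp (-V x))) g.riemVolume :=
    iAn.sub iB2
  have iR : Integrable (fun x ↦ 2 * (Ψ (z x) ^ 2 * (g.gradSq η x * Real.exp (-V x)))) g.riemVolume := by
    refine (integrable_of_continuous_of_hasCompactSupport' hg
      (((hΨ.continuous.comp hz.continuous).pow 2).mul (hgradη.mul hec)) ?_).const_mul 2
    exact (hgradηs.mul_right).mul_left
  have hmono := integral_mono iL iR hpt
  rw [integral_sub iAn iB2, integral_neg, integral_const_mul, integral_const_mul] at hmono
  rw [hid]
  exact hmono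

/-- **Weak maximum principle for `𝕃²` solutions of the weighted heat equation on a complete
weighted manifold, with Gaffney cut-offs.** `V` smooth (no other assumption); `η_k ∈ C_c^∞`,
`0 ≤ η_k ≤ 1`, `η_k ≤ η_{k+1}`, `η_k(x) = 1` for large `k`, `|∇η_k|² ≤ C₀/(k+1)²`. If `z` is smooth on
`M × O` (`O ⊇ [0,T]` open) with `∂ₛz = Lz` on `[0, T]`, `z(0, ·) ≤ 0` and `z₊² e^{-V}` integrable on
the strip `M × (0, T)`, then `z ≤ 0` on `[0, T] × M`. Energy method with `Φ = Ψ²`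
(`exists_convexTest`, `integral_sqTest_dissipation_le`): `0 ≤ E_k(s) = ∫ Φ(z(s))η_k²e^{-V}
≤ 2C₀/(k+1)² ∫∫ z₊² e^{-V} → 0`, `E_k` nondecreasing in `k`. This is the uniqueness / comparison
class `𝕃²(e^{-V}dV_g ⊗ dt)` of the minimal heat semigroup on a complete weighted manifold.
[cite: Grigoryan2009, §11.4 and §12.1] [cite: BakryGentilLedoux2014, §3.2 (pp. 141–147)] -/
theorem gaffney_maxPrinciple (hg : g.IsRiemannian) {V : M → ℝ} (hV : ContMDiff (𝓡 n) 𝓘(ℝ, ℝ) ∞ V)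
    {η : ℕ → M → ℝ} {C₀ : ℝ} (hηs : ∀ k, ContMDiff (𝓡 n) 𝓘(ℝ, ℝ) ∞ (η k))
    (hηc : ∀ k, HasCompactSupport (η k)) (hη01 : ∀ k x, 0 ≤ η k x ∧ η k x ≤ 1)
    (hηmono : ∀ k x, η k x ≤ η (k + 1) x) (hη1 : ∀ x, ∀ᶠ k in atTop, η k x = 1)
    (hηgrad : ∀ k x, g.gradSq (η k) x ≤ C₀ / ((k : ℝ) + 1) ^ 2)
    {T : ℝ} {O : Set ℝ} {z : ℝ → M → ℝ} (hO : IsOpen O) (hTO : Icc 0 T ⊆ O)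
    (hz : ContMDiffOn ((𝓡 n).prod 𝓘(ℝ, ℝ)) 𝓘(ℝ, ℝ) ∞ (fun p : M × ℝ ↦ z p.2 p.1) (univ ×ˢ O))
    (heq : ∀ s ∈ Icc 0 T, ∀ x, deriv (fun r ↦ z r x) s = g.dalembertian (z s) x
      - g.innerDual x (mvfderiv (𝓡 n) V x).toLinearMap (mvfderiv (𝓡 n) (z s) x).toLinearMap)
    (hz0 : ∀ x, z 0 x ≤ 0)
    (hint : Integrable (fun p : M × ℝ ↦ max (z p.2 p.1) 0 ^ 2 * Real.exp (-V p.1))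
      ((g.riemVolume.prod (volume : Measure ℝ)).restrict (univ ×ˢ Ioo 0 T))) :
    ∀ s ∈ Icc 0 T, ∀ x, z s x ≤ 0 := by
  intro s₀ hs₀ x₀
  -- topology and measure
  haveI : LocallyCompactSpace M := Manifold.locallyCompact_of_finiteDimensional (M := M) (𝓡 n)
  haveI : IsFiniteMeasureOnCompacts g.riemVolume := CarrilloNi2009_shrinkerLSI.isFiniteMeasureOnCompacts_riemVolume hg
  haveI : IsLocallyFiniteMeasure g.riemVolume := isLocallyFiniteMeasure_of_isFiniteMeasureOnCompacts
  haveI : g.riemVolume.IsOpenPosMeasure := isOpenPosMeasure_riemVolume hg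
  haveI := sigmaFinite_riemVolume hg
  set μ : Measure M := g.riemVolume with hμ
  have hεpos : ∀ k : ℕ, (0 : ℝ) < ((k : ℝ) + 1) ^ 2 := fun k ↦ by positivity
  -- the test function `Φ = Ψ²`
  obtain ⟨Ψ, hΨs, hΨneg, hΨ', hΨ'', hΨbd, hΨzero⟩ := exists_convexTest
  have hΨd : ∀ t, HasDerivAt Ψ (deriv Ψ t) t := fun t ↦ (hΨs.differentiable (by simp) t).hasDerivAt
  have hΨc : Continuous Ψ := hΨs.continuous
  have hΨ'c : Continuous (deriv Ψ) := hΨs.continuous_deriv (by simp)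
  have hΦbd : ∀ t, Ψ t ^ 2 ≤ max t 0 ^ 2 := fun t ↦ pow_le_pow_left₀ (hΨbd t).1 (hΨbd t).2 2
  -- regularity of `z`: slices, joint continuity, time derivative
  have hexpc : Continuous fun x ↦ Real.exp (-V x) := Real.continuous_exp.comp hV.continuous.neg
  have hzs : ∀ s ∈ O, ContMDiff (𝓡 n) 𝓘(ℝ, ℝ) ∞ (z s) := fun s hs ↦ contMDiff_slice_of_contMDiffOn hz hs
  have hzc : ContinuousOn (fun p : M × ℝ ↦ z p.2 p.1) (univ ×ˢ O) := hz.continuousOn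
  have hz'c : ContinuousOn (fun p : M × ℝ ↦ deriv (fun r ↦ z r p.1) p.2) (univ ×ˢ O) := continuousOn_deriv_time hO hz
  -- the integrands `F = Ψ(z)²`, `F' = 2Ψ(z)Ψ'(z) ∂ₛz`
  set F : ℝ → M → ℝ := fun s x ↦ Ψ (z s x) ^ 2 with hF
  set F' : ℝ → M → ℝ := fun s x ↦ 2 * Ψ (z s x) * deriv Ψ (z s x) * deriv (fun r ↦ z r x) s with hF'
  have hFc : ContinuousOn (fun p : M × ℝ ↦ F p.2 p.1) (univ ×ˢ O) := (hΨc.comp_continuousOn hzc).pow 2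
  have hF'c : ContinuousOn (fun p : M × ℝ ↦ F' p.2 p.1) (univ ×ˢ O) :=
    ((continuousOn_const.mul (hΨc.comp_continuousOn hzc)).mul (hΨ'c.comp_continuousOn hzc)).mul hz'c
  have hFd : ∀ s ∈ O, ∀ x, HasDerivAt (F · x) (F' s x) s := fun s hs x ↦ by
    have h1 : HasDerivAt (fun r ↦ Ψ (z r x)) (deriv Ψ (z s x) * deriv (fun r ↦ z r x) s) s :=
      (hΨd (z s x)).comp s (CutoffToolkit.hasDerivAt_time hO hz x hs)
    have h := h1.mul h1
    have e1 : (F · x) = fun r ↦ Ψ (z r x) * Ψ (z r x) := funext fun r ↦ by simp only [hF, sq]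
    rw [e1]
    refine h.congr_deriv ?_
    simp only [hF']
    ring
  -- the weights `h k = η_k² e^{-V}`, energies `E k`, derivatives `E' k`, error terms `Y k`
  have hη2c : ∀ k, HasCompactSupport (fun x ↦ η k x ^ 2) := fun k ↦ by
    rw [show (fun x ↦ η k x ^ 2) = fun x ↦ η k x * η k x from funext fun x ↦ sq (η k x)]
    exact (hηc k).mul_right
  set h : ℕ → M → ℝ := fun k x ↦ η k x ^ 2 * Real.exp (-V x) with hh
  have hhc : ∀ k, Continuous (h k) := fun k ↦ ((hηs k).continuous.pow 2).mul hexpc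
  have hhs : ∀ k, HasCompactSupport (h k) := fun k ↦ (hη2c k).mul_right
  have hh0 : ∀ k x, 0 ≤ h k x := fun k x ↦ mul_nonneg (sq_nonneg _) (Real.exp_pos _).le
  have hgradηc : ∀ k, Continuous (g.gradSq (η k)) := fun k ↦ (contMDiff_gradSq g (hηs k)).continuous
  have hgradηs : ∀ k, HasCompactSupport (g.gradSq (η k)) := fun k ↦
    HasCompactSupport.intro (hηc k) fun x hx ↦ gradSq_eq_zero_of_notMem_tsupport hx
  set wY : ℕ → M → ℝ := fun k x ↦ g.gradSq (η k) x * Real.exp (-V x) with hwY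
  have hwYc : ∀ k, Continuous (wY k) := fun k ↦ (hgradηc k).mul hexpc
  have hwYs : ∀ k, HasCompactSupport (wY k) := fun k ↦ (hgradηs k).mul_right
  set E : ℕ → ℝ → ℝ := fun k s ↦ ∫ x, F s x * h k x ∂μ with hE
  set E' : ℕ → ℝ → ℝ := fun k s ↦ ∫ x, F' s x * h k x ∂μ with hE'
  set Y : ℕ → ℝ → ℝ := fun k s ↦ ∫ x, F s x * wY k x ∂μ with hYdef
  have hEd : ∀ k, ∀ s ∈ O, HasDerivAt (E k) (E' k s) s := fun k s hs ↦
    hasDerivAt_integral_mul_of_hasCompactSupport μ (hhc k) (hhs k) hO hFc hF'c hFd hs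
  have hE'c : ∀ k, ContinuousOn (E' k) O := fun k ↦ continuousOn_integral_mul_of_hasCompactSupport μ (hhc k) (hhs k) hF'c
  have hYc : ∀ k, ContinuousOn (Y k) O := fun k ↦ continuousOn_integral_mul_of_hasCompactSupport μ (hwYc k) (hwYs k) hFc
  -- the dissipation bound `E' ≤ 2 Y` on `[0, T]`
  have hE'le : ∀ k, ∀ s ∈ Icc 0 T, E' k s ≤ 2 * Y k s := by
    intro k s hs
    have hsO := hTO hs
    have hws := hzs s hsO
    have step := integral_sqTest_dissipation_le hg hws (hηs k) (hηc k) hV hΨs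
      (fun t ↦ (hΨbd t).1) (fun t ↦ (hΨ' t).1) hΨ''
    have e1 : E' k s = ∫ x, (2 * Ψ (z s x) * deriv Ψ (z s x)) * η k x ^ 2 * (g.dalembertian (z s) x
        - g.innerDual x (mvfderiv (𝓡 n) V x).toLinearMap (mvfderiv (𝓡 n) (z s) x).toLinearMap) *
        Real.exp (-V x) ∂μ := by
      refine integral_congr_ae (Eventually.of_forall fun x ↦ ?_)
      simp only [hF', hh, heq s hs x]
      ring
    have e2 : 2 * Y k s = 2 * ∫ x, Ψ (z s x) ^ 2 * (g.gradSq (η k) x * Real.exp (-V x)) ∂μ := by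
      simp only [hYdef, hF, hwY]
    rw [e1, e2]
    exact step
  -- integrating in time: `E k s₀ ≤ 2 ∫₀^{s₀} Y k ≤ 2 C₀/(k+1)² P`
  set ν : Measure (M × ℝ) := (μ.prod (volume : Measure ℝ)).restrict (univ ×ˢ Ioo 0 T) with hν
  set P : ℝ := ∫ p, max (z p.2 p.1) 0 ^ 2 * Real.exp (-V p.1) ∂ν with hP
  have hEbound : ∀ k, E k s₀ ≤ 2 * (C₀ / ((k : ℝ) + 1) ^ 2 * P) := by
    intro k
    rcases eq_or_lt_of_le hs₀.1 with h0 | hpos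
    · -- `s₀ = 0`: `E k 0 = 0`
      have hE0 : E k s₀ = 0 := by
        rw [← h0]
        refine integral_eq_zero_of_ae (ae_of_all _ fun x ↦ ?_)
        simp [hF, hΨneg _ (hz0 x)]
      rw [hE0]
      have hC : 0 ≤ C₀ / ((k : ℝ) + 1) ^ 2 := by
        have h1 := hηgrad k x₀
        exact (g.gradSq_nonneg hg _ _).trans h1
      positivity
    · have hIcc : Icc 0 s₀ ⊆ O := fun s hs ↦ hTO ⟨hs.1, hs.2.trans hs₀.2⟩
      have hderiv : ∀ s ∈ uIcc 0 s₀, HasDerivAt (E k) (E' k s) s := by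
        intro s hs
        rw [uIcc_of_le hs₀.1] at hs
        exact hEd k s (hIcc hs)
      have hE'i : IntervalIntegrable (E' k) volume 0 s₀ :=
        ((hE'c k).mono (by rw [uIcc_of_le hs₀.1]; exact hIcc)).intervalIntegrable
      have hYi : IntervalIntegrable (Y k) volume 0 s₀ :=
        ((hYc k).mono (by rw [uIcc_of_le hs₀.1]; exact hIcc)).intervalIntegrable
      have hYi2 : IntervalIntegrable (fun s ↦ 2 * Y k s) volume 0 s₀ := hYi.const_mul 2
      have hFTC := intervalIntegral.integral_eq_sub_of_hasDerivAt hderiv hE'i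
      have hE0 : E k 0 = 0 := by
        refine integral_eq_zero_of_ae (ae_of_all _ fun x ↦ ?_)
        simp [hF, hΨneg _ (hz0 x)]
      -- Fubini on the strip `M × (0, s₀)` for `Y k`, then compare with `P`
      set ν' : Measure (M × ℝ) := (μ.prod (volume : Measure ℝ)).restrict (univ ×ˢ Ioo 0 s₀) with hν'
      have hYF : ∫ p, F p.2 p.1 * wY k p.1 ∂ν' = ∫ s in (0 : ℝ)..s₀, Y k s :=
        integral_strip_eq_intervalIntegral μ hs₀.1
          (integrable_strip_mul_of_hasCompactSupport μ (hFc.mono (prod_mono le_rfl hIcc)) (hwYc k)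
            (hwYs k))
      have hsub : (univ : Set M) ×ˢ Ioo (0 : ℝ) s₀ ⊆ (univ : Set M) ×ˢ Ioo 0 T :=
        prod_mono le_rfl (Ioo_subset_Ioo le_rfl hs₀.2)
      have hintP' : Integrable (fun p : M × ℝ ↦ max (z p.2 p.1) 0 ^ 2 * Real.exp (-V p.1)) ν' :=
        hint.mono_measure (Measure.restrict_mono hsub le_rfl)
      have hmeasF : AEStronglyMeasurable (fun p : M × ℝ ↦ F p.2 p.1 * wY k p.1) ν' :=
        aestronglyMeasurable_strip μ ((hFc.mono (prod_mono le_rfl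
          (Ioo_subset_Icc_self.trans hIcc))).mul ((hwYc k).comp continuous_fst).continuousOn)
      have hbd : ∀ p : M × ℝ, ‖F p.2 p.1 * wY k p.1‖ ≤
          C₀ / ((k : ℝ) + 1) ^ 2 * (max (z p.2 p.1) 0 ^ 2 * Real.exp (-V p.1)) := by
        intro p
        rw [Real.norm_eq_abs, abs_of_nonneg (mul_nonneg (sq_nonneg _)
          (mul_nonneg (g.gradSq_nonneg hg _ _) (Real.exp_pos _).le))]
        change Ψ (z p.2 p.1) ^ 2 * (g.gradSq (η k) p.1 * Real.exp (-V p.1)) ≤ _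
        have h1 := hΦbd (z p.2 p.1)
        have h2 := hηgrad k p.1
        have hex := (Real.exp_pos (-V p.1)).le
        have h3 : 0 ≤ max (z p.2 p.1) 0 ^ 2 := sq_nonneg _
        calc Ψ (z p.2 p.1) ^ 2 * (g.gradSq (η k) p.1 * Real.exp (-V p.1))
            ≤ max (z p.2 p.1) 0 ^ 2 * (C₀ / ((k : ℝ) + 1) ^ 2 * Real.exp (-V p.1)) :=
              mul_le_mul h1 (mul_le_mul_of_nonneg_right h2 hex) (mul_nonneg (g.gradSq_nonneg hg _ _) hex) h3
          _ = C₀ / ((k : ℝ) + 1) ^ 2 * (max (z p.2 p.1) 0 ^ 2 * Real.exp (-V p.1)) := by ring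
      have hstrip_le : ∫ p, F p.2 p.1 * wY k p.1 ∂ν' ≤ C₀ / ((k : ℝ) + 1) ^ 2 * P := by
        calc ∫ p, F p.2 p.1 * wY k p.1 ∂ν' ≤ ∫ p, ‖F p.2 p.1 * wY k p.1‖ ∂ν' :=
              (Real.le_norm_self _).trans (norm_integral_le_integral_norm _)
          _ ≤ ∫ p, C₀ / ((k : ℝ) + 1) ^ 2 * (max (z p.2 p.1) 0 ^ 2 * Real.exp (-V p.1)) ∂ν' :=
              integral_mono_of_nonneg (Eventually.of_forall fun p ↦ norm_nonneg _) (hintP'.const_mul _)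
                (Eventually.of_forall hbd)
          _ = C₀ / ((k : ℝ) + 1) ^ 2 * ∫ p, max (z p.2 p.1) 0 ^ 2 * Real.exp (-V p.1) ∂ν' :=
              integral_const_mul _ _
          _ ≤ C₀ / ((k : ℝ) + 1) ^ 2 * P := by
              refine mul_le_mul_of_nonneg_left ?_ ((g.gradSq_nonneg hg _ x₀).trans (hηgrad k x₀))
              exact integral_mono_measure (Measure.restrict_mono hsub le_rfl)
                (Eventually.of_forall fun p ↦ mul_nonneg (sq_nonneg _) (Real.exp_pos _).le) hint
      calc E k s₀ = ∫ s in (0 : ℝ)..s₀, E' k s := by rw [hFTC, hE0, sub_zero]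
        _ ≤ ∫ s in (0 : ℝ)..s₀, 2 * Y k s :=
            intervalIntegral.integral_mono_on hs₀.1 hE'i hYi2 fun s hs ↦ hE'le k s ⟨hs.1, hs.2.trans hs₀.2⟩
        _ = 2 * ∫ s in (0 : ℝ)..s₀, Y k s := intervalIntegral.integral_const_mul _ _
        _ = 2 * ∫ p, F p.2 p.1 * wY k p.1 ∂ν' := by rw [hYF]
        _ ≤ 2 * (C₀ / ((k : ℝ) + 1) ^ 2 * P) := by linarith [hstrip_le]
  -- the bound tends to `0`
  have hlim : Tendsto (fun k : ℕ ↦ 2 * (C₀ / ((k : ℝ) + 1) ^ 2 * P)) atTop (𝓝 0) := by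
    have h1 : Tendsto (fun k : ℕ ↦ ((k : ℝ) + 1) ^ 2) atTop atTop :=
      (tendsto_pow_atTop two_ne_zero).comp
        (tendsto_atTop_add_const_right _ 1 (tendsto_natCast_atTop_atTop (R := ℝ)))
    have h2 : Tendsto (fun k : ℕ ↦ C₀ / ((k : ℝ) + 1) ^ 2) atTop (𝓝 0) :=
      tendsto_const_nhds.div_atTop h1
    simpa using (h2.mul_const P).const_mul 2
  -- every energy vanishes at `s₀`
  have hs₀O := hTO hs₀
  have hFsc : Continuous (F s₀) := (hΨc.comp (hzs s₀ hs₀O).continuous).pow 2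
  have hEi : ∀ k, Integrable (fun x ↦ F s₀ x * h k x) μ := fun k ↦
    integrable_of_continuous_of_hasCompactSupport' hg (hFsc.mul (hhc k)) ((hhs k).mul_left)
  have hEmono : ∀ k j, k ≤ j → E k s₀ ≤ E j s₀ := by
    intro k j hkj
    refine integral_mono (hEi k) (hEi j) fun x ↦ ?_
    have hηle : η k x ≤ η j x := (monotone_nat_of_le_succ fun m ↦ hηmono m x) hkj
    have hη2le : η k x ^ 2 ≤ η j x ^ 2 := pow_le_pow_left₀ (hη01 k x).1 hηle 2
    exact mul_le_mul_of_nonneg_left (mul_le_mul_of_nonneg_right hη2le (Real.exp_pos _).le)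
      (sq_nonneg _)
  have hEzero : ∀ k, E k s₀ = 0 := by
    intro k
    refine le_antisymm ?_ (integral_nonneg fun x ↦ mul_nonneg (sq_nonneg _) (hh0 k x))
    exact ge_of_tendsto hlim (eventually_atTop.2 ⟨k, fun j hj ↦ (hEmono k j hj).trans (hEbound j)⟩)
  -- conclusion at `x₀`
  obtain ⟨k, hk1⟩ := (hη1 x₀).exists
  have hcont : Continuous fun x ↦ F s₀ x * h k x := hFsc.mul (hhc k)
  have hnn : 0 ≤ fun x ↦ F s₀ x * h k x := fun x ↦ mul_nonneg (sq_nonneg _) (hh0 k x)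
  have hae := (integral_eq_zero_iff_of_nonneg hnn (hEi k)).1 (hEzero k)
  have heq0 := (hcont.ae_eq_iff_eq μ continuous_const).1 hae
  have hx : F s₀ x₀ * h k x₀ = 0 := congr_fun heq0 x₀
  have hpos : 0 < h k x₀ := by simp only [hh, hk1, one_pow, one_mul]; exact Real.exp_pos _
  have hΦ0 : Ψ (z s₀ x₀) ^ 2 = 0 := by
    rcases mul_eq_zero.1 hx with h0 | h0
    · exact h0
    · exact absurd h0 hpos.ne'
  exact hΨzero _ (pow_eq_zero_iff two_ne_zero |>.1 hΦ0)

end MaxPrinciple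

end Literature.Geometry.Riemannian.BakryEmeryComplete

end Part5

/-!
## Part 6 — port of `Summits/SmoothPoincare4/SmoothPoincare4/Theorems/EntropyRungBakryEmeryLogSobolevGaffneyEnergy.lean` (2 declarations kept)

# The energy estimate of the weighted heat flow on a complete manifold with first-order
# (Gaffney) cut-offs

Setting: `M` modelled on `ℝⁿ` (Hausdorff, second countable, `T₃`, Borel — NOT compact), `g`
Riemannian with its Levi-Civita connection, `V` smooth (NO further assumption on `V`),
`L = Δ_g − g⁻¹(dV, d·)`, weight `e^{-V} dV_g`, Gaffney cut-offs `η_k ∈ C_c^∞`, `0 ≤ η_k ≤ 1`,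
`η_k → 1` pointwise, `|∇η_k|² ≤ C₀/(k+1)²` (`EntropyRungBakryEmeryLogSobolevGaffneyCutoff.lean`).

* `integral_gradSq_cutoffSq_le` — the integrated energy inequality with ONE cut-off `η`:
  `∫∫_{M×(0,T)} η²|∇ρ|² e^{-V} ≤ E(0) − E(T) + 4 ∫∫_{M×(0,T)} (ρ − c)² |∇η|² e^{-V}`,
  `E(s) = ∫ (ρ(s) − c)² η² e^{-V}`, for a solution `∂ₛρ = Lρ` on `[0, T]` smooth on `M × O`
  (`O ⊇ [0,T]` open): `E' = 2∫(ρ−c)η²(Lρ)e^{-V} = −2∫η²|∇ρ|²e^{-V} − 4∫(ρ−c)η g⁻¹(dη,dρ)e^{-V}` and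
  `4|(ρ−c) η g⁻¹(dη,dρ)| ≤ η²|∇ρ|² + 4(ρ−c)²|∇η|²` (the first-order absorption);
* `gaffney_energyEstimate` — **with Gaffney cut-offs: if `(ρ − c)² e^{-V}` is integrable on the
  strip and at `s = 0`, then `|∇ρ|² e^{-V}` is integrable on the strip and
  `∫∫_{M×(0,T)} |∇ρ|² e^{-V} ≤ ∫ (ρ(0) − c)² e^{-V}`** (Fatou in `k`, the error being
  `≤ 4C₀/(k+1)² ∫∫(ρ − c)² e^{-V}`).

This is the `L²` ("finite energy") route of Bakry–Gentil–Ledoux (2014), §3.2, pp. 141–147, where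
every integration by parts on the complete manifold is justified with cut-offs `ζ_k` having only
`Γ(ζ_k) ≤ 1/k`. Everything is proved; no definitions, no named facts.

## References

* [BakryGentilLedoux2014] D. Bakry, I. Gentil, M. Ledoux, *Analysis and Geometry of Markov
  Diffusion Operators*, Springer 2014, §3.2 (pp. 141–147), Prop. 3.2.1, Thm. 3.2.6 (proofs).
* [Gaffney1954] M. P. Gaffney, Ann. of Math. 60 (1954) 140–145 (cut-offs on complete manifolds).
* [CarrilloNi2009] J. A. Carrillo, L. Ni, Comm. Anal. Geom. 17 (2009), §4.
-/

section Part6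

open scoped _root_.Manifold _root_.ContDiff _root_.ENNReal _root_.NNReal _root_.Topology
open _root_.MeasureTheory _root_.Set _root_.Filter
open Literature.Geometry.Lorentzian Literature.Geometry.Riemannian

namespace Literature.Geometry.Riemannian.BakryEmeryComplete

open NoncompactShrinkerGapHeat NoncompactShrinkerGapHeat.CutoffToolkit

section Energy

variable {n : ℕ} {M : Type*} [TopologicalSpace M] [T2Space M] [SecondCountableTopology M]
  [ChartedSpace (EuclideanSpace ℝ (Fin n)) M] [IsManifold (𝓡 n) ∞ M] [T3Space M]
  [MeasurableSpace M] [BorelSpace M]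
  {g : PseudoRiemannianMetric (𝓡 n) ∞ (EuclideanSpace ℝ (Fin n)) (TangentSpace (𝓡 n) : M → Type _)}
  [g.HasLeviCivita]

/-! ### The integrated energy inequality with one first-order cut-off -/

/-- **The integrated energy inequality with one cut-off, first-order version.** For `V` smooth,
`η ∈ C_c^∞`, `ρ` smooth on `M × O` (`O ⊇ [0, T]` open) with `∂ₛρ = Lρ` on `[0, T]`, and a constant `c`:
`∫∫_{M×(0,T)} η²|∇ρ|² e^{-V} ≤ E(0) − E(T) + 4 ∫∫_{M×(0,T)} (ρ − c)²|∇η|² e^{-V}`,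
`E(s) = ∫ (ρ(s) − c)² η² e^{-V}`: `E' = 2∫(ρ − c)η²(Lρ)e^{-V} = −2∫η²|∇ρ|²e^{-V} − 4∫(ρ−c)η g⁻¹(dη,dρ)e^{-V}
≤ −∫η²|∇ρ|²e^{-V} + 4∫(ρ−c)²|∇η|²e^{-V}` (Leibniz rule, `integral_mul_cutoffSq_mul_weightedLaplacian`,
`neg_four_mul_cutoff_innerDual_le`), integrated over `[0, T]` (FTC, Fubini). Only `|∇η|` enters —
no bound on `Lη` is used. [cite: BakryGentilLedoux2014, §3.2 (pp. 141–147)] -/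
theorem integral_gradSq_cutoffSq_le (hg : g.IsRiemannian) {V : M → ℝ}
    (hV : ContMDiff (𝓡 n) 𝓘(ℝ, ℝ) ∞ V) {η : M → ℝ} (hη : ContMDiff (𝓡 n) 𝓘(ℝ, ℝ) ∞ η)
    (hηc : HasCompactSupport η) {T : ℝ} {O : Set ℝ} {ρ : ℝ → M → ℝ} (hT : 0 < T) (hO : IsOpen O)
    (hTO : Icc 0 T ⊆ O)
    (hρ : ContMDiffOn ((𝓡 n).prod 𝓘(ℝ, ℝ)) 𝓘(ℝ, ℝ) ∞ (fun p : M × ℝ ↦ ρ p.2 p.1) (univ ×ˢ O))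
    (heq : ∀ s ∈ Icc 0 T, ∀ x, deriv (fun r ↦ ρ r x) s = g.dalembertian (ρ s) x
      - g.innerDual x (mvfderiv (𝓡 n) V x).toLinearMap (mvfderiv (𝓡 n) (ρ s) x).toLinearMap)
    (c : ℝ) :
    ∫ p, g.gradSq (ρ p.2) p.1 * (η p.1 ^ 2 * Real.exp (-V p.1))
        ∂(g.riemVolume.prod (volume : Measure ℝ)).restrict (univ ×ˢ Ioo 0 T) ≤
      ∫ x, (ρ 0 x - c) ^ 2 * (η x ^ 2 * Real.exp (-V x)) ∂g.riemVolume
        - ∫ x, (ρ T x - c) ^ 2 * (η x ^ 2 * Real.exp (-V x)) ∂g.riemVolume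
        + 4 * ∫ p, (ρ p.2 p.1 - c) ^ 2 * (g.gradSq η p.1 * Real.exp (-V p.1))
            ∂(g.riemVolume.prod (volume : Measure ℝ)).restrict (univ ×ˢ Ioo 0 T) := by
  haveI := CarrilloNi2009_shrinkerLSI.isFiniteMeasureOnCompacts_riemVolume hg
  haveI := sigmaFinite_riemVolume hg
  have h01 : (0 : ℝ) ≤ T := hT.le
  set μ : Measure M := g.riemVolume with hμ
  -- the two compactly supported weights `η² e^{-V}` and `|∇η|² e^{-V}`
  have hec : Continuous fun x ↦ Real.exp (-V x) := Real.continuous_exp.comp hV.continuous.neg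
  have hη2c : HasCompactSupport (fun x ↦ η x ^ 2) := by
    rw [show (fun x ↦ η x ^ 2) = fun x ↦ η x * η x from funext fun x ↦ sq (η x)]
    exact hηc.mul_right
  have hwE : Continuous fun x ↦ η x ^ 2 * Real.exp (-V x) := (hη.continuous.pow 2).mul hec
  have hwEc : HasCompactSupport fun x ↦ η x ^ 2 * Real.exp (-V x) := hη2c.mul_right
  have hgradη : Continuous (g.gradSq η) := (contMDiff_gradSq g hη).continuous
  have hgradηs : HasCompactSupport (g.gradSq η) :=
    HasCompactSupport.intro hηc fun x hx ↦ gradSq_eq_zero_of_notMem_tsupport hx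
  have hwY : Continuous fun x ↦ g.gradSq η x * Real.exp (-V x) := hgradη.mul hec
  have hwYc : HasCompactSupport fun x ↦ g.gradSq η x * Real.exp (-V x) := hgradηs.mul_right
  -- slices and time derivatives of `ρ`
  have hslice : ∀ s ∈ O, ContMDiff (𝓡 n) 𝓘(ℝ, ℝ) ∞ (ρ s) := fun s hs ↦
    contMDiff_slice_of_contMDiffOn hρ hs
  have hρc : ContinuousOn (fun p : M × ℝ ↦ ρ p.2 p.1) (univ ×ˢ O) := hρ.continuousOn
  have hρ'c : ContinuousOn (fun p : M × ℝ ↦ deriv (fun r ↦ ρ r p.1) p.2) (univ ×ˢ O) :=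
    continuousOn_deriv_time hO hρ
  have hF : ContinuousOn (fun p : M × ℝ ↦ (ρ p.2 p.1 - c) ^ 2) (univ ×ˢ O) :=
    (hρc.sub continuousOn_const).pow 2
  have hF' : ContinuousOn (fun p : M × ℝ ↦ 2 * (ρ p.2 p.1 - c) * deriv (fun r ↦ ρ r p.1) p.2)
      (univ ×ˢ O) := (continuousOn_const.mul (hρc.sub continuousOn_const)).mul hρ'c
  have hd : ∀ s ∈ O, ∀ x, HasDerivAt (fun r ↦ (ρ r x - c) ^ 2)
      (2 * (ρ s x - c) * deriv (fun r ↦ ρ r x) s) s := by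
    intro s hs x
    have h := ((CutoffToolkit.hasDerivAt_time hO hρ x hs).sub_const c).pow 2
    refine h.congr_deriv ?_
    norm_num
  have hgradc : ContinuousOn (fun p : M × ℝ ↦ g.gradSq (ρ p.2) p.1) (univ ×ˢ O) :=
    (contMDiffOn_gradSq_family g hO.uniqueDiffOn hρ).continuousOn
  -- the energy `E`, its derivative `E'`, the gradient term `G` and the error term `Y`
  set E : ℝ → ℝ := fun s ↦ ∫ x, (ρ s x - c) ^ 2 * (η x ^ 2 * Real.exp (-V x)) ∂μ with hE
  set E' : ℝ → ℝ := fun s ↦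
    ∫ x, (2 * (ρ s x - c) * deriv (fun r ↦ ρ r x) s) * (η x ^ 2 * Real.exp (-V x)) ∂μ with hE'
  set G : ℝ → ℝ := fun s ↦ ∫ x, g.gradSq (ρ s) x * (η x ^ 2 * Real.exp (-V x)) ∂μ with hG
  set Y : ℝ → ℝ := fun s ↦ ∫ x, (ρ s x - c) ^ 2 * (g.gradSq η x * Real.exp (-V x)) ∂μ with hY
  have hEd : ∀ s ∈ O, HasDerivAt E (E' s) s := fun s hs ↦
    hasDerivAt_integral_mul_of_hasCompactSupport μ hwE hwEc hO hF hF' hd hs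
  have hE'c : ContinuousOn E' O := continuousOn_integral_mul_of_hasCompactSupport μ hwE hwEc hF'
  have hGc : ContinuousOn G O := continuousOn_integral_mul_of_hasCompactSupport μ hwE hwEc hgradc
  have hYc : ContinuousOn Y O := continuousOn_integral_mul_of_hasCompactSupport μ hwY hwYc hF
  -- `E' ≤ -G + 4 Y` on `[0, T]`
  have hE'le : ∀ s ∈ Icc 0 T, E' s ≤ -G s + 4 * Y s := by
    intro s hs
    have hsO := hTO hs
    have hρs := hslice s hsO
    have hid := integral_mul_cutoffSq_mul_weightedLaplacian hg (a := fun y ↦ ρ s y - c)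
      (hρs.sub contMDiff_const) hρs hη hηc hV
    -- `E' s = 2 ∫ (ρ - c) η² (Lρ) e^{-V}`
    have e0 : E' s = 2 * ∫ x, (ρ s x - c) * η x ^ 2 * (g.dalembertian (ρ s) x
        - g.innerDual x (mvfderiv (𝓡 n) V x).toLinearMap (mvfderiv (𝓡 n) (ρ s) x).toLinearMap) *
          Real.exp (-V x) ∂μ := by
      rw [hE', ← integral_const_mul]
      refine integral_congr_ae (Eventually.of_forall fun x ↦ ?_)
      simp only [heq s hs x]
      ring
    -- `d(ρ - c) = dρ`, so the first Green term is `G s`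
    have hdsub : ∀ x, (mvfderiv (𝓡 n) (fun y ↦ ρ s y - c) x).toLinearMap =
        (mvfderiv (𝓡 n) (ρ s) x).toLinearMap := fun x ↦ by
      rw [mvfderiv_fun_sub (hρs.mdifferentiableAt (by simp)) mdifferentiableAt_const, mvfderiv_const,
        sub_zero]
    have e1 : ∫ x, η x ^ 2 * g.innerDual x (mvfderiv (𝓡 n) (fun y ↦ ρ s y - c) x).toLinearMap
        (mvfderiv (𝓡 n) (ρ s) x).toLinearMap * Real.exp (-V x) ∂μ = G s := by
      refine integral_congr_ae (Eventually.of_forall fun x ↦ ?_)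
      simp only [hdsub x]
      rw [show g.innerDual x (mvfderiv (𝓡 n) (ρ s) x).toLinearMap (mvfderiv (𝓡 n) (ρ s) x).toLinearMap
        = g.gradSq (ρ s) x from rfl]
      ring
    -- the cross term is absorbed: `-4 X ≤ G + 4 Y`
    set X : ℝ := ∫ x, (ρ s x - c) * η x * g.innerDual x (mvfderiv (𝓡 n) η x).toLinearMap
        (mvfderiv (𝓡 n) (ρ s) x).toLinearMap * Real.exp (-V x) ∂μ with hX
    have h1' : (1 : ℕ∞ω) ≤ (∞ : ℕ∞ω) := WithTop.coe_le_coe.mpr le_top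
    have hIc : Continuous fun x ↦ g.innerDual x (mvfderiv (𝓡 n) η x).toLinearMap
        (mvfderiv (𝓡 n) (ρ s) x).toLinearMap :=
      continuous_innerDual_mvfderiv g (hη.of_le h1') (hρs.of_le h1')
    have iX : Integrable (fun x ↦ -(4 * ((ρ s x - c) * η x * g.innerDual x
        (mvfderiv (𝓡 n) η x).toLinearMap (mvfderiv (𝓡 n) (ρ s) x).toLinearMap)) * Real.exp (-V x)) μ := by
      refine integrable_of_continuous_of_hasCompactSupport' hg
        ((continuous_const.mul (((hρs.continuous.sub continuous_const).mul hη.continuous).mul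
          hIc)).neg.mul hec) ?_
      exact ((((hηc.mul_left).mul_right).mul_left).neg).mul_right
    have iGY : Integrable (fun x ↦ (η x ^ 2 * g.gradSq (ρ s) x + 4 * ((ρ s x - c) ^ 2 * g.gradSq η x))
        * Real.exp (-V x)) μ := by
      refine integrable_of_continuous_of_hasCompactSupport' hg
        ((((hη.continuous.pow 2).mul (contMDiff_gradSq g hρs).continuous).add
          (continuous_const.mul ((hρs.continuous.sub continuous_const).pow 2 |>.mul hgradη))).mul hec) ?_
      refine HasCompactSupport.mul_right ?_
      exact (hη2c.mul_right).add ((hgradηs.mul_left).mul_left)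
    have hmono := integral_mono iX iGY fun x ↦
      mul_le_mul_of_nonneg_right (neg_four_mul_cutoff_innerDual_le hg (ρ s) η c x) (Real.exp_nonneg _)
    have eX : ∫ x, -(4 * ((ρ s x - c) * η x * g.innerDual x (mvfderiv (𝓡 n) η x).toLinearMap
        (mvfderiv (𝓡 n) (ρ s) x).toLinearMap)) * Real.exp (-V x) ∂μ = -4 * X := by
      rw [hX, ← integral_const_mul]
      exact integral_congr_ae (Eventually.of_forall fun x ↦ by ring)
    have iG1 : Integrable (fun x ↦ η x ^ 2 * g.gradSq (ρ s) x * Real.exp (-V x)) μ :=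
      integrable_of_continuous_of_hasCompactSupport' hg
        (((hη.continuous.pow 2).mul (contMDiff_gradSq g hρs).continuous).mul hec)
        (hη2c.mul_right.mul_right)
    have iY1 : Integrable (fun x ↦ 4 * ((ρ s x - c) ^ 2 * g.gradSq η x) * Real.exp (-V x)) μ :=
      integrable_of_continuous_of_hasCompactSupport' hg
        ((continuous_const.mul (((hρs.continuous.sub continuous_const).pow 2).mul hgradη)).mul hec)
        (((hgradηs.mul_left).mul_left).mul_right)
    have eGY : ∫ x, (η x ^ 2 * g.gradSq (ρ s) x + 4 * ((ρ s x - c) ^ 2 * g.gradSq η x))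
        * Real.exp (-V x) ∂μ = G s + 4 * Y s := by
      have e2 : ∫ x, (η x ^ 2 * g.gradSq (ρ s) x + 4 * ((ρ s x - c) ^ 2 * g.gradSq η x))
          * Real.exp (-V x) ∂μ = ∫ x, (η x ^ 2 * g.gradSq (ρ s) x * Real.exp (-V x)
            + 4 * ((ρ s x - c) ^ 2 * g.gradSq η x) * Real.exp (-V x)) ∂μ :=
        integral_congr_ae (Eventually.of_forall fun x ↦ by ring)
      rw [e2, integral_add iG1 iY1]
      have e3 : ∫ x, η x ^ 2 * g.gradSq (ρ s) x * Real.exp (-V x) ∂μ = G s :=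
        integral_congr_ae (Eventually.of_forall fun x ↦ by ring)
      have e4 : ∫ x, 4 * ((ρ s x - c) ^ 2 * g.gradSq η x) * Real.exp (-V x) ∂μ = 4 * Y s := by
        rw [hY, ← integral_const_mul]
        exact integral_congr_ae (Eventually.of_forall fun x ↦ by ring)
      rw [e3, e4]
    rw [eX, eGY] at hmono
    rw [e0, hid, e1]
    linarith
  -- the fundamental theorem of calculus on `[0, T]` and monotonicity of the integral
  have huIcc : uIcc (0 : ℝ) T = Icc 0 T := uIcc_of_le h01
  have hFTC : ∫ s in (0 : ℝ)..T, E' s = E T - E 0 :=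
    intervalIntegral.integral_eq_sub_of_hasDerivAt (fun s hs ↦ hEd s (hTO (huIcc ▸ hs)))
      ((hE'c.mono hTO).intervalIntegrable_of_Icc h01)
  have hGi : IntervalIntegrable G volume 0 T := (hGc.mono hTO).intervalIntegrable_of_Icc h01
  have hYi : IntervalIntegrable Y volume 0 T := (hYc.mono hTO).intervalIntegrable_of_Icc h01
  have hE'i : IntervalIntegrable E' volume 0 T := (hE'c.mono hTO).intervalIntegrable_of_Icc h01
  have hGi' : IntervalIntegrable (fun s ↦ -G s) volume 0 T := hGi.neg
  have hYi' : IntervalIntegrable (fun s ↦ 4 * Y s) volume 0 T := hYi.const_mul 4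
  have hmonoI : ∫ s in (0 : ℝ)..T, E' s ≤ ∫ s in (0 : ℝ)..T, (-G s + 4 * Y s) :=
    intervalIntegral.integral_mono_on h01 hE'i (hGi'.add hYi') fun s hs ↦ hE'le s hs
  have hsplit : ∫ s in (0 : ℝ)..T, (-G s + 4 * Y s) =
      -(∫ s in (0 : ℝ)..T, G s) + 4 * ∫ s in (0 : ℝ)..T, Y s := by
    rw [intervalIntegral.integral_add hGi' hYi', intervalIntegral.integral_neg,
      intervalIntegral.integral_const_mul]
  -- Fubini on the strip for `G` and `Y`
  have hGF : ∫ p, g.gradSq (ρ p.2) p.1 * (η p.1 ^ 2 * Real.exp (-V p.1))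
      ∂(μ.prod (volume : Measure ℝ)).restrict (univ ×ˢ Ioo 0 T) = ∫ s in (0 : ℝ)..T, G s :=
    integral_strip_eq_intervalIntegral μ h01
      (integrable_strip_mul_of_hasCompactSupport μ (hgradc.mono (prod_mono le_rfl hTO)) hwE hwEc)
  have hYF : ∫ p, (ρ p.2 p.1 - c) ^ 2 * (g.gradSq η p.1 * Real.exp (-V p.1))
      ∂(μ.prod (volume : Measure ℝ)).restrict (univ ×ˢ Ioo 0 T) = ∫ s in (0 : ℝ)..T, Y s :=
    integral_strip_eq_intervalIntegral μ h01
      (integrable_strip_mul_of_hasCompactSupport μ (hF.mono (prod_mono le_rfl hTO)) hwY hwYc)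
  have eE0 : E 0 = ∫ x, (ρ 0 x - c) ^ 2 * (η x ^ 2 * Real.exp (-V x)) ∂μ := rfl
  have eET : E T = ∫ x, (ρ T x - c) ^ 2 * (η x ^ 2 * Real.exp (-V x)) ∂μ := rfl
  rw [hGF, hYF]
  linarith [hFTC, hsplit, hmonoI, eE0, eET]

/-! ### The energy estimate with Gaffney cut-offs -/

/-- **The energy estimate for the weighted heat flow on a complete manifold, with Gaffney
cut-offs.** `V` smooth (no other assumption), `η_k ∈ C_c^∞`, `0 ≤ η_k ≤ 1`, `η_k → 1` pointwise,
`|∇η_k|² ≤ C₀/(k+1)²`; `ρ` smooth on `M × O` (`O ⊇ [0, T]` open) with `∂ₛρ = Lρ` on `[0, T]`,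
`(ρ − c)² e^{-V}` integrable on the strip `M × (0, T)` and at `s = 0`. Then `|∇ρ|² e^{-V}` is integrable
on the strip and `∫∫_{M×(0,T)} |∇ρ|² e^{-V} ≤ ∫ (ρ(0) − c)² e^{-V}`. Proof: `integral_gradSq_cutoffSq_le`
with `η = η_k`: `∫∫ η_k²|∇ρ|²e^{-V} ≤ ∫(ρ₀ − c)²e^{-V} + 4C₀/(k+1)² ∫∫(ρ − c)²e^{-V}`; Fatou (`η_k² → 1`)
and dominated convergence. This is the finite-energy property of `𝕃²` solutions, BGL §3.2.
[cite: BakryGentilLedoux2014, §3.2 (pp. 141–147)] -/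
theorem gaffney_energyEstimate (hg : g.IsRiemannian) {V : M → ℝ} (hV : ContMDiff (𝓡 n) 𝓘(ℝ, ℝ) ∞ V)
    {η : ℕ → M → ℝ} {C₀ : ℝ} (hηs : ∀ k, ContMDiff (𝓡 n) 𝓘(ℝ, ℝ) ∞ (η k))
    (hηc : ∀ k, HasCompactSupport (η k)) (hη01 : ∀ k x, 0 ≤ η k x ∧ η k x ≤ 1)
    (hη1 : ∀ x, ∀ᶠ k in atTop, η k x = 1)
    (hηgrad : ∀ k x, g.gradSq (η k) x ≤ C₀ / ((k : ℝ) + 1) ^ 2)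
    {T : ℝ} {O : Set ℝ} {ρ : ℝ → M → ℝ} (hT : 0 < T) (hO : IsOpen O) (hTO : Icc 0 T ⊆ O)
    (hρ : ContMDiffOn ((𝓡 n).prod 𝓘(ℝ, ℝ)) 𝓘(ℝ, ℝ) ∞ (fun p : M × ℝ ↦ ρ p.2 p.1) (univ ×ˢ O))
    (heq : ∀ s ∈ Icc 0 T, ∀ x, deriv (fun r ↦ ρ r x) s = g.dalembertian (ρ s) x
      - g.innerDual x (mvfderiv (𝓡 n) V x).toLinearMap (mvfderiv (𝓡 n) (ρ s) x).toLinearMap)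
    (c : ℝ)
    (hInt : Integrable (fun p : M × ℝ ↦ (ρ p.2 p.1 - c) ^ 2 * Real.exp (-V p.1))
      ((g.riemVolume.prod (volume : Measure ℝ)).restrict (univ ×ˢ Ioo 0 T)))
    (h0 : Integrable (fun x ↦ (ρ 0 x - c) ^ 2 * Real.exp (-V x)) g.riemVolume) :
    Integrable (fun p : M × ℝ ↦ g.gradSq (ρ p.2) p.1 * Real.exp (-V p.1))
        ((g.riemVolume.prod (volume : Measure ℝ)).restrict (univ ×ˢ Ioo 0 T)) ∧
      ∫ p in univ ×ˢ Ioo 0 T, g.gradSq (ρ p.2) p.1 * Real.exp (-V p.1)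
          ∂(g.riemVolume.prod (volume : Measure ℝ)) ≤
        ∫ x, (ρ 0 x - c) ^ 2 * Real.exp (-V x) ∂g.riemVolume := by
  haveI := CarrilloNi2009_shrinkerLSI.isFiniteMeasureOnCompacts_riemVolume hg
  haveI := sigmaFinite_riemVolume hg
  set μ : Measure M := g.riemVolume with hμ
  set ν : Measure (M × ℝ) := (μ.prod (volume : Measure ℝ)).restrict (univ ×ˢ Ioo 0 T) with hν
  set A : ℝ := ∫ x, (ρ 0 x - c) ^ 2 * Real.exp (-V x) ∂μ with hA
  set B : ℝ := ∫ p, (ρ p.2 p.1 - c) ^ 2 * Real.exp (-V p.1) ∂ν with hB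
  set r : ℕ → ℝ := fun k ↦ ∫ p, (ρ p.2 p.1 - c) ^ 2 * (g.gradSq (η k) p.1 * Real.exp (-V p.1)) ∂ν
    with hr
  set F : M × ℝ → ℝ := fun p ↦ g.gradSq (ρ p.2) p.1 * Real.exp (-V p.1) with hFdef
  have hec : Continuous fun x ↦ Real.exp (-V x) := Real.continuous_exp.comp hV.continuous.neg
  have hεpos : ∀ k : ℕ, (0 : ℝ) < ((k : ℝ) + 1) ^ 2 := fun k ↦ by positivity
  -- Step 1: the integrated inequality for every `k`
  have hid : ∀ k, ∫ p, g.gradSq (ρ p.2) p.1 * (η k p.1 ^ 2 * Real.exp (-V p.1)) ∂ν ≤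
      ∫ x, (ρ 0 x - c) ^ 2 * (η k x ^ 2 * Real.exp (-V x)) ∂μ
        - ∫ x, (ρ T x - c) ^ 2 * (η k x ^ 2 * Real.exp (-V x)) ∂μ + 4 * r k := fun k ↦
    integral_gradSq_cutoffSq_le hg hV (hηs k) (hηc k) hT hO hTO hρ heq c
  -- Step 2: `E_k(0) ≤ A`, `E_k(T) ≥ 0`
  have hsq1 : ∀ k x, η k x ^ 2 ≤ 1 := fun k x ↦ pow_le_one₀ (hη01 k x).1 (hη01 k x).2
  have hE0 : ∀ k, ∫ x, (ρ 0 x - c) ^ 2 * (η k x ^ 2 * Real.exp (-V x)) ∂μ ≤ A := fun k ↦ by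
    refine integral_mono_of_nonneg (Eventually.of_forall fun x ↦ ?_) h0
      (Eventually.of_forall fun x ↦ ?_)
    · exact mul_nonneg (sq_nonneg _) (mul_nonneg (sq_nonneg _) (Real.exp_nonneg _))
    · exact mul_le_mul_of_nonneg_left (mul_le_of_le_one_left (Real.exp_nonneg _) (hsq1 k x))
        (sq_nonneg _)
  have hET : ∀ k, 0 ≤ ∫ x, (ρ T x - c) ^ 2 * (η k x ^ 2 * Real.exp (-V x)) ∂μ := fun k ↦
    integral_nonneg fun x ↦ mul_nonneg (sq_nonneg _) (mul_nonneg (sq_nonneg _) (Real.exp_nonneg _))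
  -- Step 3: the error terms `r k ≤ C₀/(k+1)² B` tend to `0`
  have hcontρ : ContinuousOn (fun p : M × ℝ ↦ ρ p.2 p.1) (univ ×ˢ Ioo 0 T) :=
    hρ.continuousOn.mono (prod_mono le_rfl (Ioo_subset_Icc_self.trans hTO))
  have hgradηc : ∀ k, Continuous (g.gradSq (η k)) := fun k ↦ (contMDiff_gradSq g (hηs k)).continuous
  have hr_meas : ∀ k, AEStronglyMeasurable
      (fun p : M × ℝ ↦ (ρ p.2 p.1 - c) ^ 2 * (g.gradSq (η k) p.1 * Real.exp (-V p.1))) ν := fun k ↦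
    aestronglyMeasurable_strip μ (((hcontρ.sub continuousOn_const).pow 2).mul
      (((hgradηc k).comp continuous_fst).mul (hec.comp continuous_fst)).continuousOn)
  have hr_bound : ∀ k (p : M × ℝ), ‖(ρ p.2 p.1 - c) ^ 2 * (g.gradSq (η k) p.1 * Real.exp (-V p.1))‖ ≤
      C₀ / ((k : ℝ) + 1) ^ 2 * ((ρ p.2 p.1 - c) ^ 2 * Real.exp (-V p.1)) := fun k p ↦ by
    rw [Real.norm_eq_abs, abs_of_nonneg (mul_nonneg (sq_nonneg _)
      (mul_nonneg (g.gradSq_nonneg hg _ _) (Real.exp_nonneg _)))]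
    have h0' : 0 ≤ (ρ p.2 p.1 - c) ^ 2 * Real.exp (-V p.1) := mul_nonneg (sq_nonneg _) (Real.exp_nonneg _)
    calc (ρ p.2 p.1 - c) ^ 2 * (g.gradSq (η k) p.1 * Real.exp (-V p.1))
        = g.gradSq (η k) p.1 * ((ρ p.2 p.1 - c) ^ 2 * Real.exp (-V p.1)) := by ring
      _ ≤ C₀ / ((k : ℝ) + 1) ^ 2 * ((ρ p.2 p.1 - c) ^ 2 * Real.exp (-V p.1)) :=
          mul_le_mul_of_nonneg_right (hηgrad k p.1) h0'
  have hB0 : 0 ≤ B := integral_nonneg fun p ↦ mul_nonneg (sq_nonneg _) (Real.exp_nonneg _)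
  have hr_le : ∀ k, r k ≤ C₀ / ((k : ℝ) + 1) ^ 2 * B := fun k ↦ by
    calc r k ≤ ‖r k‖ := Real.le_norm_self _
      _ ≤ ∫ p, ‖(ρ p.2 p.1 - c) ^ 2 * (g.gradSq (η k) p.1 * Real.exp (-V p.1))‖ ∂ν :=
          norm_integral_le_integral_norm _
      _ ≤ ∫ p, C₀ / ((k : ℝ) + 1) ^ 2 * ((ρ p.2 p.1 - c) ^ 2 * Real.exp (-V p.1)) ∂ν :=
          integral_mono_of_nonneg (Eventually.of_forall fun p ↦ norm_nonneg _) (hInt.const_mul _)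
            (Eventually.of_forall (hr_bound k))
      _ = C₀ / ((k : ℝ) + 1) ^ 2 * B := integral_const_mul _ _
  -- `C₀ ≥ 0` unless `M` is empty, in which case `B = 0`; either way `C₀ B ≥ 0`-type bounds hold
  have hC₀B : ∀ k : ℕ, C₀ / ((k : ℝ) + 1) ^ 2 * B ≤ |C₀| * B := fun k ↦ by
    refine mul_le_mul_of_nonneg_right ?_ hB0
    refine (le_abs_self _).trans ?_
    rw [abs_div, abs_of_pos (hεpos k)]
    refine div_le_self (abs_nonneg _) ?_
    have : (1 : ℝ) ≤ (k : ℝ) + 1 := by linarith [(Nat.cast_nonneg k : (0 : ℝ) ≤ k)]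
    exact one_le_pow₀ this
  have hr_tendsto : Tendsto (fun k : ℕ ↦ C₀ / ((k : ℝ) + 1) ^ 2 * B) atTop (𝓝 0) := by
    have h1 : Tendsto (fun k : ℕ ↦ ((k : ℝ) + 1) ^ 2) atTop atTop :=
      (tendsto_pow_atTop two_ne_zero).comp
        (tendsto_atTop_add_const_right _ 1 (tendsto_natCast_atTop_atTop (R := ℝ)))
    have h2 : Tendsto (fun k : ℕ ↦ C₀ / ((k : ℝ) + 1) ^ 2) atTop (𝓝 0) :=
      tendsto_const_nhds.div_atTop h1
    simpa using h2.mul_const B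
  -- Step 4: `∫ η_k² F ≤ A + 4 r_k ≤ A + 4 C₀ B`
  have hI_le : ∀ k, ∫ p, η k p.1 ^ 2 * F p ∂ν ≤ A + 4 * (C₀ / ((k : ℝ) + 1) ^ 2 * B) := fun k ↦ by
    have e : ∫ p, η k p.1 ^ 2 * F p ∂ν = ∫ p, g.gradSq (ρ p.2) p.1 * (η k p.1 ^ 2 * Real.exp (-V p.1)) ∂ν :=
      integral_congr_ae (Eventually.of_forall fun p ↦ by simp only [hFdef]; ring)
    rw [e]
    linarith [hid k, hE0 k, hET k, hr_le k]
  have hKbound : ∀ k, ∫ p, η k p.1 ^ 2 * F p ∂ν ≤ A + 4 * (|C₀| * B) := fun k ↦ by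
    linarith [hI_le k, hC₀B k]
  -- Step 5: Fatou gives the integrability of `F = |∇ρ|² e^{-V}` on the strip
  have hgradc : ContinuousOn (fun p : M × ℝ ↦ g.gradSq (ρ p.2) p.1) (univ ×ˢ O) :=
    (contMDiffOn_gradSq_family g hO.uniqueDiffOn hρ).continuousOn
  have hFm : AEStronglyMeasurable F ν :=
    aestronglyMeasurable_strip μ ((hgradc.mono (prod_mono le_rfl (Ioo_subset_Icc_self.trans hTO))).mul
      (hec.comp continuous_fst).continuousOn)
  have hF0 : ∀ p, 0 ≤ F p := fun p ↦ mul_nonneg (g.gradSq_nonneg hg _ _) (Real.exp_nonneg _)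
  have hχF : ∀ k, Integrable (fun p : M × ℝ ↦ η k p.1 ^ 2 * F p) ν := fun k ↦ by
    have hwk : Continuous fun x ↦ η k x ^ 2 * Real.exp (-V x) := ((hηs k).continuous.pow 2).mul hec
    have hη2c : HasCompactSupport (fun x ↦ η k x ^ 2) := by
      rw [show (fun x ↦ η k x ^ 2) = fun x ↦ η k x * η k x from funext fun x ↦ sq (η k x)]
      exact (hηc k).mul_right
    have hwkc : HasCompactSupport fun x ↦ η k x ^ 2 * Real.exp (-V x) := hη2c.mul_right
    have h := integrable_strip_mul_of_hasCompactSupport μ (hgradc.mono (prod_mono le_rfl hTO))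
      hwk hwkc
    exact h.congr (Eventually.of_forall fun p ↦ by simp only [hFdef]; ring)
  have hlim2 : ∀ x, Tendsto (fun k ↦ η k x ^ 2) atTop (𝓝 1) := fun x ↦ by
    simpa using (tendsto_cutoff_of_eventually_eq hη1 x).pow 2
  have hFint : Integrable F ν :=
    CarrilloNi2009_shrinkerLSI.integrable_of_forall_integral_cutoff_mul_le hFm hF0
      (fun k p ↦ sq_nonneg (η k p.1)) hχF (fun p ↦ hlim2 p.1) (K := A + 4 * (|C₀| * B)) hKbound
  -- Step 6: `∫ η_k² F → ∫ F` (dominated convergence) and the bound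
  have hI_tendsto : Tendsto (fun k ↦ ∫ p, η k p.1 ^ 2 * F p ∂ν) atTop (𝓝 (∫ p, F p ∂ν)) := by
    refine tendsto_integral_of_dominated_convergence F (fun k ↦ (hχF k).aestronglyMeasurable) hFint
      (fun k ↦ Eventually.of_forall fun p ↦ ?_) (Eventually.of_forall fun p ↦ ?_)
    · rw [Real.norm_eq_abs, abs_of_nonneg (mul_nonneg (sq_nonneg _) (hF0 p))]
      exact mul_le_of_le_one_left (hF0 p) (hsq1 k p.1)
    · simpa using (hlim2 p.1).mul_const (F p)
  have hb_tendsto : Tendsto (fun k : ℕ ↦ A + 4 * (C₀ / ((k : ℝ) + 1) ^ 2 * B)) atTop (𝓝 (A + 4 * 0)) :=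
    tendsto_const_nhds.add (hr_tendsto.const_mul 4)
  have hfinal : ∫ p, F p ∂ν ≤ A + 4 * 0 := le_of_tendsto_of_tendsto' hI_tendsto hb_tendsto hI_le
  refine ⟨hFint, ?_⟩
  have hgoal : ∫ p, F p ∂ν ≤ A := by linarith [hfinal]
  simpa only [hFdef] using hgoal

end Energy

end Literature.Geometry.Riemannian.BakryEmeryComplete

end Part6

/-!
## Part 7 — port of `Summits/SmoothPoincare4/SmoothPoincare4/Theorems/EntropyRungBakryEmeryLogSobolevHessianSlack.lean` (2 declarations kept)

# The Hessian controls `g⁻¹(dη, d|∇u|²)` through the `Γ₂`-slack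

First-order (Gaffney) cut-offs `η` on a complete manifold only come with a bound on `|∇η|`, so every
integration by parts of the Bakry–Émery programme on a complete NON-compact weighted manifold
`(M, g, e^{-V} dV_g)` produces error terms `g⁻¹(dη, d|∇u|²)`, which involve the Hessian of `u`. They
are absorbed into the Hessian term of the weighted Bochner formula
`½ L|∇u|² = |Hess u|² + g⁻¹(du, d(Lu)) + (Ric + Hess V)(∇u, ∇u)` (`L = Δ_g − g⁻¹(dV, d·)`), which the
tree's `weightedBochner_pointwise_ge` drops. This file supplies the two pointwise facts needed:

* `sq_apply_le_normSqAt_mul_mul_cs` — Cauchy–Schwarz for a symmetric form at a positive definite point,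
  off-diagonal version: `H(v, w)² ≤ |H|²_G G(v,v) G(w,w)`;
* `innerDual_gradSq_sq_le_slack` — **`g⁻¹(dη, d|∇u|²)² ≤ 4 |∇η|² |∇u|² S`**, where
  `S = ½ L|∇u|² − g⁻¹(du, d(Lu)) − K|∇u|² (≥ |Hess u|² ≥ 0)` is the slack of the pointwise
  `Γ₂ ≥ K Γ` inequality under `Ric + Hess V ≥ K g` (read in the chart at the point:
  `∂_Y|∇u|² = 2 Hess u(Y, ∇u)`, `IsMetricOn.fderiv_gradSqAt`, the weighted Bochner formula
  `IsMetricOn.weightedLapAt_gradSqAt`, and the Cauchy–Schwarz inequality above).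

Everything is proved; no definitions, no named facts.

## References

* D. Bakry, I. Gentil, M. Ledoux, *Analysis and Geometry of Markov Diffusion Operators* (2014),
  §3.2 (pp. 141–147: integrations by parts on a complete manifold with the cut-offs `ζ_k`) and
  §C.6 (`Γ₂(f) = |∇∇f|² + (Ric + ∇∇W)(∇f, ∇f)`). [BakryGentilLedoux2014]
* J. A. Carrillo, L. Ni, Comm. Anal. Geom. 17 (2009), §3 (p. 8, the Bochner type formula) and §4
  (cut-off justification). [CarrilloNi2009]
-/

section Part7

open _root_.Bundle _root_.Set _root_.Function _root_.Module _root_.Filter _root_.Manifold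
open scoped _root_.ContDiff _root_.Topology _root_.Manifold

/-! ### Cauchy–Schwarz for a symmetric form, off-diagonal -/

namespace Literature.Geometry.Lorentzian.MetricCoord.IsMetricOn

variable {E : Type*} [NormedAddCommGroup E] [NormedSpace ℝ E] [FiniteDimensional ℝ E]
  {G : E → E →L[ℝ] E →L[ℝ] ℝ} {V : Set E} {x : E}

/-- **Cauchy–Schwarz for a symmetric form at a positive definite point, off-diagonal version**:
`H(v, w)² ≤ |H|²_G · G(v, v) · G(w, w)` (in an orthonormal basis `H(v,w) = Σ H_{km} v_k w_m`,
`|H|² = Σ H_{km}²`, `G(v,v) G(w,w) = Σ_{km} v_k² w_m²`). The diagonal case is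
`abs_apply_apply_le_sqrt_normSqAt_mul`. [cite: BakryGentilLedoux2014, §3.2 (pp. 141–147) and §C.6] -/
theorem sq_apply_le_normSqAt_mul_mul_cs (hG : IsMetricOn G V) (hx : x ∈ V)
    (hpos : ∀ v : E, v ≠ 0 → 0 < G x v v) {H : E →L[ℝ] E →L[ℝ] ℝ} (hH : ∀ v w, H v w = H w v)
    (v w : E) : H v w ^ 2 ≤ normSqAt G x H * G x v v * G x w w := by
  classical
  have hs := hG.symm x hx
  obtain ⟨e, he⟩ := exists_orthonormal_basis hs hpos
  -- components
  set c : Fin (finrank ℝ E) → ℝ := fun k ↦ G x v (e k) with hc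
  set d : Fin (finrank ℝ E) → ℝ := fun k ↦ G x w (e k) with hd
  have hv : ∑ k, c k • e k = v := sum_apply_smul_of_orthonormal e he v
  have hw : ∑ k, d k • e k = w := sum_apply_smul_of_orthonormal e he w
  have hGvv : G x v v = ∑ k, c k ^ 2 := by
    rw [apply_eq_sum_of_orthonormal e he hs v v]
    exact Finset.sum_congr rfl fun k _ ↦ by rw [hc, sq]
  have hGww : G x w w = ∑ k, d k ^ 2 := by
    rw [apply_eq_sum_of_orthonormal e he hs w w]
    exact Finset.sum_congr rfl fun k _ ↦ by rw [hd, sq]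
  have hright : ∀ u, H u w = ∑ m, d m * H u (e m) := fun u ↦ by
    conv_lhs => rw [← hw]
    rw [map_sum]
    exact Finset.sum_congr rfl fun m _ ↦ by rw [map_smul, smul_eq_mul]
  have hleft : ∀ u, H v u = ∑ k, c k * H (e k) u := fun u ↦ by
    rw [hH v u]
    conv_lhs => rw [← hv]
    rw [map_sum]
    refine Finset.sum_congr rfl fun k _ ↦ ?_
    rw [map_smul, smul_eq_mul, hH u (e k)]
  have hHvw : H v w = ∑ k, ∑ m, c k * d m * H (e k) (e m) := by
    rw [hleft w]
    refine Finset.sum_congr rfl fun k _ ↦ ?_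
    rw [hright (e k), Finset.mul_sum]
    exact Finset.sum_congr rfl fun m _ ↦ by ring
  have hnorm : normSqAt G x H = ∑ k, ∑ m, H (e k) (e m) ^ 2 :=
    hG.normSqAt_eq_sum_sq_of_orthonormal hx e he hH
  -- Cauchy–Schwarz over the product index
  have hCS : (∑ k, ∑ m, c k * d m * H (e k) (e m)) ^ 2 ≤
      (∑ k, ∑ m, (c k * d m) ^ 2) * ∑ k, ∑ m, H (e k) (e m) ^ 2 := by
    have h := sq_sum_mul_le (ι := Fin (finrank ℝ E) × Fin (finrank ℝ E))
      (fun p ↦ c p.1 * d p.2) (fun p ↦ H (e p.1) (e p.2))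
    simpa only [Fintype.sum_prod_type] using h
  have hcd : ∑ k, ∑ m, (c k * d m) ^ 2 = (∑ k, c k ^ 2) * ∑ m, d m ^ 2 := by
    rw [Finset.sum_mul_sum]
    exact Finset.sum_congr rfl fun k _ ↦ Finset.sum_congr rfl fun m _ ↦ by ring
  rw [hHvw, hnorm, hGvv, hGww]
  rw [hcd] at hCS
  calc (∑ k, ∑ m, c k * d m * H (e k) (e m)) ^ 2
      ≤ ((∑ k, c k ^ 2) * ∑ m, d m ^ 2) * ∑ k, ∑ m, H (e k) (e m) ^ 2 := hCS
    _ = (∑ k, ∑ m, H (e k) (e m) ^ 2) * (∑ k, c k ^ 2) * ∑ m, d m ^ 2 := by ring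

end Literature.Geometry.Lorentzian.MetricCoord.IsMetricOn

/-! ### The slack of `Γ₂ ≥ KΓ` dominates the Hessian: `g⁻¹(dη, d|∇u|²)² ≤ 4|∇η|²|∇u|² S` -/

namespace Literature.Geometry.Riemannian.BakryEmeryComplete

open Literature.Geometry.Lorentzian Literature.Geometry.Lorentzian.PseudoRiemannianMetric
  Literature.Geometry.Riemannian

variable {E : Type*} [NormedAddCommGroup E] [NormedSpace ℝ E] [FiniteDimensional ℝ E]
  {H : Type*} [TopologicalSpace H] {I : ModelWithCorners ℝ E H} [I.Boundaryless]
  {M : Type*} [TopologicalSpace M] [ChartedSpace H M] [IsManifold I ∞ M]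
  (g : PseudoRiemannianMetric I ∞ E (TangentSpace I : M → Type _)) [g.HasLeviCivita]

/-- **The Hessian error term is controlled by the `Γ₂`-slack.** Let `g` be Riemannian with
`Ric + Hess V ≥ K g` (`V ∈ C^∞`), `u, η ∈ C^∞(M)`, `L = Δ_g − g⁻¹(dV, d·)`, and
`S(x) = ½ L|∇u|²(x) − g⁻¹(du, d(Lu))(x) − K |∇u|²(x)` the slack of the pointwise inequality
`Γ₂(u) ≥ K Γ(u)` (`weightedBochner_pointwise_ge`). Then at every `x`

  `g⁻¹(dη, d|∇u|²)(x)² ≤ 4 |∇η|²(x) |∇u|²(x) S(x)`.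

Proof, in the chart at `x`: `g⁻¹(dη, d|∇u|²) = 2 Hess u(∇η, ∇u)` (`IsMetricOn.fderiv_gradSqAt`),
`Hess u(∇η, ∇u)² ≤ |Hess u|² |∇η|² |∇u|²` (`sq_apply_le_normSqAt_mul_mul_cs`), and
`|Hess u|² = ½L|∇u|² − g⁻¹(du, d(Lu)) − (Ric + Hess V)(∇u, ∇u) ≤ S` by the weighted Bochner
formula `IsMetricOn.weightedLapAt_gradSqAt` and `(Ric + Hess V)(∇u,∇u) ≥ K|∇u|²`. This is what
lets first-order (Gaffney) cut-offs run the Bakry–Émery integrations by parts on a complete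
manifold. [cite: BakryGentilLedoux2014, §3.2 (pp. 141–147) and §C.6]
[cite: CarrilloNi2009, §3 (p. 8)] -/
theorem innerDual_gradSq_sq_le_slack (hR : g.IsRiemannian) {V : M → ℝ} {K : ℝ}
    (hV : ContMDiff I 𝓘(ℝ, ℝ) ∞ V)
    (hRic : ∀ (y : M) (X : TangentSpace I y), K * g.val y X X ≤ g.ricci y X X + g.hessian V y X X)
    {u : M → ℝ} (hu : ContMDiff I 𝓘(ℝ, ℝ) ∞ u) {η : M → ℝ} (hη : ContMDiff I 𝓘(ℝ, ℝ) ∞ η)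
    (x : M) :
    (g.innerDual x (mvfderiv I η x).toLinearMap (mvfderiv I (g.gradSq u) x).toLinearMap) ^ 2 ≤
      4 * g.gradSq η x * g.gradSq u x *
        ((1 / 2) * (g.dalembertian (g.gradSq u) x
            - g.innerDual x (mvfderiv I V x).toLinearMap (mvfderiv I (g.gradSq u) x).toLinearMap)
          - g.innerDual x (mvfderiv I u x).toLinearMap
              (mvfderiv I (fun y ↦ g.dalembertian u y
                - g.innerDual y (mvfderiv I V y).toLinearMap
                    (mvfderiv I u y).toLinearMap) x).toLinearMap
          - K * g.gradSq u x) := by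
  -- the chart at `x`, components and representatives
  set G := chartRep I (fun _ ↦ g) x 0 with hGdef
  have hGm : MetricCoord.IsMetricOn G (extChartAt I x).target :=
    OpensChart.isMetricOn_repr (val_chartPullback_eq_chartRep (fun _ : ℝ ↦ g) x 0)
  set uh : E → ℝ := u ∘ (extChartAt I x).symm with huhdef
  set Vh : E → ℝ := V ∘ (extChartAt I x).symm with hVhdef
  set ηh : E → ℝ := η ∘ (extChartAt I x).symm with hηhdef
  have hu0 : extChartAt I x x ∈ (extChartAt I x).target := mem_extChartAt_target x
  set u₀ : chartTarget I x := ⟨extChartAt I x x, hu0⟩ with hu₀def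
  have hΦu₀ : chartInv I x u₀ = x := extChartAt_to_inv x
  have huh : ContDiffOn ℝ ∞ uh (extChartAt I x).target := by
    rw [huhdef, ← contMDiffOn_iff_contDiffOn]
    exact hu.comp_contMDiffOn (contMDiffOn_extChartAt_symm x)
  have hVh : ContDiffOn ℝ ∞ Vh (extChartAt I x).target := by
    rw [hVhdef, ← contMDiffOn_iff_contDiffOn]
    exact hV.comp_contMDiffOn (contMDiffOn_extChartAt_symm x)
  -- the coordinate weighted Bochner formula at `φ x`
  have key := hGm.weightedLapAt_gradSqAt hu0 huh hVh
  -- regularity of the manifold-level functions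
  have hud : ∀ y, MDifferentiableAt I 𝓘(ℝ, ℝ) u y := fun y ↦ hu.mdifferentiableAt (by simp)
  have hVd : ∀ y, MDifferentiableAt I 𝓘(ℝ, ℝ) V y := fun y ↦ hV.mdifferentiableAt (by simp)
  have hηd : ∀ y, MDifferentiableAt I 𝓘(ℝ, ℝ) η y := fun y ↦ hη.mdifferentiableAt (by simp)
  have hQ : ContMDiff I 𝓘(ℝ, ℝ) ∞ (g.gradSq u) := contMDiff_gradSq g hu
  have hQd : ∀ y, MDifferentiableAt I 𝓘(ℝ, ℝ) (g.gradSq u) y := fun y ↦ hQ.mdifferentiableAt (by simp)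
  have hQ2 : ContMDiffAt I 𝓘(ℝ, ℝ) 2 (g.gradSq u) (chartInv I x u₀) :=
    (hQ.of_le (WithTop.coe_le_coe.mpr le_top)).contMDiffAt
  have hLs : ContMDiff I 𝓘(ℝ, ℝ) ∞ (fun y ↦ g.dalembertian u y
      - g.innerDual y (mvfderiv I V y).toLinearMap (mvfderiv I u y).toLinearMap) :=
    (contMDiff_dalembertian g hu).sub (contMDiff_innerDual g hV hu)
  have hLd : ∀ y, MDifferentiableAt I 𝓘(ℝ, ℝ) (fun y ↦ g.dalembertian u y
      - g.innerDual y (mvfderiv I V y).toLinearMap (mvfderiv I u y).toLinearMap) y := fun y ↦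
    hLs.mdifferentiableAt (by simp)
  -- (a) `|∇u|²` read in the chart (as a function near `φ x`) and `|∇u|²(x)`, `|∇η|²(x)`
  have hQrep : (g.gradSq u ∘ (extChartAt I x).symm) =ᶠ[𝓝 (extChartAt I x x)]
      MetricCoord.gradSqAt G uh := by
    filter_upwards [(isOpen_extChartAt_target x).mem_nhds hu0] with z hz
    exact gradSq_chartInv_eq g x ⟨z, hz⟩ (hud _)
  have hgrad : g.gradSq u x = MetricCoord.gradSqAt G uh (extChartAt I x x) := by
    have h := gradSq_chartInv_eq g x u₀ (F := u) (hud _)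
    rw [hΦu₀] at h
    exact h
  have hgradη : g.gradSq η x = MetricCoord.gradSqAt G ηh (extChartAt I x x) := by
    have h := gradSq_chartInv_eq g x u₀ (F := η) (hηd _)
    rw [hΦu₀] at h
    exact h
  -- (b) `Δ|∇u|²` and `g⁻¹(dV, d|∇u|²)`, `g⁻¹(dη, d|∇u|²)`
  have hlap : g.dalembertian (g.gradSq u) x =
      MetricCoord.lapAt G (MetricCoord.gradSqAt G uh) (extChartAt I x x) := by
    have h := dalembertian_chartInv_eq g x u₀ hQ2
    rw [hΦu₀] at h
    rw [h]
    exact MetricCoord.lapAt_congr_of_eventuallyEq G hQrep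
  have hIV : g.innerDual x (mvfderiv I V x).toLinearMap (mvfderiv I (g.gradSq u) x).toLinearMap =
      fderiv ℝ (MetricCoord.gradSqAt G uh) (extChartAt I x x)
        (MetricCoord.sharpAt G (extChartAt I x x) (fderiv ℝ Vh (extChartAt I x x))) := by
    have h := innerDual_chartInv_eq g x u₀ (hVd _) (hQd _)
    rw [hΦu₀] at h
    rw [show (mvfderiv I V x).toLinearMap = (mvfderiv I V x : TangentSpace I x →ₗ[ℝ] ℝ) from rfl,
      show (mvfderiv I (g.gradSq u) x).toLinearMap =
        (mvfderiv I (g.gradSq u) x : TangentSpace I x →ₗ[ℝ] ℝ) from rfl, h,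
      MetricCoord.apply_sharpAt_comm (hGm.isInvertible _ hu0) (hGm.symm _ hu0), hQrep.fderiv_eq]
  have hIη : g.innerDual x (mvfderiv I η x).toLinearMap (mvfderiv I (g.gradSq u) x).toLinearMap =
      fderiv ℝ (MetricCoord.gradSqAt G uh) (extChartAt I x x)
        (MetricCoord.sharpAt G (extChartAt I x x) (fderiv ℝ ηh (extChartAt I x x))) := by
    have h := innerDual_chartInv_eq g x u₀ (hηd _) (hQd _)
    rw [hΦu₀] at h
    rw [show (mvfderiv I η x).toLinearMap = (mvfderiv I η x : TangentSpace I x →ₗ[ℝ] ℝ) from rfl,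
      show (mvfderiv I (g.gradSq u) x).toLinearMap =
        (mvfderiv I (g.gradSq u) x : TangentSpace I x →ₗ[ℝ] ℝ) from rfl, h,
      MetricCoord.apply_sharpAt_comm (hGm.isInvertible _ hu0) (hGm.symm _ hu0), hQrep.fderiv_eq]
  -- (c) `g⁻¹(du, d(Lu))`: the representative of `Lu` near `φ x`
  have hLrep : ((fun y ↦ g.dalembertian u y
      - g.innerDual y (mvfderiv I V y).toLinearMap (mvfderiv I u y).toLinearMap) ∘
        (extChartAt I x).symm) =ᶠ[𝓝 (extChartAt I x x)]
      fun z ↦ MetricCoord.lapAt G uh z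
        - fderiv ℝ uh z (MetricCoord.sharpAt G z (fderiv ℝ Vh z)) := by
    filter_upwards [(isOpen_extChartAt_target x).mem_nhds hu0] with z hz
    have hu2 : ContMDiffAt I 𝓘(ℝ, ℝ) 2 u (chartInv I x ⟨z, hz⟩) :=
      (hu.of_le (WithTop.coe_le_coe.mpr le_top)).contMDiffAt
    have h1 := dalembertian_chartInv_eq g x ⟨z, hz⟩ hu2
    have h2 := innerDual_chartInv_eq g x ⟨z, hz⟩ (hVd _) (hud _)
    simp only [chartInv_apply, Subtype.coe_mk] at h1 h2
    simp only [Function.comp_apply]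
    rw [h1, show (mvfderiv I V ((extChartAt I x).symm z)).toLinearMap =
        (mvfderiv I V ((extChartAt I x).symm z) : TangentSpace I _ →ₗ[ℝ] ℝ) from rfl,
      show (mvfderiv I u ((extChartAt I x).symm z)).toLinearMap =
        (mvfderiv I u ((extChartAt I x).symm z) : TangentSpace I _ →ₗ[ℝ] ℝ) from rfl, h2,
      MetricCoord.apply_sharpAt_comm (hGm.isInvertible z hz) (hGm.symm z hz)]
  have hIL : g.innerDual x (mvfderiv I u x).toLinearMap
      (mvfderiv I (fun y ↦ g.dalembertian u y
        - g.innerDual y (mvfderiv I V y).toLinearMap (mvfderiv I u y).toLinearMap) x).toLinearMap =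
      fderiv ℝ (MetricCoord.lapAt G uh) (extChartAt I x x)
          (MetricCoord.sharpAt G (extChartAt I x x) (fderiv ℝ uh (extChartAt I x x)))
        - fderiv ℝ (fun y ↦ fderiv ℝ uh y (MetricCoord.sharpAt G y (fderiv ℝ Vh y)))
          (extChartAt I x x)
          (MetricCoord.sharpAt G (extChartAt I x x) (fderiv ℝ uh (extChartAt I x x))) := by
    have h := innerDual_chartInv_eq g x u₀ (hud _) (hLd _)
    rw [hΦu₀] at h
    rw [show (mvfderiv I u x).toLinearMap = (mvfderiv I u x : TangentSpace I x →ₗ[ℝ] ℝ) from rfl,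
      show (mvfderiv I (fun y ↦ g.dalembertian u y
        - g.innerDual y (mvfderiv I V y).toLinearMap (mvfderiv I u y).toLinearMap) x).toLinearMap =
        (mvfderiv I (fun y ↦ g.dalembertian u y
          - g.innerDual y (mvfderiv I V y).toLinearMap (mvfderiv I u y).toLinearMap) x :
            TangentSpace I x →ₗ[ℝ] ℝ) from rfl, h,
      MetricCoord.apply_sharpAt_comm (hGm.isInvertible _ hu0) (hGm.symm _ hu0), hLrep.fderiv_eq]
    have hΔd : DifferentiableAt ℝ (MetricCoord.lapAt G uh) (extChartAt I x x) :=
      ((hGm.contDiffOn_lapAt huh _ hu0).contDiffAt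
        ((isOpen_extChartAt_target x).mem_nhds hu0)).differentiableAt (by simp)
    have hId : DifferentiableAt ℝ (fun y ↦ fderiv ℝ uh y (MetricCoord.sharpAt G y (fderiv ℝ Vh y)))
        (extChartAt I x x) := hGm.differentiableAt_innerGrad hu0 huh hVh
    rw [fderiv_fun_sub hΔd hId]
    rfl
  -- (d) the curvature term and the Hessian term
  have hV2 : ContMDiffAt I 𝓘(ℝ, ℝ) 2 V (chartInv I x u₀) :=
    (hV.of_le (WithTop.coe_le_coe.mpr le_top)).contMDiffAt
  have hB := bakryEmery_chartInv_le g x u₀ hV2 (fun X ↦ hRic _ X)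
    (MetricCoord.sharpAt G (extChartAt I x x) (fderiv ℝ uh (extChartAt I x x)))
  have hGX : G (extChartAt I x x)
      (MetricCoord.sharpAt G (extChartAt I x x) (fderiv ℝ uh (extChartAt I x x)))
      (MetricCoord.sharpAt G (extChartAt I x x) (fderiv ℝ uh (extChartAt I x x))) = g.gradSq u x := by
    rw [MetricCoord.apply_sharpAt_sharpAt (hGm.isInvertible _ hu0), hgrad]
    rfl
  have hGY : G (extChartAt I x x)
      (MetricCoord.sharpAt G (extChartAt I x x) (fderiv ℝ ηh (extChartAt I x x)))
      (MetricCoord.sharpAt G (extChartAt I x x) (fderiv ℝ ηh (extChartAt I x x))) = g.gradSq η x := by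
    rw [MetricCoord.apply_sharpAt_sharpAt (hGm.isInvertible _ hu0), hgradη]
    rfl
  have hB' : K * g.gradSq u x ≤
      MetricCoord.ricAt G (extChartAt I x x)
          (MetricCoord.sharpAt G (extChartAt I x x) (fderiv ℝ uh (extChartAt I x x)))
          (MetricCoord.sharpAt G (extChartAt I x x) (fderiv ℝ uh (extChartAt I x x)))
        + MetricCoord.hessAt G Vh (extChartAt I x x)
          (MetricCoord.sharpAt G (extChartAt I x x) (fderiv ℝ uh (extChartAt I x x)))
          (MetricCoord.sharpAt G (extChartAt I x x) (fderiv ℝ uh (extChartAt I x x))) := by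
    rw [← hGX]
    exact hB
  -- the Hessian term `N = |Hess u|²` and the slack
  set N := MetricCoord.normSqAt G (extChartAt I x x) (MetricCoord.hessAt G uh (extChartAt I x x))
    with hNdef
  have hslack : N ≤ (1 / 2) * (g.dalembertian (g.gradSq u) x
            - g.innerDual x (mvfderiv I V x).toLinearMap (mvfderiv I (g.gradSq u) x).toLinearMap)
          - g.innerDual x (mvfderiv I u x).toLinearMap
              (mvfderiv I (fun y ↦ g.dalembertian u y
                - g.innerDual y (mvfderiv I V y).toLinearMap
                    (mvfderiv I u y).toLinearMap) x).toLinearMap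
          - K * g.gradSq u x := by
    rw [hlap, hIV, hIL]
    linarith [key, hB']
  -- (e) `g⁻¹(dη, d|∇u|²) = 2 Hess u(∇η, ∇u)` and Cauchy–Schwarz
  have hpos : ∀ v : E, v ≠ 0 → 0 < G (extChartAt I x x) v v := fun v hv ↦ by
    have h := chartPullback_pos g x u₀ (fun w hw ↦ hR _ w hw) v hv
    rwa [val_chartPullback_eq_chartRep (fun _ : ℝ ↦ g) x 0] at h
  have huhx : ContDiffAt ℝ ∞ uh (extChartAt I x x) :=
    huh.contDiffAt ((isOpen_extChartAt_target x).mem_nhds hu0)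
  have hsymm : ∀ v w, MetricCoord.hessAt G uh (extChartAt I x x) v w =
      MetricCoord.hessAt G uh (extChartAt I x x) w v := fun v w ↦ hGm.hessAt_comm hu0 huhx v w
  have hCS := hGm.sq_apply_le_normSqAt_mul_mul_cs hu0 hpos hsymm
    (MetricCoord.sharpAt G (extChartAt I x x) (fderiv ℝ ηh (extChartAt I x x)))
    (MetricCoord.sharpAt G (extChartAt I x x) (fderiv ℝ uh (extChartAt I x x)))
  rw [hGX, hGY, ← hNdef] at hCS
  have hder : g.innerDual x (mvfderiv I η x).toLinearMap (mvfderiv I (g.gradSq u) x).toLinearMap =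
      2 * MetricCoord.hessAt G uh (extChartAt I x x)
        (MetricCoord.sharpAt G (extChartAt I x x) (fderiv ℝ ηh (extChartAt I x x)))
        (MetricCoord.sharpAt G (extChartAt I x x) (fderiv ℝ uh (extChartAt I x x))) := by
    rw [hIη, hGm.fderiv_gradSqAt hu0 huh]
  have h4 : 0 ≤ 4 * g.gradSq η x * g.gradSq u x :=
    mul_nonneg (mul_nonneg (by norm_num) (g.gradSq_nonneg hR η x)) (g.gradSq_nonneg hR u x)
  calc (g.innerDual x (mvfderiv I η x).toLinearMap (mvfderiv I (g.gradSq u) x).toLinearMap) ^ 2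
      = 4 * (MetricCoord.hessAt G uh (extChartAt I x x)
          (MetricCoord.sharpAt G (extChartAt I x x) (fderiv ℝ ηh (extChartAt I x x)))
          (MetricCoord.sharpAt G (extChartAt I x x) (fderiv ℝ uh (extChartAt I x x)))) ^ 2 := by
        rw [hder]; ring
    _ ≤ 4 * (N * g.gradSq η x * g.gradSq u x) := by linarith [hCS]
    _ = 4 * g.gradSq η x * g.gradSq u x * N := by ring
    _ ≤ _ := mul_le_mul_of_nonneg_left hslack h4

end Literature.Geometry.Riemannian.BakryEmeryComplete

end Part7

/-!
## Part 8 — port of `Summits/SmoothPoincare4/SmoothPoincare4/Theorems/EntropyRungBakryEmeryLogSobolevGradientDissipation.lean` (3 declarations kept)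

# The dissipation inequality of the gradient subsolution with a first-order (Gaffney) cut-off

Setting: `M` modelled on `ℝⁿ` (Hausdorff, second countable, `T₃`, Borel — NOT compact), `g`
Riemannian with its Levi-Civita connection, `V` smooth with `Ric + Hess V ≥ K g` (NO other assumption
on `V`), `L = Δ_g − g⁻¹(dV, d·)`; Gaffney cut-offs `η_k` (`0 ≤ η_k ≤ 1`, `η_k ≤ η_{k+1}`, `η_k(x) = 1`
for large `k`, `|∇η_k|² ≤ C₀/(k+1)²`, `exists_gaffney_cutoff`).

This file is the one-cut-off step of the gradient decay `|∇ρ(s)|² ≤ e^{-2Ks} sup|∇ρ₀|²`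
(`gaffney_gradientDecay`, `EntropyRungBakryEmeryLogSobolevGradientBound.lean`): the energy method for
the SUBSOLUTION `w = e^{2Ks}|∇ρ|² − G₀` with the linear-growth convex
test function `Ψ` of `exists_convexTest` and the weights `η_k² e^{-V}`; what makes first-order cut-offs
possible is the Hessian term of the weighted Bochner formula: with the slack
`S = ½L|∇ρ|² − g⁻¹(dρ, d(Lρ)) − K|∇ρ|² ≥ |Hess ρ|² ≥ 0` one has EXACTLY `∂ₛw − Lw = −2e^{2Ks} S`
(`deriv_gradSq_of_heatFlow_isOpen`), while the cut-off error `g⁻¹(dη, dw) = e^{2Ks} g⁻¹(dη, d|∇ρ|²)`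
obeys `g⁻¹(dη, d|∇ρ|²)² ≤ 4|∇η|²|∇ρ|² S` (`innerDual_gradSq_sq_le_slack`); hence, for
`E_k(s) = ∫ Ψ(w(s)) η_k² e^{-V}`,
`E_k' = −∫ η_k²Ψ''(w)|∇w|²e^{-V} − 2∫ Ψ'(w)η_k g⁻¹(dη_k, dw)e^{-V} − 2∫ Ψ'(w)η_k² e^{2Ks} S e^{-V}
≤ 2 e^{2Ks} ∫ Ψ'(w) |∇η_k|² |∇ρ|² e^{-V} ≤ 2e^{2|K|T} C₀/(k+1)² ∫ |∇ρ(s)|² e^{-V}`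
(`slack_absorb`), so `0 ≤ E_k(s) ≤ 2e^{2|K|T} C₀/(k+1)² ∫∫|∇ρ|²e^{-V} → 0`; `E_k` is nondecreasing in
`k`, every `E_k(s)` vanishes, `w ≤ 0`. (Closed case: `heatFlow_gradSq_le`; the shrinker toolkit's
`helper_gradientDecay` uses cut-offs with `|Lη_k| ≤ C` instead.) Everything is proved; no definitions.

## References

* [BakryGentilLedoux2014] D. Bakry, I. Gentil, M. Ledoux (2014), Thm. 3.2.3/3.2.4 and their proofs,
  pp. 143–147 (gradient bounds on a complete manifold through cut-offs `ζ_k`, `Γ(ζ_k) ≤ 1/k`), §C.6.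
* [CarrilloNi2009] J. A. Carrillo, L. Ni, Comm. Anal. Geom. 17 (2009), §3 (p. 8) and §4.
* [Grigoryan2009] A. Grigor'yan (2009), §12.1 (energy method with cut-offs).
-/

section Part8

open scoped _root_.Manifold _root_.ContDiff _root_.ENNReal _root_.NNReal _root_.Topology
open _root_.MeasureTheory _root_.Set _root_.Filter
open Literature.Geometry.Lorentzian Literature.Geometry.Riemannian

namespace Literature.Geometry.Riemannian.BakryEmeryComplete

open NoncompactShrinkerGapHeat NoncompactShrinkerGapHeat.CutoffToolkit

/-! ### The pointwise absorption behind the gradient bound -/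

/-- **Absorption of the cut-off error into the `Γ₂`-slack.** For `ψ' ≥ 0`, `e ≥ 0`, `S, G, Q ≥ 0`
and `J² ≤ 4 G Q S` (the values of `Ψ'(w)`, `e^{2Ks}`, the slack, `|∇η|²`, `|∇ρ|²`,
`J = g⁻¹(dη, d|∇ρ|²)`): `−2 ψ' η (e J) − 2 ψ' η² e S ≤ 2 ψ' e (G Q)`, because
`(η J)² ≤ 4 η² G Q S ≤ (η² S + G Q)²`. [cite: BakryGentilLedoux2014, Thm. 3.2.3 (proof, pp. 143–146)] -/
theorem slack_absorb {ψ' e J S G Q η : ℝ} (hψ : 0 ≤ ψ') (he : 0 ≤ e) (hS : 0 ≤ S) (hG : 0 ≤ G)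
    (hQ : 0 ≤ Q) (hJ : J ^ 2 ≤ 4 * G * Q * S) :
    -(2 * (ψ' * η * (e * J))) - 2 * (ψ' * η ^ 2 * e * S) ≤ 2 * (ψ' * e * (G * Q)) := by
  have hsq : (η * J) ^ 2 ≤ (η ^ 2 * S + G * Q) ^ 2 := by
    have h1 : (η * J) ^ 2 ≤ 4 * (η ^ 2 * S) * (G * Q) := by
      rw [mul_pow]
      nlinarith [mul_le_mul_of_nonneg_left hJ (sq_nonneg η)]
    nlinarith [sq_nonneg (η ^ 2 * S - G * Q)]
  have hnn : 0 ≤ η ^ 2 * S + G * Q := add_nonneg (mul_nonneg (sq_nonneg _) hS) (mul_nonneg hG hQ)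
  have habs := abs_le_of_sq_le_sq' hsq hnn
  have hcross : -(η * J) ≤ η ^ 2 * S + G * Q := by linarith [habs.1]
  have hpe : 0 ≤ ψ' * e := mul_nonneg hψ he
  have key := mul_le_mul_of_nonneg_left hcross hpe
  nlinarith [key]

section Gradient

variable {n : ℕ} {M : Type*} [TopologicalSpace M] [T2Space M] [SecondCountableTopology M]
  [ChartedSpace (EuclideanSpace ℝ (Fin n)) M] [IsManifold (𝓡 n) ∞ M] [T3Space M]
  [MeasurableSpace M] [BorelSpace M]
  {g : PseudoRiemannianMetric (𝓡 n) ∞ (EuclideanSpace ℝ (Fin n)) (TangentSpace (𝓡 n) : M → Type _)}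
  [g.HasLeviCivita]

omit [T2Space M] [SecondCountableTopology M] [IsManifold (𝓡 n) ∞ M] [T3Space M] [MeasurableSpace M]
  [BorelSpace M] in
/-- The differential of an affine function of `u`: `d(a u + b) = a du`. [cite: BakryGentilLedoux2014, Thm. 3.2.3 (proof, pp. 143–146)] -/
theorem mvfderiv_affine_toLinearMap {u : M → ℝ} {x : M} (hu : MDifferentiableAt (𝓡 n) 𝓘(ℝ, ℝ) u x)
    (a b : ℝ) :
    (mvfderiv (𝓡 n) (fun y ↦ a * u y + b) x).toLinearMap = a • (mvfderiv (𝓡 n) u x).toLinearMap := by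
  have hζ1 : HasDerivAt (fun t : ℝ ↦ a * t + b) a (u x) := by
    simpa using ((hasDerivAt_id (u x)).const_mul a).add_const b
  have hcomp : (fun y ↦ a * u y + b) = (fun t : ℝ ↦ a * t + b) ∘ u := rfl
  ext v
  have h := mvfderiv_real_comp_apply (I := 𝓡 n) hζ1 hu v
  simpa [hcomp] using h

/-- **The dissipation inequality for the gradient subsolution, one first-order cut-off.** Let
`Ric + Hess V ≥ K g`, `ρ` smooth, `η ∈ C_c^∞`, `Ψ` smooth with `Ψ', Ψ'' ≥ 0`, `e ≥ 0`, `G₀ ∈ ℝ`,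
`w = e |∇ρ|² − G₀`. Then
`∫ Ψ'(w) η² (Lw) e^{-V} + ∫ Ψ'(w) η² (e (2K|∇ρ|² + 2 g⁻¹(dρ, d(Lρ)) − L|∇ρ|²)) e^{-V}
≤ 2 e ∫ Ψ'(w) |∇η|² |∇ρ|² e^{-V}`: the `η²`-Green identity
(`integral_mul_cutoffSq_mul_weightedLaplacian`), `Ψ'' ≥ 0`, and `slack_absorb` with
`innerDual_gradSq_sq_le_slack`. The second integrand is `Ψ'(w) η² (∂ₛw − Lw)` along the heat flow.
[cite: BakryGentilLedoux2014, Thm. 3.2.3 (proof, pp. 143–146)] -/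
theorem integral_gradTest_dissipation_le (hg : g.IsRiemannian) {V : M → ℝ} {K : ℝ}
    (hV : ContMDiff (𝓡 n) 𝓘(ℝ, ℝ) ∞ V)
    (hRic : ∀ (y : M) (X : TangentSpace (𝓡 n) y), K * g.val y X X ≤ g.ricci y X X + g.hessian V y X X)
    {ρ η : M → ℝ} (hρ : ContMDiff (𝓡 n) 𝓘(ℝ, ℝ) ∞ ρ) (hη : ContMDiff (𝓡 n) 𝓘(ℝ, ℝ) ∞ η)
    (hηc : HasCompactSupport η) {Ψ : ℝ → ℝ} (hΨ : ContDiff ℝ ∞ Ψ) (hΨ1 : ∀ t, 0 ≤ deriv Ψ t)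
    (hΨ2 : ∀ t, 0 ≤ deriv (deriv Ψ) t) {e : ℝ} (he : 0 ≤ e) (G₀ : ℝ) :
    (∫ x, deriv Ψ (e * g.gradSq ρ x + -G₀) * η x ^ 2 *
        (g.dalembertian (fun y ↦ e * g.gradSq ρ y + -G₀) x
          - g.innerDual x (mvfderiv (𝓡 n) V x).toLinearMap
            (mvfderiv (𝓡 n) (fun y ↦ e * g.gradSq ρ y + -G₀) x).toLinearMap) * Real.exp (-V x)
        ∂g.riemVolume)
      + ∫ x, deriv Ψ (e * g.gradSq ρ x + -G₀) * η x ^ 2 *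
          (e * (2 * K * g.gradSq ρ x
            + 2 * g.innerDual x (mvfderiv (𝓡 n) ρ x).toLinearMap
              (mvfderiv (𝓡 n) (fun y ↦ g.dalembertian ρ y
                - g.innerDual y (mvfderiv (𝓡 n) V y).toLinearMap (mvfderiv (𝓡 n) ρ y).toLinearMap)
                x).toLinearMap
            - (g.dalembertian (g.gradSq ρ) x - g.innerDual x (mvfderiv (𝓡 n) V x).toLinearMap
                (mvfderiv (𝓡 n) (g.gradSq ρ) x).toLinearMap))) * Real.exp (-V x) ∂g.riemVolume ≤
      2 * e * ∫ x, deriv Ψ (e * g.gradSq ρ x + -G₀) * (g.gradSq η x * g.gradSq ρ x) * Real.exp (-V x)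
        ∂g.riemVolume := by
  haveI := CarrilloNi2009_shrinkerLSI.isFiniteMeasureOnCompacts_riemVolume hg
  have h1le : (1 : ℕ∞ω) ≤ (∞ : ℕ∞ω) := WithTop.coe_le_coe.mpr le_top
  have h2le : (2 : ℕ∞ω) ≤ (∞ : ℕ∞ω) := WithTop.coe_le_coe.mpr le_top
  -- notation
  set Q : M → ℝ := g.gradSq ρ with hQdef
  have hQ : ContMDiff (𝓡 n) 𝓘(ℝ, ℝ) ∞ Q := contMDiff_gradSq g hρ
  set w : M → ℝ := fun y ↦ e * Q y + -G₀ with hwdef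
  have hw : ContMDiff (𝓡 n) 𝓘(ℝ, ℝ) ∞ w := (contMDiff_const.mul hQ).add contMDiff_const
  set Lρ : M → ℝ := fun y ↦ g.dalembertian ρ y
    - g.innerDual y (mvfderiv (𝓡 n) V y).toLinearMap (mvfderiv (𝓡 n) ρ y).toLinearMap with hLρ
  set S : M → ℝ := fun x ↦ (1 / 2) * (g.dalembertian Q x
      - g.innerDual x (mvfderiv (𝓡 n) V x).toLinearMap (mvfderiv (𝓡 n) Q x).toLinearMap)
    - g.innerDual x (mvfderiv (𝓡 n) ρ x).toLinearMap (mvfderiv (𝓡 n) Lρ x).toLinearMap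
    - K * Q x with hSdef
  have hS0 : ∀ x, 0 ≤ S x := fun x ↦ by
    have h := weightedBochner_pointwise_ge g hg hV hRic hρ x
    simp only [hSdef, hQdef, hLρ]
    linarith [h]
  have hslack : ∀ x, (g.innerDual x (mvfderiv (𝓡 n) η x).toLinearMap
      (mvfderiv (𝓡 n) Q x).toLinearMap) ^ 2 ≤ 4 * g.gradSq η x * Q x * S x := fun x ↦
    innerDual_gradSq_sq_le_slack g hg hV hRic hρ hη x
  -- the one-variable functions
  have hΨ' : ContDiff ℝ ∞ (deriv Ψ) := (contDiff_infty_iff_deriv.1 hΨ).2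
  have hΨ'd : ∀ t, HasDerivAt (deriv Ψ) (deriv (deriv Ψ) t) t := fun t ↦
    (hΨ'.differentiable (by simp) t).hasDerivAt
  -- the Green identity against `Ψ'(w) η²`
  have ha : ContMDiff (𝓡 n) 𝓘(ℝ, ℝ) ∞ (fun y ↦ deriv Ψ (w y)) := hΨ'.comp_contMDiff hw
  have hid := integral_mul_cutoffSq_mul_weightedLaplacian hg (a := fun y ↦ deriv Ψ (w y)) ha hw hη hηc hV
  -- chain rules
  have hwd : ∀ x, MDifferentiableAt (𝓡 n) 𝓘(ℝ, ℝ) w x := fun x ↦ hw.mdifferentiableAt (by simp)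
  have hQd : ∀ x, MDifferentiableAt (𝓡 n) 𝓘(ℝ, ℝ) Q x := fun x ↦ hQ.mdifferentiableAt (by simp)
  have hdw : ∀ x, (mvfderiv (𝓡 n) w x).toLinearMap = e • (mvfderiv (𝓡 n) Q x).toLinearMap := fun x ↦
    mvfderiv_affine_toLinearMap (hQd x) e (-G₀)
  have hch : ∀ x, (mvfderiv (𝓡 n) (fun y ↦ deriv Ψ (w y)) x).toLinearMap =
      deriv (deriv Ψ) (w x) • (mvfderiv (𝓡 n) w x).toLinearMap := fun x ↦ by
    ext v
    exact mvfderiv_real_comp_apply (I := 𝓡 n) (hΨ'd (w x)) (hwd x) v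
  have hpt1 : ∀ x, g.innerDual x (mvfderiv (𝓡 n) (fun y ↦ deriv Ψ (w y)) x).toLinearMap
      (mvfderiv (𝓡 n) w x).toLinearMap = deriv (deriv Ψ) (w x) * g.gradSq w x := fun x ↦ by
    rw [hch x, g.innerDual_smul_left]; rfl
  have hpt2 : ∀ x, g.innerDual x (mvfderiv (𝓡 n) η x).toLinearMap (mvfderiv (𝓡 n) w x).toLinearMap =
      e * g.innerDual x (mvfderiv (𝓡 n) η x).toLinearMap (mvfderiv (𝓡 n) Q x).toLinearMap := fun x ↦ by
    rw [hdw x, g.innerDual_smul_right]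
  -- the pointwise inequality
  have hpt : ∀ x,
      (-(η x ^ 2 * g.innerDual x (mvfderiv (𝓡 n) (fun y ↦ deriv Ψ (w y)) x).toLinearMap
          (mvfderiv (𝓡 n) w x).toLinearMap * Real.exp (-V x))
        - 2 * ((fun y ↦ deriv Ψ (w y)) x * η x * g.innerDual x (mvfderiv (𝓡 n) η x).toLinearMap
          (mvfderiv (𝓡 n) w x).toLinearMap * Real.exp (-V x)))
      + deriv Ψ (w x) * η x ^ 2 * (e * (2 * K * Q x
          + 2 * g.innerDual x (mvfderiv (𝓡 n) ρ x).toLinearMap (mvfderiv (𝓡 n) Lρ x).toLinearMap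
          - (g.dalembertian Q x - g.innerDual x (mvfderiv (𝓡 n) V x).toLinearMap
              (mvfderiv (𝓡 n) Q x).toLinearMap))) * Real.exp (-V x) ≤
      2 * e * (deriv Ψ (w x) * (g.gradSq η x * Q x) * Real.exp (-V x)) := by
    intro x
    rw [hpt1 x, hpt2 x]
    have hex : 0 ≤ Real.exp (-V x) := (Real.exp_pos _).le
    have hψ1 := hΨ1 (w x)
    have hψ2 := hΨ2 (w x)
    have hGw : 0 ≤ g.gradSq w x := g.gradSq_nonneg hg w x
    have hGη : 0 ≤ g.gradSq η x := g.gradSq_nonneg hg η x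
    have hQ0 : 0 ≤ Q x := g.gradSq_nonneg hg ρ x
    -- `∂ₛw − Lw = −2 e S`
    have hsrc : e * (2 * K * Q x
        + 2 * g.innerDual x (mvfderiv (𝓡 n) ρ x).toLinearMap (mvfderiv (𝓡 n) Lρ x).toLinearMap
        - (g.dalembertian Q x - g.innerDual x (mvfderiv (𝓡 n) V x).toLinearMap
            (mvfderiv (𝓡 n) Q x).toLinearMap)) = -(2 * e * S x) := by
      simp only [hSdef]; ring
    rw [hsrc]
    have habs := slack_absorb (η := η x) hψ1 he (hS0 x) hGη hQ0 (hslack x)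
    -- drop the `Ψ''` term
    have hdrop : -(η x ^ 2 * (deriv (deriv Ψ) (w x) * g.gradSq w x) * Real.exp (-V x)) ≤ 0 := by
      have : 0 ≤ η x ^ 2 * (deriv (deriv Ψ) (w x) * g.gradSq w x) * Real.exp (-V x) :=
        mul_nonneg (mul_nonneg (sq_nonneg _) (mul_nonneg hψ2 hGw)) hex
      linarith
    have key := mul_le_mul_of_nonneg_right habs hex
    nlinarith [key, hdrop]
  -- integrability (everything is continuous with compact support)
  have hec : Continuous fun x ↦ Real.exp (-V x) := Real.continuous_exp.comp hV.continuous.neg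
  have hgradη : Continuous (g.gradSq η) := (contMDiff_gradSq g hη).continuous
  have hgradηs : HasCompactSupport (g.gradSq η) :=
    HasCompactSupport.intro hηc fun x hx ↦ gradSq_eq_zero_of_notMem_tsupport hx
  have hη2c : HasCompactSupport (fun x ↦ η x ^ 2) := by
    rw [show (fun x ↦ η x ^ 2) = fun x ↦ η x * η x from funext fun x ↦ sq (η x)]
    exact hηc.mul_right
  have hV1 := hV.of_le h1le
  have hI1c : Continuous fun x ↦ g.innerDual x (mvfderiv (𝓡 n) (fun y ↦ deriv Ψ (w y)) x).toLinearMap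
      (mvfderiv (𝓡 n) w x).toLinearMap := continuous_innerDual_mvfderiv g (ha.of_le h1le) (hw.of_le h1le)
  have hI2c : Continuous fun x ↦ g.innerDual x (mvfderiv (𝓡 n) η x).toLinearMap
      (mvfderiv (𝓡 n) w x).toLinearMap := continuous_innerDual_mvfderiv g (hη.of_le h1le) (hw.of_le h1le)
  have hLρs : ContMDiff (𝓡 n) 𝓘(ℝ, ℝ) ∞ Lρ := (contMDiff_dalembertian g hρ).sub (contMDiff_innerDual g hV hρ)
  have hI3c : Continuous fun x ↦ g.innerDual x (mvfderiv (𝓡 n) ρ x).toLinearMap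
      (mvfderiv (𝓡 n) Lρ x).toLinearMap := continuous_innerDual_mvfderiv g (hρ.of_le h1le) (hLρs.of_le h1le)
  have hLQc : Continuous fun x ↦ g.dalembertian Q x - g.innerDual x (mvfderiv (𝓡 n) V x).toLinearMap
      (mvfderiv (𝓡 n) Q x).toLinearMap :=
    (continuous_dalembertian g (hQ.of_le h2le)).sub (continuous_innerDual_mvfderiv g hV1 (hQ.of_le h1le))
  have hψwc : Continuous fun x ↦ deriv Ψ (w x) := ha.continuous
  have iA : Integrable (fun x ↦ η x ^ 2 * g.innerDual x
      (mvfderiv (𝓡 n) (fun y ↦ deriv Ψ (w y)) x).toLinearMap (mvfderiv (𝓡 n) w x).toLinearMap *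
      Real.exp (-V x)) g.riemVolume :=
    integrable_of_continuous_of_hasCompactSupport' hg (((hη.continuous.pow 2).mul hI1c).mul hec)
      (hη2c.mul_right.mul_right)
  have iB : Integrable (fun x ↦ (fun y ↦ deriv Ψ (w y)) x * η x * g.innerDual x
      (mvfderiv (𝓡 n) η x).toLinearMap (mvfderiv (𝓡 n) w x).toLinearMap * Real.exp (-V x)) g.riemVolume :=
    integrable_of_continuous_of_hasCompactSupport' hg (((hψwc.mul hη.continuous).mul hI2c).mul hec)
      (((hηc.mul_left).mul_right).mul_right)
  have iC : Integrable (fun x ↦ deriv Ψ (w x) * η x ^ 2 * (e * (2 * K * Q x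
      + 2 * g.innerDual x (mvfderiv (𝓡 n) ρ x).toLinearMap (mvfderiv (𝓡 n) Lρ x).toLinearMap
      - (g.dalembertian Q x - g.innerDual x (mvfderiv (𝓡 n) V x).toLinearMap
          (mvfderiv (𝓡 n) Q x).toLinearMap))) * Real.exp (-V x)) g.riemVolume := by
    refine integrable_of_continuous_of_hasCompactSupport' hg
      (((hψwc.mul (hη.continuous.pow 2)).mul (continuous_const.mul
        (((continuous_const.mul hQ.continuous).add (continuous_const.mul hI3c)).sub hLQc))).mul hec) ?_
    exact ((hη2c.mul_left).mul_right).mul_right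
  have iAn : Integrable (fun x ↦ -(η x ^ 2 * g.innerDual x
      (mvfderiv (𝓡 n) (fun y ↦ deriv Ψ (w y)) x).toLinearMap (mvfderiv (𝓡 n) w x).toLinearMap *
      Real.exp (-V x))) g.riemVolume := iA.neg
  have iB2 : Integrable (fun x ↦ 2 * ((fun y ↦ deriv Ψ (w y)) x * η x * g.innerDual x
      (mvfderiv (𝓡 n) η x).toLinearMap (mvfderiv (𝓡 n) w x).toLinearMap * Real.exp (-V x))) g.riemVolume :=
    iB.const_mul 2
  have iL1 : Integrable (fun x ↦ -(η x ^ 2 * g.innerDual x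
        (mvfderiv (𝓡 n) (fun y ↦ deriv Ψ (w y)) x).toLinearMap (mvfderiv (𝓡 n) w x).toLinearMap *
        Real.exp (-V x))
      - 2 * ((fun y ↦ deriv Ψ (w y)) x * η x * g.innerDual x (mvfderiv (𝓡 n) η x).toLinearMap
        (mvfderiv (𝓡 n) w x).toLinearMap * Real.exp (-V x))) g.riemVolume := iAn.sub iB2
  have iL : Integrable (fun x ↦ (-(η x ^ 2 * g.innerDual x
        (mvfderiv (𝓡 n) (fun y ↦ deriv Ψ (w y)) x).toLinearMap (mvfderiv (𝓡 n) w x).toLinearMap *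
        Real.exp (-V x))
      - 2 * ((fun y ↦ deriv Ψ (w y)) x * η x * g.innerDual x (mvfderiv (𝓡 n) η x).toLinearMap
        (mvfderiv (𝓡 n) w x).toLinearMap * Real.exp (-V x)))
      + deriv Ψ (w x) * η x ^ 2 * (e * (2 * K * Q x
          + 2 * g.innerDual x (mvfderiv (𝓡 n) ρ x).toLinearMap (mvfderiv (𝓡 n) Lρ x).toLinearMap
          - (g.dalembertian Q x - g.innerDual x (mvfderiv (𝓡 n) V x).toLinearMap
              (mvfderiv (𝓡 n) Q x).toLinearMap))) * Real.exp (-V x)) g.riemVolume := iL1.add iC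
  have iR : Integrable (fun x ↦ 2 * e * (deriv Ψ (w x) * (g.gradSq η x * Q x) * Real.exp (-V x)))
      g.riemVolume := by
    refine (integrable_of_continuous_of_hasCompactSupport' hg
      ((hψwc.mul (hgradη.mul hQ.continuous)).mul hec) ?_).const_mul (2 * e)
    exact ((hgradηs.mul_right).mul_left).mul_right
  have hmono := integral_mono iL iR hpt
  rw [integral_add iL1 iC, integral_sub iAn iB2, integral_neg,
    integral_const_mul, integral_const_mul] at hmono
  rw [hid]
  exact hmono

end Gradient

end Literature.Geometry.Riemannian.BakryEmeryComplete

end Part8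

/-!
## Part 9 — port of `Summits/SmoothPoincare4/SmoothPoincare4/Theorems/EntropyRungBakryEmeryLogSobolevGradientBound.lean` (1 declarations kept)

# Gradient decay `|∇ρ(s)|² ≤ e^{-2Ks} sup|∇ρ₀|²` for `𝕃²` solutions of the weighted heat flow on a
# complete `CD(K, ∞)` manifold, with first-order (Gaffney) cut-offs

Setting: `M` modelled on `ℝⁿ` (Hausdorff, second countable, `T₃`, Borel — NOT compact), `g`
Riemannian with its Levi-Civita connection, `V` smooth with `Ric + Hess V ≥ K g` (NO other assumption
on `V`), `L = Δ_g − g⁻¹(dV, d·)`; Gaffney cut-offs `η_k` (`0 ≤ η_k ≤ 1`, `η_k ≤ η_{k+1}`, `η_k(x) = 1`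
for large `k`, `|∇η_k|² ≤ C₀/(k+1)²`, `exists_gaffney_cutoff`).

**Theorem** (`gaffney_gradientDecay`). A solution `ρ` of `∂ₛρ = Lρ` on `[0, T]`, smooth on `M × O`
(`O ⊇ [0,T]` open), of finite energy `|∇ρ|² e^{-V} ∈ L¹(M × (0,T))`, with `|∇ρ(0)|² ≤ G₀`, satisfies
`|∇ρ(s)|² ≤ e^{-2Ks} G₀` on `[0, T]`: the energy method for the subsolution `w = e^{2Ks}|∇ρ|² − G₀`
(`∂ₛw − Lw = −2e^{2Ks} S` with the `Γ₂`-slack `S`) with the linear test function of `exists_convexTest`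
and weights `η_k² e^{-V}`, the cut-off error being absorbed into `S`
(`integral_gradTest_dissipation_le`, `EntropyRungBakryEmeryLogSobolevGradientDissipation.lean`), so that
`0 ≤ E_k(s) ≤ 2e^{2|K|T} C₀/(k+1)² ∫∫|∇ρ|² e^{-V} → 0`, `E_k` nondecreasing in `k` — the weak Bakry–Émery
commutation `Γ(P_t f) ≤ e^{-2Kt}‖Γf‖_∞` for the minimal heat flow. Everything is proved; no definitions.

## References

* [BakryGentilLedoux2014] D. Bakry, I. Gentil, M. Ledoux (2014), Thm. 3.2.3/3.2.4 and their proofs,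
  pp. 143–147 (gradient bounds on a complete manifold through cut-offs `ζ_k`, `Γ(ζ_k) ≤ 1/k`), §C.6.
* [CarrilloNi2009] J. A. Carrillo, L. Ni, Comm. Anal. Geom. 17 (2009), §3 (p. 8) and §4.
-/

section Part9

open scoped _root_.Manifold _root_.ContDiff _root_.ENNReal _root_.NNReal _root_.Topology
open _root_.MeasureTheory _root_.Set _root_.Filter
open Literature.Geometry.Lorentzian Literature.Geometry.Riemannian

namespace Literature.Geometry.Riemannian.BakryEmeryComplete

open NoncompactShrinkerGapHeat NoncompactShrinkerGapHeat.CutoffToolkit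

section Gradient

variable {n : ℕ} {M : Type*} [TopologicalSpace M] [T2Space M] [SecondCountableTopology M]
  [ChartedSpace (EuclideanSpace ℝ (Fin n)) M] [IsManifold (𝓡 n) ∞ M] [T3Space M]
  [MeasurableSpace M] [BorelSpace M]
  {g : PseudoRiemannianMetric (𝓡 n) ∞ (EuclideanSpace ℝ (Fin n)) (TangentSpace (𝓡 n) : M → Type _)}
  [g.HasLeviCivita]

/-- **Gradient decay for finite-energy solutions of the weighted heat flow on a complete `CD(K,∞)`
manifold, with Gaffney cut-offs.** `Ric + Hess V ≥ K g`, `V` smooth (no other assumption); `η_k` as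
in `exists_gaffney_cutoff`; `ρ` smooth on `M × O` (`O ⊇ [0,T]` open) with `∂ₛρ = Lρ` on `[0, T]`,
`|∇ρ|² e^{-V}` integrable on the strip `M × (0,T)` and `|∇ρ(0)|² ≤ G₀`. Then
`|∇ρ(s)|² ≤ e^{-2Ks} G₀` on `[0, T]`. Energy method for `w = e^{2Ks}|∇ρ|² − G₀` with the linear test
function of `exists_convexTest` and weights `η_k² e^{-V}`: `∂ₛw − Lw = −2e^{2Ks}S` with the
`Γ₂`-slack `S`, and the cut-off error is absorbed into `S` (`integral_gradTest_dissipation_le`), so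
`0 ≤ E_k(s) ≤ 2e^{2|K|T} C₀/(k+1)² ∫∫ |∇ρ|² e^{-V} → 0`. This is the (weak) Bakry–Émery commutation
`Γ(P_t f) ≤ e^{-2Kt} ‖Γ f‖_∞` for the minimal heat flow.
[cite: BakryGentilLedoux2014, Thm. 3.2.3 and Thm. 3.2.4 (proofs, pp. 143–147)]
[cite: CarrilloNi2009, §3 (C(K,∞), p. 8)] -/
theorem gaffney_gradientDecay (hg : g.IsRiemannian) {V : M → ℝ} {K : ℝ}
    (hV : ContMDiff (𝓡 n) 𝓘(ℝ, ℝ) ∞ V)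
    (hRic : ∀ (y : M) (X : TangentSpace (𝓡 n) y), K * g.val y X X ≤ g.ricci y X X + g.hessian V y X X)
    {η : ℕ → M → ℝ} {C₀ : ℝ} (hηs : ∀ k, ContMDiff (𝓡 n) 𝓘(ℝ, ℝ) ∞ (η k))
    (hηc : ∀ k, HasCompactSupport (η k)) (hη01 : ∀ k x, 0 ≤ η k x ∧ η k x ≤ 1)
    (hηmono : ∀ k x, η k x ≤ η (k + 1) x) (hη1 : ∀ x, ∀ᶠ k in atTop, η k x = 1)
    (hηgrad : ∀ k x, g.gradSq (η k) x ≤ C₀ / ((k : ℝ) + 1) ^ 2)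
    {T : ℝ} {O : Set ℝ} {ρ : ℝ → M → ℝ} (hO : IsOpen O) (hTO : Icc 0 T ⊆ O)
    (hρ : ContMDiffOn ((𝓡 n).prod 𝓘(ℝ, ℝ)) 𝓘(ℝ, ℝ) ∞ (fun p : M × ℝ ↦ ρ p.2 p.1) (univ ×ˢ O))
    (heq : ∀ s ∈ Icc 0 T, ∀ x, deriv (fun r ↦ ρ r x) s = g.dalembertian (ρ s) x
      - g.innerDual x (mvfderiv (𝓡 n) V x).toLinearMap (mvfderiv (𝓡 n) (ρ s) x).toLinearMap)
    (hint : Integrable (fun p : M × ℝ ↦ g.gradSq (ρ p.2) p.1 * Real.exp (-V p.1))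
      ((g.riemVolume.prod (volume : Measure ℝ)).restrict (univ ×ˢ Ioo 0 T)))
    {G₀ : ℝ} (hG₀ : ∀ x, g.gradSq (ρ 0) x ≤ G₀) :
    ∀ s ∈ Icc 0 T, ∀ x, g.gradSq (ρ s) x ≤ Real.exp (-2 * K * s) * G₀ := by
  intro s₀ hs₀ x₀
  -- topology and measure
  haveI : LocallyCompactSpace M := Manifold.locallyCompact_of_finiteDimensional (M := M) (𝓡 n)
  haveI : IsFiniteMeasureOnCompacts g.riemVolume := CarrilloNi2009_shrinkerLSI.isFiniteMeasureOnCompacts_riemVolume hg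
  haveI : IsLocallyFiniteMeasure g.riemVolume := isLocallyFiniteMeasure_of_isFiniteMeasureOnCompacts
  haveI : g.riemVolume.IsOpenPosMeasure := isOpenPosMeasure_riemVolume hg
  haveI := sigmaFinite_riemVolume hg
  set μ : Measure M := g.riemVolume with hμ
  -- the test function (linear growth)
  obtain ⟨Ψ, hΨs, hΨneg, hΨ', hΨ'', hΨbd, hΨzero⟩ := exists_convexTest
  have hΨd : ∀ t, HasDerivAt Ψ (deriv Ψ t) t := fun t ↦ (hΨs.differentiable (by simp) t).hasDerivAt
  have hΨc : Continuous Ψ := hΨs.continuous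
  have hΨ'c : Continuous (deriv Ψ) := hΨs.continuous_deriv (by simp)
  -- the subsolution `w(s, x) = e^{2Ks}|∇ρ(s)|²(x) − G₀`
  set ex : ℝ → ℝ := fun s ↦ Real.exp (2 * K * s) with hex
  have hexd : ∀ s, HasDerivAt ex (2 * K * ex s) s := fun s ↦ by
    have h1 : HasDerivAt (fun r : ℝ ↦ 2 * K * r) (2 * K) s := by
      simpa using (hasDerivAt_id s).const_mul (2 * K)
    simpa [hex, mul_comm] using h1.exp
  have hex0 : ∀ s, 0 ≤ ex s := fun s ↦ (Real.exp_pos _).le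
  have hexT : ∀ s ∈ Icc 0 T, ex s ≤ Real.exp (2 * |K| * T) := fun s hs ↦ by
    refine Real.exp_le_exp.2 ?_
    have h1 : 2 * K * s ≤ 2 * |K| * s := by nlinarith [le_abs_self K, hs.1]
    have h2 : 2 * |K| * s ≤ 2 * |K| * T := by nlinarith [abs_nonneg K, hs.2]
    linarith
  set Q : ℝ → M → ℝ := fun s x ↦ g.gradSq (ρ s) x with hQdef
  set w : ℝ → M → ℝ := fun s x ↦ ex s * Q s x + -G₀ with hwdef
  have hQj : ContMDiffOn ((𝓡 n).prod 𝓘(ℝ, ℝ)) 𝓘(ℝ, ℝ) ∞ (fun p : M × ℝ ↦ Q p.2 p.1) (univ ×ˢ O) :=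
    contMDiffOn_gradSq_family g hO.uniqueDiffOn hρ
  have hexj : ContMDiffOn ((𝓡 n).prod 𝓘(ℝ, ℝ)) 𝓘(ℝ, ℝ) ∞ (fun p : M × ℝ ↦ ex p.2) (univ ×ˢ O) := by
    have h : ContDiff ℝ ∞ ex := Real.contDiff_exp.comp (contDiff_const.mul contDiff_id)
    exact (h.comp_contMDiff contMDiff_snd).contMDiffOn
  have hwj : ContMDiffOn ((𝓡 n).prod 𝓘(ℝ, ℝ)) 𝓘(ℝ, ℝ) ∞ (fun p : M × ℝ ↦ w p.2 p.1) (univ ×ˢ O) :=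
    (hexj.mul hQj).add contMDiffOn_const
  have hρs : ∀ s ∈ O, ContMDiff (𝓡 n) 𝓘(ℝ, ℝ) ∞ (ρ s) := fun s hs ↦ contMDiff_slice_of_contMDiffOn hρ hs
  have hws : ∀ s ∈ O, ContMDiff (𝓡 n) 𝓘(ℝ, ℝ) ∞ (w s) := fun s hs ↦ contMDiff_slice_of_contMDiffOn hwj hs
  have hwc : ContinuousOn (fun p : M × ℝ ↦ w p.2 p.1) (univ ×ˢ O) := hwj.continuousOn
  have hw'c : ContinuousOn (fun p : M × ℝ ↦ deriv (fun r ↦ w r p.1) p.2) (univ ×ˢ O) := continuousOn_deriv_time hO hwj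
  -- the time derivative of `w` on `[0, T]`
  have hQderiv : ∀ s ∈ Icc 0 T, ∀ x, deriv (fun r ↦ Q r x) s =
      2 * g.innerDual x (mvfderiv (𝓡 n) (ρ s) x).toLinearMap
        (mvfderiv (𝓡 n) (fun y ↦ g.dalembertian (ρ s) y -
          g.innerDual y (mvfderiv (𝓡 n) V y).toLinearMap (mvfderiv (𝓡 n) (ρ s) y).toLinearMap) x).toLinearMap :=
    fun s hs x ↦ deriv_gradSq_of_heatFlow_isOpen hV hO hρ (hTO hs) (heq s hs) x
  have hwderiv : ∀ s ∈ Icc 0 T, ∀ x, deriv (fun r ↦ w r x) s =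
      2 * K * ex s * Q s x + ex s * (2 * g.innerDual x (mvfderiv (𝓡 n) (ρ s) x).toLinearMap
        (mvfderiv (𝓡 n) (fun y ↦ g.dalembertian (ρ s) y -
          g.innerDual y (mvfderiv (𝓡 n) V y).toLinearMap (mvfderiv (𝓡 n) (ρ s) y).toLinearMap) x).toLinearMap) := by
    intro s hs x
    have hQd : HasDerivAt (fun r ↦ Q r x) (deriv (fun r ↦ Q r x) s) s := CutoffToolkit.hasDerivAt_time hO hQj x (hTO hs)
    have h := ((hexd s).mul hQd).add_const (-G₀)
    have e : (fun r ↦ w r x) = fun r ↦ (ex * fun r' ↦ Q r' x) r + -G₀ := rfl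
    rw [e, h.deriv, hQderiv s hs x]
  -- the integrands `F = Ψ(w)`, `F' = Ψ'(w) ∂ₛw`
  set F : ℝ → M → ℝ := fun s x ↦ Ψ (w s x) with hF
  set F' : ℝ → M → ℝ := fun s x ↦ deriv Ψ (w s x) * deriv (fun r ↦ w r x) s with hF'
  have hFc : ContinuousOn (fun p : M × ℝ ↦ F p.2 p.1) (univ ×ˢ O) := hΨc.comp_continuousOn hwc
  have hF'c : ContinuousOn (fun p : M × ℝ ↦ F' p.2 p.1) (univ ×ˢ O) := (hΨ'c.comp_continuousOn hwc).mul hw'c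
  have hFd : ∀ s ∈ O, ∀ x, HasDerivAt (F · x) (F' s x) s := fun s hs x ↦
    (hΨd (w s x)).comp s (CutoffToolkit.hasDerivAt_time hO hwj x hs)
  -- weights, energies, error terms
  have hexpc : Continuous fun x ↦ Real.exp (-V x) := Real.continuous_exp.comp hV.continuous.neg
  have hη2c : ∀ k, HasCompactSupport (fun x ↦ η k x ^ 2) := fun k ↦ by
    rw [show (fun x ↦ η k x ^ 2) = fun x ↦ η k x * η k x from funext fun x ↦ sq (η k x)]
    exact (hηc k).mul_right
  set h : ℕ → M → ℝ := fun k x ↦ η k x ^ 2 * Real.exp (-V x) with hh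
  have hhc : ∀ k, Continuous (h k) := fun k ↦ ((hηs k).continuous.pow 2).mul hexpc
  have hhs : ∀ k, HasCompactSupport (h k) := fun k ↦ (hη2c k).mul_right
  have hh0 : ∀ k x, 0 ≤ h k x := fun k x ↦ mul_nonneg (sq_nonneg _) (Real.exp_pos _).le
  have hgradηc : ∀ k, Continuous (g.gradSq (η k)) := fun k ↦ (contMDiff_gradSq g (hηs k)).continuous
  have hgradηs : ∀ k, HasCompactSupport (g.gradSq (η k)) := fun k ↦ .intro (hηc k) fun x hx ↦ gradSq_eq_zero_of_notMem_tsupport hx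
  set wZ : ℕ → M → ℝ := fun k x ↦ g.gradSq (η k) x * Real.exp (-V x) with hwZ
  have hwZc : ∀ k, Continuous (wZ k) := fun k ↦ (hgradηc k).mul hexpc
  have hwZs : ∀ k, HasCompactSupport (wZ k) := fun k ↦ (hgradηs k).mul_right
  set E : ℕ → ℝ → ℝ := fun k s ↦ ∫ x, F s x * h k x ∂μ with hE
  set E' : ℕ → ℝ → ℝ := fun k s ↦ ∫ x, F' s x * h k x ∂μ with hE'
  set Z : ℕ → ℝ → ℝ := fun k s ↦ ∫ x, Q s x * wZ k x ∂μ with hZdef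
  have hEd : ∀ k, ∀ s ∈ O, HasDerivAt (E k) (E' k s) s := fun k s hs ↦
    hasDerivAt_integral_mul_of_hasCompactSupport μ (hhc k) (hhs k) hO hFc hF'c hFd hs
  have hE'c : ∀ k, ContinuousOn (E' k) O := fun k ↦ continuousOn_integral_mul_of_hasCompactSupport μ (hhc k) (hhs k) hF'c
  have hZc : ∀ k, ContinuousOn (Z k) O := fun k ↦
    continuousOn_integral_mul_of_hasCompactSupport μ (hwZc k) (hwZs k) hQj.continuousOn
  have hZ0 : ∀ k s, 0 ≤ Z k s := fun k s ↦ integral_nonneg fun x ↦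
    mul_nonneg (g.gradSq_nonneg hg _ _) (mul_nonneg (g.gradSq_nonneg hg _ _) (Real.exp_pos _).le)
  -- the dissipation bound `E' k s ≤ 2 e^{2|K|T} Z k s` on `[0, T]`
  set CT : ℝ := Real.exp (2 * |K| * T) with hCT
  have hE'le : ∀ k, ∀ s ∈ Icc 0 T, E' k s ≤ 2 * CT * Z k s := by
    intro k s hs
    have hsO := hTO hs
    have step := integral_gradTest_dissipation_le hg hV hRic (hρs s hsO) (hηs k) (hηc k) hΨs
      (fun t ↦ (hΨ' t).1) hΨ'' (hex0 s) G₀ (K := K)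
    -- `E' k s` is the left-hand side of `step`
    have hLc : ∀ x, deriv (fun r ↦ w r x) s =
        (g.dalembertian (w s) x - g.innerDual x (mvfderiv (𝓡 n) V x).toLinearMap
          (mvfderiv (𝓡 n) (w s) x).toLinearMap)
        + ex s * (2 * K * Q s x
          + 2 * g.innerDual x (mvfderiv (𝓡 n) (ρ s) x).toLinearMap
            (mvfderiv (𝓡 n) (fun y ↦ g.dalembertian (ρ s) y
              - g.innerDual y (mvfderiv (𝓡 n) V y).toLinearMap (mvfderiv (𝓡 n) (ρ s) y).toLinearMap)
              x).toLinearMap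
          - (g.dalembertian (Q s) x - g.innerDual x (mvfderiv (𝓡 n) V x).toLinearMap
              (mvfderiv (𝓡 n) (Q s) x).toLinearMap)) := by
      intro x
      have hQ2 : ContMDiffAt (𝓡 n) 𝓘(ℝ, ℝ) 2 (Q s) x :=
        ((contMDiff_gradSq g (hρs s hsO)).of_le (WithTop.coe_le_coe.mpr le_top)).contMDiffAt
      have haff := weightedLaplacian_affine (g := g) (V := V) hQ2 (ex s) (-G₀)
      rw [hwderiv s hs x, show w s = fun y ↦ ex s * Q s y + -G₀ from rfl, haff]
      ring
    have e1 : E' k s = (∫ x, deriv Ψ (ex s * g.gradSq (ρ s) x + -G₀) * η k x ^ 2 *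
        (g.dalembertian (fun y ↦ ex s * g.gradSq (ρ s) y + -G₀) x
          - g.innerDual x (mvfderiv (𝓡 n) V x).toLinearMap
            (mvfderiv (𝓡 n) (fun y ↦ ex s * g.gradSq (ρ s) y + -G₀) x).toLinearMap) * Real.exp (-V x) ∂μ)
      + ∫ x, deriv Ψ (ex s * g.gradSq (ρ s) x + -G₀) * η k x ^ 2 *
          (ex s * (2 * K * g.gradSq (ρ s) x
            + 2 * g.innerDual x (mvfderiv (𝓡 n) (ρ s) x).toLinearMap
              (mvfderiv (𝓡 n) (fun y ↦ g.dalembertian (ρ s) y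
                - g.innerDual y (mvfderiv (𝓡 n) V y).toLinearMap (mvfderiv (𝓡 n) (ρ s) y).toLinearMap)
                x).toLinearMap
            - (g.dalembertian (g.gradSq (ρ s)) x - g.innerDual x (mvfderiv (𝓡 n) V x).toLinearMap
                (mvfderiv (𝓡 n) (g.gradSq (ρ s)) x).toLinearMap))) * Real.exp (-V x) ∂μ := by
      have h1le : (1 : ℕ∞ω) ≤ (∞ : ℕ∞ω) := WithTop.coe_le_coe.mpr le_top
      have h2le : (2 : ℕ∞ω) ≤ (∞ : ℕ∞ω) := WithTop.coe_le_coe.mpr le_top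
      have hwss := hws s hsO
      have hρss := hρs s hsO
      have hQs : ContMDiff (𝓡 n) 𝓘(ℝ, ℝ) ∞ (Q s) := contMDiff_gradSq g hρss
      have hψwc : Continuous fun x ↦ deriv Ψ (w s x) := hΨ'c.comp hwss.continuous
      have hLwc : Continuous fun x ↦ g.dalembertian (w s) x - g.innerDual x
          (mvfderiv (𝓡 n) V x).toLinearMap (mvfderiv (𝓡 n) (w s) x).toLinearMap :=
        (continuous_dalembertian g (hwss.of_le h2le)).sub
          (continuous_innerDual_mvfderiv g (hV.of_le h1le) (hwss.of_le h1le))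
      have hLρss : ContMDiff (𝓡 n) 𝓘(ℝ, ℝ) ∞ (fun y ↦ g.dalembertian (ρ s) y
          - g.innerDual y (mvfderiv (𝓡 n) V y).toLinearMap (mvfderiv (𝓡 n) (ρ s) y).toLinearMap) :=
        (contMDiff_dalembertian g hρss).sub (contMDiff_innerDual g hV hρss)
      have hI3c : Continuous fun x ↦ g.innerDual x (mvfderiv (𝓡 n) (ρ s) x).toLinearMap
          (mvfderiv (𝓡 n) (fun y ↦ g.dalembertian (ρ s) y
            - g.innerDual y (mvfderiv (𝓡 n) V y).toLinearMap (mvfderiv (𝓡 n) (ρ s) y).toLinearMap)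
            x).toLinearMap := continuous_innerDual_mvfderiv g (hρss.of_le h1le) (hLρss.of_le h1le)
      have hLQc : Continuous fun x ↦ g.dalembertian (Q s) x - g.innerDual x
          (mvfderiv (𝓡 n) V x).toLinearMap (mvfderiv (𝓡 n) (Q s) x).toLinearMap :=
        (continuous_dalembertian g (hQs.of_le h2le)).sub
          (continuous_innerDual_mvfderiv g (hV.of_le h1le) (hQs.of_le h1le))
      have hsrcc : Continuous fun x ↦ ex s * (2 * K * Q s x
          + 2 * g.innerDual x (mvfderiv (𝓡 n) (ρ s) x).toLinearMap
            (mvfderiv (𝓡 n) (fun y ↦ g.dalembertian (ρ s) y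
              - g.innerDual y (mvfderiv (𝓡 n) V y).toLinearMap (mvfderiv (𝓡 n) (ρ s) y).toLinearMap)
              x).toLinearMap
          - (g.dalembertian (Q s) x - g.innerDual x (mvfderiv (𝓡 n) V x).toLinearMap
              (mvfderiv (𝓡 n) (Q s) x).toLinearMap)) :=
        continuous_const.mul (((continuous_const.mul hQs.continuous).add
          (continuous_const.mul hI3c)).sub hLQc)
      have i1 : Integrable (fun x ↦ deriv Ψ (w s x) * η k x ^ 2 * (g.dalembertian (w s) x
          - g.innerDual x (mvfderiv (𝓡 n) V x).toLinearMap (mvfderiv (𝓡 n) (w s) x).toLinearMap) *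
          Real.exp (-V x)) μ :=
        integrable_of_continuous_of_hasCompactSupport' hg
          (((hψwc.mul ((hηs k).continuous.pow 2)).mul hLwc).mul hexpc)
          ((((hη2c k).mul_left).mul_right).mul_right)
      have i2 : Integrable (fun x ↦ deriv Ψ (w s x) * η k x ^ 2 * (ex s * (2 * K * Q s x
          + 2 * g.innerDual x (mvfderiv (𝓡 n) (ρ s) x).toLinearMap
            (mvfderiv (𝓡 n) (fun y ↦ g.dalembertian (ρ s) y
              - g.innerDual y (mvfderiv (𝓡 n) V y).toLinearMap (mvfderiv (𝓡 n) (ρ s) y).toLinearMap)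
              x).toLinearMap
          - (g.dalembertian (Q s) x - g.innerDual x (mvfderiv (𝓡 n) V x).toLinearMap
              (mvfderiv (𝓡 n) (Q s) x).toLinearMap))) * Real.exp (-V x)) μ :=
        integrable_of_continuous_of_hasCompactSupport' hg
          (((hψwc.mul ((hηs k).continuous.pow 2)).mul hsrcc).mul hexpc)
          ((((hη2c k).mul_left).mul_right).mul_right)
      rw [← integral_add i1 i2]
      refine integral_congr_ae (Eventually.of_forall fun x ↦ ?_)
      simp only [hF', hh, hLc x]
      ring
    have e2 : 2 * CT * Z k s ≥ 2 * ex s * ∫ x, deriv Ψ (ex s * g.gradSq (ρ s) x + -G₀) *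
        (g.gradSq (η k) x * g.gradSq (ρ s) x) * Real.exp (-V x) ∂μ := by
      have hZ1 : ∫ x, deriv Ψ (ex s * g.gradSq (ρ s) x + -G₀) *
          (g.gradSq (η k) x * g.gradSq (ρ s) x) * Real.exp (-V x) ∂μ ≤ Z k s := by
        have hρss := hρs s hsO
        have hψwc : Continuous fun x ↦ deriv Ψ (w s x) := hΨ'c.comp (hws s hsO).continuous
        have i3 : Integrable (fun x ↦ deriv Ψ (ex s * g.gradSq (ρ s) x + -G₀) *
            (g.gradSq (η k) x * g.gradSq (ρ s) x) * Real.exp (-V x)) μ :=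
          integrable_of_continuous_of_hasCompactSupport' hg
            ((hψwc.mul ((hgradηc k).mul (contMDiff_gradSq g hρss).continuous)).mul hexpc)
            ((((hgradηs k).mul_right).mul_left).mul_right)
        have i4 : Integrable (fun x ↦ Q s x * wZ k x) μ :=
          integrable_of_continuous_of_hasCompactSupport' hg
            ((contMDiff_gradSq g hρss).continuous.mul (hwZc k)) ((hwZs k).mul_left)
        refine integral_mono i3 i4 fun x ↦ ?_
        have hq : 0 ≤ g.gradSq (η k) x * g.gradSq (ρ s) x * Real.exp (-V x) :=
          mul_nonneg (mul_nonneg (g.gradSq_nonneg hg _ _) (g.gradSq_nonneg hg _ _)) (Real.exp_pos _).le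
        have h1 := (hΨ' (ex s * g.gradSq (ρ s) x + -G₀)).2
        calc deriv Ψ (ex s * g.gradSq (ρ s) x + -G₀) * (g.gradSq (η k) x * g.gradSq (ρ s) x) *
              Real.exp (-V x)
            = deriv Ψ (ex s * g.gradSq (ρ s) x + -G₀) *
                (g.gradSq (η k) x * g.gradSq (ρ s) x * Real.exp (-V x)) := by ring
          _ ≤ 1 * (g.gradSq (η k) x * g.gradSq (ρ s) x * Real.exp (-V x)) :=
              mul_le_mul_of_nonneg_right h1 hq
          _ = Q s x * wZ k x := by simp only [hQdef, hwZ]; ring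
      have hI0 : 0 ≤ ∫ x, deriv Ψ (ex s * g.gradSq (ρ s) x + -G₀) *
          (g.gradSq (η k) x * g.gradSq (ρ s) x) * Real.exp (-V x) ∂μ :=
        integral_nonneg fun x ↦ mul_nonneg (mul_nonneg (hΨ' _).1
          (mul_nonneg (g.gradSq_nonneg hg _ _) (g.gradSq_nonneg hg _ _))) (Real.exp_pos _).le
      have h3 : 2 * ex s ≤ 2 * CT := by linarith [hexT s hs]
      nlinarith [mul_le_mul h3 hZ1 hI0 (by positivity), hZ0 k s]
    rw [e1]
    exact step.trans e2
  -- integrating in time: `E k s₀ ≤ 2 CT C₀/(k+1)² B`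
  set ν : Measure (M × ℝ) := (μ.prod (volume : Measure ℝ)).restrict (univ ×ˢ Ioo 0 T) with hν
  set B : ℝ := ∫ p, g.gradSq (ρ p.2) p.1 * Real.exp (-V p.1) ∂ν with hB
  have hB0 : 0 ≤ B := integral_nonneg fun p ↦ mul_nonneg (g.gradSq_nonneg hg _ _) (Real.exp_pos _).le
  have hCT0 : 0 ≤ CT := (Real.exp_pos _).le
  have hCk : ∀ k : ℕ, 0 ≤ C₀ / ((k : ℝ) + 1) ^ 2 := fun k ↦ (g.gradSq_nonneg hg _ x₀).trans (hηgrad k x₀)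
  have hE0 : ∀ k, E k 0 = 0 := fun k ↦ by
    refine integral_eq_zero_of_ae (ae_of_all _ fun x ↦ ?_)
    have hw0 : w 0 x ≤ 0 := by
      simp only [hwdef, hQdef, hex, mul_zero, Real.exp_zero, one_mul]
      linarith [hG₀ x]
    simp [hF, hΨneg _ hw0]
  have hEbound : ∀ k, E k s₀ ≤ 2 * CT * (C₀ / ((k : ℝ) + 1) ^ 2 * B) := by
    intro k
    rcases eq_or_lt_of_le hs₀.1 with h0 | hpos
    · rw [← h0, hE0 k]
      exact mul_nonneg (mul_nonneg (by norm_num) hCT0) (mul_nonneg (hCk k) hB0)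
    · have hIcc : Icc 0 s₀ ⊆ O := fun s hs ↦ hTO ⟨hs.1, hs.2.trans hs₀.2⟩
      have hderiv : ∀ s ∈ uIcc 0 s₀, HasDerivAt (E k) (E' k s) s := by
        intro s hs
        rw [uIcc_of_le hs₀.1] at hs
        exact hEd k s (hIcc hs)
      have hE'i : IntervalIntegrable (E' k) volume 0 s₀ :=
        ((hE'c k).mono (by rw [uIcc_of_le hs₀.1]; exact hIcc)).intervalIntegrable
      have hZi : IntervalIntegrable (Z k) volume 0 s₀ :=
        ((hZc k).mono (by rw [uIcc_of_le hs₀.1]; exact hIcc)).intervalIntegrable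
      have hZi2 : IntervalIntegrable (fun s ↦ 2 * CT * Z k s) volume 0 s₀ := hZi.const_mul (2 * CT)
      have hFTC := intervalIntegral.integral_eq_sub_of_hasDerivAt hderiv hE'i
      -- Fubini on the strip `M × (0, s₀)` for `Z k`, then compare with `B`
      set ν' : Measure (M × ℝ) := (μ.prod (volume : Measure ℝ)).restrict (univ ×ˢ Ioo 0 s₀) with hν'
      have hZF : ∫ p, Q p.2 p.1 * wZ k p.1 ∂ν' = ∫ s in (0 : ℝ)..s₀, Z k s :=
        integral_strip_eq_intervalIntegral μ hs₀.1
          (integrable_strip_mul_of_hasCompactSupport μ (hQj.continuousOn.mono (prod_mono le_rfl hIcc))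
            (hwZc k) (hwZs k))
      have hsub : (univ : Set M) ×ˢ Ioo (0 : ℝ) s₀ ⊆ (univ : Set M) ×ˢ Ioo 0 T :=
        prod_mono le_rfl (Ioo_subset_Ioo le_rfl hs₀.2)
      have hint' : Integrable (fun p : M × ℝ ↦ g.gradSq (ρ p.2) p.1 * Real.exp (-V p.1)) ν' :=
        hint.mono_measure (Measure.restrict_mono hsub le_rfl)
      have hbd : ∀ p : M × ℝ, ‖Q p.2 p.1 * wZ k p.1‖ ≤
          C₀ / ((k : ℝ) + 1) ^ 2 * (g.gradSq (ρ p.2) p.1 * Real.exp (-V p.1)) := by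
        intro p
        rw [Real.norm_eq_abs, abs_of_nonneg (mul_nonneg (g.gradSq_nonneg hg _ _)
          (mul_nonneg (g.gradSq_nonneg hg _ _) (Real.exp_pos _).le))]
        change g.gradSq (ρ p.2) p.1 * (g.gradSq (η k) p.1 * Real.exp (-V p.1)) ≤ _
        have h2 := hηgrad k p.1
        have hq : 0 ≤ g.gradSq (ρ p.2) p.1 * Real.exp (-V p.1) :=
          mul_nonneg (g.gradSq_nonneg hg _ _) (Real.exp_pos _).le
        calc g.gradSq (ρ p.2) p.1 * (g.gradSq (η k) p.1 * Real.exp (-V p.1))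
            = g.gradSq (η k) p.1 * (g.gradSq (ρ p.2) p.1 * Real.exp (-V p.1)) := by ring
          _ ≤ C₀ / ((k : ℝ) + 1) ^ 2 * (g.gradSq (ρ p.2) p.1 * Real.exp (-V p.1)) :=
              mul_le_mul_of_nonneg_right h2 hq
      have hstrip_le : ∫ p, Q p.2 p.1 * wZ k p.1 ∂ν' ≤ C₀ / ((k : ℝ) + 1) ^ 2 * B := by
        calc ∫ p, Q p.2 p.1 * wZ k p.1 ∂ν' ≤ ∫ p, ‖Q p.2 p.1 * wZ k p.1‖ ∂ν' :=
              (Real.le_norm_self _).trans (norm_integral_le_integral_norm _)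
          _ ≤ ∫ p, C₀ / ((k : ℝ) + 1) ^ 2 * (g.gradSq (ρ p.2) p.1 * Real.exp (-V p.1)) ∂ν' :=
              integral_mono_of_nonneg (Eventually.of_forall fun p ↦ norm_nonneg _) (hint'.const_mul _)
                (Eventually.of_forall hbd)
          _ = C₀ / ((k : ℝ) + 1) ^ 2 * ∫ p, g.gradSq (ρ p.2) p.1 * Real.exp (-V p.1) ∂ν' :=
              integral_const_mul _ _
          _ ≤ C₀ / ((k : ℝ) + 1) ^ 2 * B := by
              refine mul_le_mul_of_nonneg_left ?_ (hCk k)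
              exact integral_mono_measure (Measure.restrict_mono hsub le_rfl)
                (Eventually.of_forall fun p ↦ mul_nonneg (g.gradSq_nonneg hg _ _) (Real.exp_pos _).le) hint
      calc E k s₀ = ∫ s in (0 : ℝ)..s₀, E' k s := by rw [hFTC, hE0, sub_zero]
        _ ≤ ∫ s in (0 : ℝ)..s₀, 2 * CT * Z k s :=
            intervalIntegral.integral_mono_on hs₀.1 hE'i hZi2 fun s hs ↦ hE'le k s ⟨hs.1, hs.2.trans hs₀.2⟩
        _ = 2 * CT * ∫ s in (0 : ℝ)..s₀, Z k s := intervalIntegral.integral_const_mul _ _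
        _ = 2 * CT * ∫ p, Q p.2 p.1 * wZ k p.1 ∂ν' := by rw [hZF]
        _ ≤ 2 * CT * (C₀ / ((k : ℝ) + 1) ^ 2 * B) := mul_le_mul_of_nonneg_left hstrip_le (by positivity)
  -- the bound tends to `0`
  have hlim : Tendsto (fun k : ℕ ↦ 2 * CT * (C₀ / ((k : ℝ) + 1) ^ 2 * B)) atTop (𝓝 0) := by
    have h1 : Tendsto (fun k : ℕ ↦ ((k : ℝ) + 1) ^ 2) atTop atTop :=
      (tendsto_pow_atTop two_ne_zero).comp
        (tendsto_atTop_add_const_right _ 1 (tendsto_natCast_atTop_atTop (R := ℝ)))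
    have h2 : Tendsto (fun k : ℕ ↦ C₀ / ((k : ℝ) + 1) ^ 2) atTop (𝓝 0) :=
      tendsto_const_nhds.div_atTop h1
    simpa using (h2.mul_const B).const_mul (2 * CT)
  -- every energy vanishes at `s₀`
  have hs₀O := hTO hs₀
  have hFsc : Continuous (F s₀) := hΨc.comp (hws s₀ hs₀O).continuous
  have hF0 : ∀ x, 0 ≤ F s₀ x := fun x ↦ (hΨbd _).1
  have hEi : ∀ k, Integrable (fun x ↦ F s₀ x * h k x) μ := fun k ↦
    integrable_of_continuous_of_hasCompactSupport' hg (hFsc.mul (hhc k)) ((hhs k).mul_left)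
  have hEmono : ∀ k j, k ≤ j → E k s₀ ≤ E j s₀ := by
    intro k j hkj
    refine integral_mono (hEi k) (hEi j) fun x ↦ ?_
    have hηle : η k x ≤ η j x := (monotone_nat_of_le_succ fun m ↦ hηmono m x) hkj
    have hη2le : η k x ^ 2 ≤ η j x ^ 2 := pow_le_pow_left₀ (hη01 k x).1 hηle 2
    exact mul_le_mul_of_nonneg_left (mul_le_mul_of_nonneg_right hη2le (Real.exp_pos _).le) (hF0 x)
  have hEzero : ∀ k, E k s₀ = 0 := by
    intro k
    refine le_antisymm ?_ (integral_nonneg fun x ↦ mul_nonneg (hF0 x) (hh0 k x))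
    exact ge_of_tendsto hlim (eventually_atTop.2 ⟨k, fun j hj ↦ (hEmono k j hj).trans (hEbound j)⟩)
  -- conclusion at `x₀`
  obtain ⟨k, hk1⟩ := (hη1 x₀).exists
  have hcont : Continuous fun x ↦ F s₀ x * h k x := hFsc.mul (hhc k)
  have hnn : 0 ≤ fun x ↦ F s₀ x * h k x := fun x ↦ mul_nonneg (hF0 x) (hh0 k x)
  have hae := (integral_eq_zero_iff_of_nonneg hnn (hEi k)).1 (hEzero k)
  have heq0 := (hcont.ae_eq_iff_eq μ continuous_const).1 hae
  have hx : F s₀ x₀ * h k x₀ = 0 := congr_fun heq0 x₀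
  have hpos : 0 < h k x₀ := by simp only [hh, hk1, one_pow, one_mul]; exact Real.exp_pos _
  have hΨ0 : Ψ (w s₀ x₀) = 0 := by
    rcases mul_eq_zero.1 hx with h0 | h0
    · exact h0
    · exact absurd h0 hpos.ne'
  have hwle : w s₀ x₀ ≤ 0 := hΨzero _ hΨ0
  -- `e^{2Ks₀}|∇ρ(s₀)|² ≤ G₀`
  have hle : ex s₀ * g.gradSq (ρ s₀) x₀ ≤ G₀ := by
    simp only [hwdef, hQdef] at hwle; linarith
  have hexpos : 0 < ex s₀ := Real.exp_pos _
  have hinv : Real.exp (-2 * K * s₀) * ex s₀ = 1 := by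
    simp only [hex, ← Real.exp_add]; rw [show -2 * K * s₀ + 2 * K * s₀ = 0 by ring, Real.exp_zero]
  calc g.gradSq (ρ s₀) x₀ = Real.exp (-2 * K * s₀) * (ex s₀ * g.gradSq (ρ s₀) x₀) := by
        rw [← mul_assoc, hinv, one_mul]
    _ ≤ Real.exp (-2 * K * s₀) * G₀ := mul_le_mul_of_nonneg_left hle (Real.exp_pos _).le

end Gradient

end Literature.Geometry.Riemannian.BakryEmeryComplete

end Part9

/-!
## Part 10 — port of `Summits/SmoothPoincare4/SmoothPoincare4/Theorems/EntropyRungBakryEmeryLogSobolevAPriori.lean` (1 declarations kept)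

# A-priori bounds for the energy-class weighted heat flow on a complete `CD(K,∞)` manifold

Setting: `M` modelled on `ℝⁿ` (Hausdorff, second countable, `T₃`, Borel — NOT compact), `g` Riemannian with
its Levi-Civita connection, `V` smooth (NO growth assumption), `Ric_g + Hess V ≥ K g`,
`L = Δ_g − g⁻¹(dV, d·)`, monotone Gaffney cut-offs `η_k`.

`gaffney_apriori` — for `u` smooth on `M × O` (`O ⊇ [0, T]` open) with `∂ₛu = Lu` on `[0, T]`,
`a ≤ u(0) ≤ b`, `a ≤ c ≤ b`, `(u − c)² e^{-V} ∈ L¹(M × (0,T))`, `(u(0) − c)² e^{-V} ∈ L¹(M)` and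
`|∇u(0)|² ≤ G₀`: `a ≤ u ≤ b` and `|∇u(s)|² ≤ e^{-2Ks} G₀` on `[0, T] × M`. The two-sided bound is the weak
maximum principle `gaffney_maxPrinciple` for `u − b` and `a − u` (`L(αu + β) = αLu`,
`(αu + β)₊² ≤ (u − c)²`); the gradient bound is `gaffney_gradientDecay`, whose integrability proviso
`|∇u|² e^{-V} ∈ L¹(M × (0,T))` is the energy inequality `gaffney_energyEstimate`.
Everything is proved; no definitions.

## References

* [Grigoryan2009] A. Grigor'yan (2009), §11.4 and §12.1 (uniqueness class / maximum principle).
* [BakryGentilLedoux2014] D. Bakry, I. Gentil, M. Ledoux (2014), Thm. 3.2.3/3.2.4 (pp. 143–146).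
-/

section Part10

open scoped _root_.Manifold _root_.ContDiff _root_.ENNReal _root_.NNReal _root_.Topology
open _root_.MeasureTheory _root_.Set _root_.Filter
open Literature.Geometry.Lorentzian Literature.Geometry.Riemannian

namespace Literature.Geometry.Riemannian.BakryEmeryComplete

open NoncompactShrinkerGapHeat NoncompactShrinkerGapHeat.CutoffToolkit

section APriori

variable {n : ℕ} {M : Type*} [TopologicalSpace M] [T2Space M] [SecondCountableTopology M]
  [ChartedSpace (EuclideanSpace ℝ (Fin n)) M] [IsManifold (𝓡 n) ∞ M] [T3Space M]
  [MeasurableSpace M] [BorelSpace M]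
  {g : PseudoRiemannianMetric (𝓡 n) ∞ (EuclideanSpace ℝ (Fin n)) (TangentSpace (𝓡 n) : M → Type _)}
  [g.HasLeviCivita]

/-- **A-priori bounds along the energy-class weighted heat flow** (see the module docstring):
two-sided bounds `a ≤ u ≤ b` and the Bakry–Émery gradient decay `|∇u(s)|² ≤ e^{-2Ks} G₀` on `[0,T] × M`.
[cite: Grigoryan2009, §11.4, §12.1] [cite: BakryGentilLedoux2014, Thm. 3.2.3/3.2.4 (pp. 143–146)] -/
theorem gaffney_apriori (hg : g.IsRiemannian) {V : M → ℝ} {K : ℝ} (hV : ContMDiff (𝓡 n) 𝓘(ℝ, ℝ) ∞ V)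
    (hRic : ∀ (y : M) (X : TangentSpace (𝓡 n) y), K * g.val y X X ≤ g.ricci y X X + g.hessian V y X X)
    {η : ℕ → M → ℝ} {C₀ : ℝ} (hηs : ∀ k, ContMDiff (𝓡 n) 𝓘(ℝ, ℝ) ∞ (η k))
    (hηc : ∀ k, HasCompactSupport (η k)) (hη01 : ∀ k x, 0 ≤ η k x ∧ η k x ≤ 1)
    (hηmono : ∀ k x, η k x ≤ η (k + 1) x) (hη1 : ∀ x, ∀ᶠ k in atTop, η k x = 1)
    (hηgrad : ∀ k x, g.gradSq (η k) x ≤ C₀ / ((k : ℝ) + 1) ^ 2)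
    {T : ℝ} {O : Set ℝ} {u : ℝ → M → ℝ} (hT : 0 < T) (hO : IsOpen O) (hTO : Icc 0 T ⊆ O)
    (hu : ContMDiffOn ((𝓡 n).prod 𝓘(ℝ, ℝ)) 𝓘(ℝ, ℝ) ∞ (fun p : M × ℝ ↦ u p.2 p.1) (univ ×ˢ O))
    (heq : ∀ s ∈ Icc 0 T, ∀ x, deriv (fun r ↦ u r x) s = g.dalembertian (u s) x
      - g.innerDual x (mvfderiv (𝓡 n) V x).toLinearMap (mvfderiv (𝓡 n) (u s) x).toLinearMap)
    {a b c G₀ : ℝ} (hac : a ≤ c) (hcb : c ≤ b) (h0ab : ∀ x, a ≤ u 0 x ∧ u 0 x ≤ b)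
    (hG₀ : ∀ x, g.gradSq (u 0) x ≤ G₀)
    (hint : Integrable (fun p : M × ℝ ↦ (u p.2 p.1 - c) ^ 2 * Real.exp (-V p.1))
      ((g.riemVolume.prod (volume : Measure ℝ)).restrict (univ ×ˢ Ioo 0 T)))
    (h0 : Integrable (fun x ↦ (u 0 x - c) ^ 2 * Real.exp (-V x)) g.riemVolume) :
    (∀ s ∈ Icc 0 T, ∀ x, a ≤ u s x ∧ u s x ≤ b) ∧
      ∀ s ∈ Icc 0 T, ∀ x, g.gradSq (u s) x ≤ Real.exp (-2 * K * s) * G₀ := by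
  set μ : Measure M := g.riemVolume with hμ
  set ν : Measure (M × ℝ) := (μ.prod (volume : Measure ℝ)).restrict (univ ×ˢ Ioo 0 T) with hν
  have hexpc : Continuous fun y ↦ Real.exp (-V y) := Real.continuous_exp.comp hV.continuous.neg
  -- regularity of `u`
  have hus : ∀ r ∈ O, ContMDiff (𝓡 n) 𝓘(ℝ, ℝ) ∞ (u r) := fun r hr ↦ contMDiff_slice_of_contMDiffOn hu hr
  have hud : ∀ r ∈ O, ∀ y, HasDerivAt (fun r' ↦ u r' y) (deriv (fun r' ↦ u r' y) r) r := fun r hr y ↦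
    CutoffToolkit.hasDerivAt_time hO hu y hr
  -- the maximum principle for the affine images `α u + β`
  have key : ∀ α β : ℝ, (∀ y, α * u 0 y + β ≤ 0) → (∀ r y, α * u r y + β ≤ |u r y - c|) →
      ∀ s ∈ Icc 0 T, ∀ x, α * u s x + β ≤ 0 := by
    intro α β hz0 hle
    set z : ℝ → M → ℝ := fun r y ↦ α * u r y + β with hz
    have hzs : ContMDiffOn ((𝓡 n).prod 𝓘(ℝ, ℝ)) 𝓘(ℝ, ℝ) ∞ (fun p : M × ℝ ↦ z p.2 p.1) (univ ×ˢ O) :=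
      (contMDiffOn_const.mul hu).add contMDiffOn_const
    have heqz : ∀ r ∈ Icc 0 T, ∀ y, deriv (fun r' ↦ z r' y) r = g.dalembertian (z r) y -
        g.innerDual y (mvfderiv (𝓡 n) V y).toLinearMap (mvfderiv (𝓡 n) (z r) y).toLinearMap := by
      intro r hr y
      have hrO := hTO hr
      have hd : HasDerivAt (fun r' ↦ z r' y) (α * deriv (fun r' ↦ u r' y) r) r :=
        ((hud r hrO y).const_mul α).add_const β
      have h2 : ContMDiffAt (𝓡 n) 𝓘(ℝ, ℝ) 2 (u r) y :=
        ((hus r hrO).of_le (WithTop.coe_le_coe.mpr le_top)).contMDiffAt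
      have hLz := weightedLaplacian_affine (g := g) (V := V) h2 α β
      rw [hd.deriv, show z r = fun y' ↦ α * u r y' + β from rfl, hLz, heq r hr y]
    have hint' : Integrable (fun p : M × ℝ ↦ max (z p.2 p.1) 0 ^ 2 * Real.exp (-V p.1)) ν := by
      refine hint.mono' ?_ (ae_of_all _ fun p ↦ ?_)
      · have hcont : ContinuousOn (fun p : M × ℝ ↦ max (z p.2 p.1) 0 ^ 2 * Real.exp (-V p.1)) (univ ×ˢ O) :=
          ((hzs.continuousOn.sup continuousOn_const).pow 2).mul (hexpc.comp continuous_fst).continuousOn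
        exact (hcont.mono (prod_mono le_rfl (Ioo_subset_Icc_self.trans hTO))).aestronglyMeasurable
          (MeasurableSet.univ.prod measurableSet_Ioo)
      · have hex := Real.exp_pos (-V p.1)
        have h1 : max (z p.2 p.1) 0 ≤ |u p.2 p.1 - c| := max_le (hle _ _) (abs_nonneg _)
        have h2 : max (z p.2 p.1) 0 ^ 2 ≤ (u p.2 p.1 - c) ^ 2 := by
          rw [← sq_abs (u p.2 p.1 - c)]
          exact pow_le_pow_left₀ (le_max_right _ _) h1 2
        rw [Real.norm_eq_abs, abs_of_nonneg (mul_nonneg (sq_nonneg _) hex.le)]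
        exact mul_le_mul_of_nonneg_right h2 hex.le
    exact gaffney_maxPrinciple hg hV hηs hηc hη01 hηmono hη1 hηgrad hO hTO hzs heqz hz0 hint'
  have hab : ∀ s ∈ Icc 0 T, ∀ x, a ≤ u s x ∧ u s x ≤ b := by
    intro s hs x
    refine ⟨?_, ?_⟩
    · have h := key (-1) a (fun y ↦ by linarith [(h0ab y).1])
        (fun r y ↦ by linarith [neg_abs_le (u r y - c)]) s hs x
      linarith
    · have h := key 1 (-b) (fun y ↦ by linarith [(h0ab y).2])
        (fun r y ↦ by linarith [le_abs_self (u r y - c)]) s hs x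
      linarith
  refine ⟨hab, ?_⟩
  -- the energy inequality gives `|∇u|² e^{-V} ∈ L¹(M × (0,T))`, then the gradient decay
  have hE := (gaffney_energyEstimate hg hV hηs hηc hη01 hη1 hηgrad hT hO hTO hu heq c hint h0).1
  exact gaffney_gradientDecay hg hV hRic hηs hηc hη01 hηmono hη1 hηgrad hO hTO hu heq hE hG₀

end APriori

end Literature.Geometry.Riemannian.BakryEmeryComplete

end Part10

/-!
## Part 11 — port of `Summits/SmoothPoincare4/SmoothPoincare4/Theorems/EntropyRungBakryEmeryLogSobolevMass.lean` (1 declarations kept)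

# Conservation of mass for the weighted heat flow on a complete manifold with first-order (Gaffney)
# cut-offs

Setting: `M` modelled on `ℝⁿ` (Hausdorff, second countable, `T₃`, Borel — NOT compact), `g` Riemannian with
its Levi-Civita connection, `V` smooth with `e^{-V} ∈ L¹` (NO further assumption), `L = Δ_g − g⁻¹(dV, d·)`,
Gaffney cut-offs `η_k` (`0 ≤ η_k ≤ 1`, `η_k(x) = 1` for large `k`, `|∇η_k|² ≤ C₀/(k+1)²`).

`gaffney_massConservation` — for `u` smooth on `M × O` (`O ⊇ [0, T]` open), `∂ₛu = Lu` on `[0, T]`, bounded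
(`|u| ≤ B`) with bounded gradient (`|∇u|² ≤ C_G`) on `[0, T]`: `∫ u(s) e^{-V} = ∫ u(0) e^{-V}` for
`s ∈ [0, T]`. With `F_k(s) = ∫ u(s) η_k² e^{-V}`: `F_k' = ∫ (Lu) η_k² e^{-V} = −2∫ η_k g⁻¹(dη_k, du) e^{-V}`
(`integral_mul_cutoffSq_mul_weightedLaplacian` with `a = 1`), `|F_k'| ≤ 2 √C₀/(k+1) √C_G ∫e^{-V}`, so
`|F_k(s) − F_k(0)| → 0`, while `F_k(s) → ∫ u(s) e^{-V}` (dominated convergence). No bound on `Lη_k` or on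
`Lu` is used (compare the shrinker toolkit's `helper_massConservation`). Everything is proved; no definitions.

## References

* [BakryGentilLedoux2014] D. Bakry, I. Gentil, M. Ledoux (2014), Thm. 3.2.6 (p. 147, mass conservation)
  with §3.2 (pp. 141–147: cut-offs `ζ_k`, `Γ(ζ_k) ≤ 1/k`).
* [Grigoryan2009] A. Grigor'yan (2009), Thm. 11.8 (stochastic completeness under finite volume).
-/

section Part11

open scoped _root_.Manifold _root_.ContDiff _root_.ENNReal _root_.NNReal _root_.Topology
open _root_.MeasureTheory _root_.Set _root_.Filter
open Literature.Geometry.Lorentzian Literature.Geometry.Riemannian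

namespace Literature.Geometry.Riemannian.BakryEmeryComplete

open NoncompactShrinkerGapHeat NoncompactShrinkerGapHeat.CutoffToolkit

section Mass

variable {n : ℕ} {M : Type*} [TopologicalSpace M] [T2Space M] [SecondCountableTopology M]
  [ChartedSpace (EuclideanSpace ℝ (Fin n)) M] [IsManifold (𝓡 n) ∞ M] [T3Space M] [MeasurableSpace M]
  [BorelSpace M]
  {g : PseudoRiemannianMetric (𝓡 n) ∞ (EuclideanSpace ℝ (Fin n)) (TangentSpace (𝓡 n) : M → Type _)}
  [g.HasLeviCivita]

/-- **Conservation of mass for bounded solutions with bounded gradient of the weighted heat flow on a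
complete manifold of finite weighted volume, with Gaffney cut-offs** (see the module docstring).
[cite: BakryGentilLedoux2014, Thm. 3.2.6 (p. 147) with §3.2 (pp. 141–147)] [cite: Grigoryan2009, Thm. 11.8] -/
theorem gaffney_massConservation (hg : g.IsRiemannian) {V : M → ℝ} (hV : ContMDiff (𝓡 n) 𝓘(ℝ, ℝ) ∞ V)
    (hw : Integrable (fun y ↦ Real.exp (-V y)) g.riemVolume)
    {η : ℕ → M → ℝ} {C₀ : ℝ} (hηs : ∀ k, ContMDiff (𝓡 n) 𝓘(ℝ, ℝ) ∞ (η k))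
    (hηc : ∀ k, HasCompactSupport (η k)) (hη01 : ∀ k x, 0 ≤ η k x ∧ η k x ≤ 1)
    (hη1 : ∀ x, ∀ᶠ k in atTop, η k x = 1)
    (hηgrad : ∀ k x, g.gradSq (η k) x ≤ C₀ / ((k : ℝ) + 1) ^ 2)
    {T : ℝ} {O : Set ℝ} {u : ℝ → M → ℝ} (hO : IsOpen O) (hTO : Icc 0 T ⊆ O)
    (hu : ContMDiffOn ((𝓡 n).prod 𝓘(ℝ, ℝ)) 𝓘(ℝ, ℝ) ∞ (fun p : M × ℝ ↦ u p.2 p.1) (univ ×ˢ O))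
    (heq : ∀ s ∈ Icc 0 T, ∀ x, deriv (fun r ↦ u r x) s = g.dalembertian (u s) x
      - g.innerDual x (mvfderiv (𝓡 n) V x).toLinearMap (mvfderiv (𝓡 n) (u s) x).toLinearMap)
    {B CG : ℝ} (hB : ∀ s ∈ Icc 0 T, ∀ x, |u s x| ≤ B) (hG : ∀ s ∈ Icc 0 T, ∀ x, g.gradSq (u s) x ≤ CG)
    {s : ℝ} (hs : s ∈ Icc 0 T) :
    ∫ x, u s x * Real.exp (-V x) ∂g.riemVolume = ∫ x, u 0 x * Real.exp (-V x) ∂g.riemVolume := by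
  haveI := CarrilloNi2009_shrinkerLSI.isFiniteMeasureOnCompacts_riemVolume hg
  set μ : Measure M := g.riemVolume with hμ
  have h0T : (0 : ℝ) ≤ T := hs.1.trans hs.2
  have h0 : (0 : ℝ) ∈ Icc 0 T := ⟨le_rfl, h0T⟩
  have hec : Continuous fun x ↦ Real.exp (-V x) := Real.continuous_exp.comp hV.continuous.neg
  have hslice : ∀ r ∈ O, ContMDiff (𝓡 n) 𝓘(ℝ, ℝ) ∞ (u r) := fun r hr ↦ contMDiff_slice_of_contMDiffOn hu hr
  have hρc : ContinuousOn (fun p : M × ℝ ↦ u p.2 p.1) (univ ×ˢ O) := hu.continuousOn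
  have hρ'c : ContinuousOn (fun p : M × ℝ ↦ deriv (fun r ↦ u r p.1) p.2) (univ ×ˢ O) :=
    continuousOn_deriv_time hO hu
  have hCG0 : ∀ x : M, 0 ≤ CG := fun x ↦ (g.gradSq_nonneg hg _ x).trans (hG 0 h0 x)
  have hC₀ : ∀ x : M, 0 ≤ C₀ := fun x ↦ by
    have h1 := hηgrad 0 x
    have h2 : 0 ≤ g.gradSq (η 0) x := g.gradSq_nonneg hg _ _
    rcases div_nonneg_iff.1 (h2.trans h1) with h | h
    · exact h.1
    · exact absurd h.2 (not_le.mpr (by positivity))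
  set W₀ : ℝ := ∫ x, Real.exp (-V x) ∂μ with hW₀
  have hW₀0 : 0 ≤ W₀ := integral_nonneg fun x ↦ (Real.exp_pos _).le
  -- the cut-off masses and the bound on their variation
  have hkey : ∀ k, |(∫ x, u s x * (η k x ^ 2 * Real.exp (-V x)) ∂μ)
      - ∫ x, u 0 x * (η k x ^ 2 * Real.exp (-V x)) ∂μ| ≤
      (2 * (Real.sqrt C₀ / ((k : ℝ) + 1)) * Real.sqrt CG * W₀) * s := by
    intro k
    have hη2c : HasCompactSupport (fun x ↦ η k x ^ 2) := by
      rw [show (fun x ↦ η k x ^ 2) = fun x ↦ η k x * η k x from funext fun x ↦ sq (η k x)]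
      exact (hηc k).mul_right
    have hwk : Continuous fun x ↦ η k x ^ 2 * Real.exp (-V x) := ((hηs k).continuous.pow 2).mul hec
    have hwkc : HasCompactSupport fun x ↦ η k x ^ 2 * Real.exp (-V x) := hη2c.mul_right
    set Fk : ℝ → ℝ := fun r ↦ ∫ x, u r x * (η k x ^ 2 * Real.exp (-V x)) ∂μ with hFk
    set Dk : ℝ → ℝ := fun r ↦ ∫ x, deriv (fun r' ↦ u r' x) r * (η k x ^ 2 * Real.exp (-V x)) ∂μ with hDk
    have hderiv : ∀ r ∈ O, HasDerivAt Fk (Dk r) r := fun r hr ↦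
      hasDerivAt_integral_mul_of_hasCompactSupport μ hwk hwkc hO hρc hρ'c (fun r hr x ↦ CutoffToolkit.hasDerivAt_time hO hu x hr) hr
    -- on `[0, T]` the derivative is `−2 ∫ η g(dη, du) e^{-V}`, bounded
    have hbound : ∀ r ∈ Ico (0 : ℝ) T, ‖Dk r‖ ≤ 2 * (Real.sqrt C₀ / ((k : ℝ) + 1)) * Real.sqrt CG * W₀ := by
      intro r hr
      have hr' : r ∈ Icc 0 T := Ico_subset_Icc_self hr
      have hus := hslice r (hTO hr')
      have hid := integral_mul_cutoffSq_mul_weightedLaplacian hg (a := fun _ : M ↦ (1 : ℝ)) contMDiff_const hus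
        (hηs k) (hηc k) hV
      have e1 : Dk r = ∫ x, (fun _ : M ↦ (1 : ℝ)) x * η k x ^ 2 * (g.dalembertian (u r) x
          - g.innerDual x (mvfderiv (𝓡 n) V x).toLinearMap (mvfderiv (𝓡 n) (u r) x).toLinearMap) *
            Real.exp (-V x) ∂μ := by
        refine integral_congr_ae (Eventually.of_forall fun x ↦ ?_)
        dsimp only
        rw [heq r hr' x]
        ring
      have e2 : ∫ x, η k x ^ 2 * g.innerDual x (mvfderiv (𝓡 n) (fun _ : M ↦ (1 : ℝ)) x).toLinearMap
          (mvfderiv (𝓡 n) (u r) x).toLinearMap * Real.exp (-V x) ∂μ = 0 := by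
        refine integral_eq_zero_of_ae (Eventually.of_forall fun x ↦ ?_)
        simp [mvfderiv_const, PseudoRiemannianMetric.innerDual]
      have h1le : (1 : ℕ∞ω) ≤ (∞ : ℕ∞ω) := WithTop.coe_le_coe.mpr le_top
      have hIc : Continuous fun x ↦ g.innerDual x (mvfderiv (𝓡 n) (η k) x).toLinearMap
          (mvfderiv (𝓡 n) (u r) x).toLinearMap := continuous_innerDual_mvfderiv g ((hηs k).of_le h1le) (hus.of_le h1le)
      have iX : Integrable (fun x ↦ (fun _ : M ↦ (1 : ℝ)) x * η k x * g.innerDual x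
          (mvfderiv (𝓡 n) (η k) x).toLinearMap (mvfderiv (𝓡 n) (u r) x).toLinearMap * Real.exp (-V x)) μ :=
        integrable_of_continuous_of_hasCompactSupport' hg (((continuous_const.mul (hηs k).continuous).mul hIc).mul hec)
          ((((hηc k).mul_left).mul_right).mul_right)
      have hpt : ∀ x, |(fun _ : M ↦ (1 : ℝ)) x * η k x * g.innerDual x
          (mvfderiv (𝓡 n) (η k) x).toLinearMap (mvfderiv (𝓡 n) (u r) x).toLinearMap * Real.exp (-V x)| ≤
          (Real.sqrt C₀ / ((k : ℝ) + 1)) * Real.sqrt CG * Real.exp (-V x) := by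
        intro x
        have hI := abs_innerDual_le_sqrt_gradSq_mul hg (η k) (u r) x
        have h2 : Real.sqrt (g.gradSq (η k) x) ≤ Real.sqrt C₀ / ((k : ℝ) + 1) := by
          have h := Real.sqrt_le_sqrt (hηgrad k x)
          rwa [Real.sqrt_div (hC₀ x), Real.sqrt_sq (by positivity)] at h
        have h3 : Real.sqrt (g.gradSq (u r) x) ≤ Real.sqrt CG := Real.sqrt_le_sqrt (hG r hr' x)
        have hηabs : |η k x| ≤ 1 := abs_le.2 ⟨by linarith [(hη01 k x).1], (hη01 k x).2⟩
        rw [abs_mul, abs_mul, abs_mul, abs_of_nonneg (Real.exp_pos _).le]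
        dsimp only
        rw [abs_one, one_mul]
        calc |η k x| * |g.innerDual x (mvfderiv (𝓡 n) (η k) x).toLinearMap
              (mvfderiv (𝓡 n) (u r) x).toLinearMap| * Real.exp (-V x)
            ≤ 1 * (Real.sqrt C₀ / ((k : ℝ) + 1) * Real.sqrt CG) * Real.exp (-V x) := by
              refine mul_le_mul_of_nonneg_right ?_ (Real.exp_pos _).le
              exact mul_le_mul hηabs (hI.trans (mul_le_mul h2 h3 (Real.sqrt_nonneg _) (by positivity)))
                (abs_nonneg _) zero_le_one
          _ = Real.sqrt C₀ / ((k : ℝ) + 1) * Real.sqrt CG * Real.exp (-V x) := by ring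
      rw [e1, hid, e2, neg_zero, zero_sub, norm_neg, norm_mul, Real.norm_eq_abs, Real.norm_eq_abs,
        show |(2 : ℝ)| = 2 by norm_num]
      calc 2 * |∫ x, (fun _ : M ↦ (1 : ℝ)) x * η k x * g.innerDual x (mvfderiv (𝓡 n) (η k) x).toLinearMap
            (mvfderiv (𝓡 n) (u r) x).toLinearMap * Real.exp (-V x) ∂μ|
          ≤ 2 * ∫ x, (Real.sqrt C₀ / ((k : ℝ) + 1)) * Real.sqrt CG * Real.exp (-V x) ∂μ := by
            refine mul_le_mul_of_nonneg_left ?_ (by norm_num)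
            exact abs_integral_le_integral_abs.trans (integral_mono iX.abs (hw.const_mul _) hpt)
        _ = 2 * (Real.sqrt C₀ / ((k : ℝ) + 1)) * Real.sqrt CG * W₀ := by rw [integral_const_mul]; ring
    have hmv := norm_image_sub_le_of_norm_deriv_le_segment' (f := Fk)
      (fun r hr ↦ (hderiv r (hTO hr)).hasDerivWithinAt) hbound s hs
    rw [sub_zero, Real.norm_eq_abs] at hmv
    exact hmv
  -- `k → ∞`
  have hsq1 : ∀ k x, η k x ^ 2 ≤ 1 := fun k x ↦ pow_le_one₀ (hη01 k x).1 (hη01 k x).2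
  have hlimF : ∀ r ∈ Icc 0 T, Tendsto (fun k ↦ ∫ x, u r x * (η k x ^ 2 * Real.exp (-V x)) ∂μ) atTop
      (𝓝 (∫ x, u r x * Real.exp (-V x) ∂μ)) := by
    intro r hr
    have hur := hslice r (hTO hr)
    refine tendsto_integral_of_dominated_convergence (fun x ↦ B * Real.exp (-V x))
      (fun k ↦ ((hur.continuous.mul (((hηs k).continuous.pow 2).mul hec)).aestronglyMeasurable))
      (hw.const_mul B) (fun k ↦ Eventually.of_forall fun x ↦ ?_) (Eventually.of_forall fun x ↦ ?_)
    · rw [Real.norm_eq_abs, abs_mul, abs_mul, abs_of_nonneg (sq_nonneg (η k x)), abs_of_nonneg (Real.exp_pos _).le]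
      calc |u r x| * (η k x ^ 2 * Real.exp (-V x)) ≤ B * (1 * Real.exp (-V x)) :=
            mul_le_mul (hB r hr x) (mul_le_mul_of_nonneg_right (hsq1 k x) (Real.exp_pos _).le)
              (mul_nonneg (sq_nonneg _) (Real.exp_pos _).le) ((abs_nonneg _).trans (hB r hr x))
        _ = B * Real.exp (-V x) := by ring
    · have h := (tendsto_cutoff_of_eventually_eq hη1 x).pow 2
      have h2 : Tendsto (fun k ↦ u r x * (η k x ^ 2 * Real.exp (-V x))) atTop
          (𝓝 (u r x * (1 ^ 2 * Real.exp (-V x)))) := (h.mul_const _).const_mul _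
      simpa using h2
  have hlimε : Tendsto (fun k : ℕ ↦ (2 * (Real.sqrt C₀ / ((k : ℝ) + 1)) * Real.sqrt CG * W₀) * s) atTop (𝓝 0) := by
    have h1 : Tendsto (fun k : ℕ ↦ (k : ℝ) + 1) atTop atTop :=
      tendsto_atTop_add_const_right _ 1 (tendsto_natCast_atTop_atTop (R := ℝ))
    have hδ : Tendsto (fun k : ℕ ↦ Real.sqrt C₀ / ((k : ℝ) + 1)) atTop (𝓝 0) := tendsto_const_nhds.div_atTop h1
    simpa using (((hδ.const_mul 2).mul_const (Real.sqrt CG)).mul_const W₀).mul_const s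
  have hdiff : Tendsto (fun k ↦ (∫ x, u s x * (η k x ^ 2 * Real.exp (-V x)) ∂μ)
      - ∫ x, u 0 x * (η k x ^ 2 * Real.exp (-V x)) ∂μ) atTop
      (𝓝 ((∫ x, u s x * Real.exp (-V x) ∂μ) - ∫ x, u 0 x * Real.exp (-V x) ∂μ)) :=
    (hlimF s hs).sub (hlimF 0 h0)
  have hzero : (∫ x, u s x * Real.exp (-V x) ∂μ) - ∫ x, u 0 x * Real.exp (-V x) ∂μ = 0 := by
    have habs := (continuous_abs.tendsto _).comp hdiff
    have hle : ∀ k, |(∫ x, u s x * (η k x ^ 2 * Real.exp (-V x)) ∂μ)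
        - ∫ x, u 0 x * (η k x ^ 2 * Real.exp (-V x)) ∂μ| ≤ (2 * (Real.sqrt C₀ / ((k : ℝ) + 1)) * Real.sqrt CG * W₀) * s :=
      hkey
    have h := le_of_tendsto_of_tendsto' habs hlimε hle
    exact abs_nonpos_iff.1 h
  linarith

end Mass

end Literature.Geometry.Riemannian.BakryEmeryComplete

end Part11

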